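import Summits.CriticalPhenomena.SAWScalingLimit.Theses.SAWDefectDecoherence
import Summits.CriticalPhenomena.SAWScalingLimit.Theses.SAWLatticeVirasoro
import Summits.CriticalPhenomena.SAWScalingLimit.Theorems.ObservableToSLE.Negative.Identification
import Summits.CriticalPhenomena.SAWScalingLimit.Theorems.SAWDefectDecoherenceObservableToSLEROrientation
import Summits.CriticalPhenomena.SAWScalingLimit.Theorems.SAWDefectDecoherenceObservableToSLEROrientationCoOrientedLattice
import Summits.CriticalPhenomena.SAWScalingLimit.Theorems.SAWDefectDecoherenceObservableToSLERGateDefs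
import Summits.CriticalPhenomena.SAWScalingLimit.Theorems.SAWDefectDecoherenceObservableToSLERGateDecomposition
import Summits.CriticalPhenomena.SAWScalingLimit.Theorems.SAWDefectDecoherenceObservableToSLERSLELawContinuity
import Summits.CriticalPhenomena.SAWScalingLimit.Theorems.SAWDefectDecoherenceObservableToSLERNestedGateDefs
import Summits.CriticalPhenomena.SAWScalingLimit.Theorems.SAWDefectDecoherenceObservableToSLERNestedLinkDefs
import Summits.CriticalPhenomena.SAWScalingLimit.Theorems.SAWDefectDecoherenceObservableToSLERMidTightN
import Summits.CriticalPhenomena.SAWScalingLimit.Theorems.SAWDefectDecoherenceObservableToSLERNestedTransferP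
import Summits.CriticalPhenomena.SAWScalingLimit.Theorems.SAWDefectDecoherenceObservableToSLERSeqReductionPM
import Summits.CriticalPhenomena.SAWScalingLimit.Theorems.SAWDefectDecoherenceObservableToSLERMidModulusN
import Summits.CriticalPhenomena.SAWScalingLimit.Theorems.SAWDefectDecoherenceObservableToSLERTwoPieceRestrictionLimit
import Summits.CriticalPhenomena.SAWScalingLimit.Theorems.SAWDevelopingMapObservableToSLETypeLadderCoOrientedReduction
import Summits.CriticalPhenomena.SAWScalingLimit.Theorems.SAWDevelopingMapObservableToSLETypeLadderNestedTransferPR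
import Summits.CriticalPhenomena.SAWScalingLimit.Theorems.SAWDevelopingMapObservableToSLETypeLadderCarvedReductionAssembly
import Summits.CriticalPhenomena.SAWScalingLimit.Theorems.SAWDevelopingMapObservableToSLETypeLadderTwoPieceAdmIdentification
import Summits.CriticalPhenomena.SAWScalingLimit.Theorems.SAWDefectDecoherenceObservableToSLERModulusOfSimpleLimits
import Summits.CriticalPhenomena.SAWScalingLimit.Theorems.SAWDevelopingMapObservableToSLETypeLadderCarvedReductionSqueezeRatio
import Summits.CriticalPhenomena.SAWScalingLimit.Theorems.SAWDevelopingMapObservableToSLETypeLadderCarvedReductionAssemblyP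
import Summits.CriticalPhenomena.SAWScalingLimit.Theorems.SAWDefectDecoherenceObservableToSLERCoOrientedReductionSolid
import Summits.CriticalPhenomena.SAWScalingLimit.Theorems.SAWDevelopingMapObservableToSLETypeLadderCarvedReductionSqueezeSelection
import Summits.CriticalPhenomena.SAWScalingLimit.Theorems.SAWDevelopingMapObservableToSLETypeLadderCarvedReductionSqueezeLattice
import Summits.CriticalPhenomena.SAWScalingLimit.Theorems.SAWDefectDecoherenceObservableToSLERMacroRestrictionLimit
import Summits.CriticalPhenomena.SAWScalingLimit.Theorems.SAWDevelopingMapObservableToSLETypeLadderCarvedReductionSqueezeConfinedOuterHull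
import Summits.CriticalPhenomena.SAWScalingLimit.Theorems.SAWDevelopingMapObservableToSLETypeLadderCarvedReductionSqueezeLattice2
import Summits.CriticalPhenomena.SAWScalingLimit.Theorems.SAWDevelopingMapObservableToSLETypeLadderCarvedReductionSqueezeDomainsCoreF
import Summits.CriticalPhenomena.SAWScalingLimit.Theorems.SAWDevelopingMapObservableToSLETypeLadderCarvedReductionSqueezeGeometry
import HarnessLib.Audit

/-!
# Line `bridge-gate-renewal` — crux `SAWDefectDecoherence.ObservableToSLER`
(stmt-CriticalPhenomena-14005; shared by routes SAWDefectDecoherence (primary), SAWPhaseRetrieval,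
SAWWindingAlias, SAWResidueField, SAWQuarterTwist; `Iff.rfl`-identical to the twin crux
stmt-CriticalPhenomena-10472 `SAWDevelopingMap.ObservableToSLE` — `Residue.observableToSLER_iff_observableToSLE`,
p129881 — so the two lines carry ONE skeleton: this file = the twin's `Cruxes/ObservableToSLE/Lines/six_class_type_ladder.lean`
up to the crux name, the route-hypothesis name `HexObservableLimitR` ≡ `HexObservableLimit` (same term) and this header)

## r16 (lead c4, 2026-08-17 ~13:45Z): THE SQUEEZE IS CLOSED — the twin landed T-A′₂F `TypeLadder.carvedReduction_squeezeGeometry_domainsCoreF`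
## (p162460) and the assembled T-A `TypeLadder.carvedReduction_squeezeGeometry` (p163006); wired here.  Every provable stub of the line has
## landed.  OPEN (3 sorries) = EXACTLY the three research ITEMS of the ledger: S1 `stub_nestedRenewalFatCoSolidR` = stmt-CriticalPhenomena-17698,
## T1⁻ `stub_macroSourceLocality` = stmt-CriticalPhenomena-17955, T5ₐ `stub_hexSimpleSubseqLimits` = stmt-CriticalPhenomena-7148.  The Theorems-level
## certificate is `Residue.observableToSLER_of_residue3 : S1 → T1⁻ → 7148 → ObservableToSLER` (this lead, landing now).

## r15 (lead c4, 2026-08-17 ~13:30Z) = the twin's r12 transposed + STAGE 2′ WIRED: T-A′₁ `stub_carvedReduction_confinedOuterHull` LANDED by the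
## twin (p147799, `TypeLadder.stub_carvedReduction_confinedOuterHull`; skelvet VET-r14 finding F1) and wired by import; the twin's wave-5 finding
## adopted: clause (MU) of the STAGE-1b/STAGE-2 interface ("∀ r > 0, eventually, pinned removed vertices r-off the gates are not in M") is
## UNSATISFIABLE for admissible data (one lattice pinning aligns only one gate row with its limit line), so (MU) becomes the fixed-radius (MU_F)
## at the window radius ρF in T-A′ and its glue, the leaf T-A′₂ is re-registered as `stub_carvedReduction_squeezeGeometry_domainsCoreF` (twin
## signature VERBATIM; the twin's worker is landing its final assembly: FinalA p162232, Outer p161852, …) and STAGE 2′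
## `stub_carvedReduction_squeezeGeometry_lattice2` (p137080 with (MU_F)) is LANDED by the twin (p154374,
## `TypeLadder.carvedReduction_squeezeGeometry_lattice2`) and wired here.  The weakened anchor T1⁻ is now ITEM stmt-CriticalPhenomena-17955
## `MacroSourceLocality` (twin strategist b1, 09:27Z).  OPEN (4 sorries): S1 (= item 17698, lead), T1⁻ (= item 17955), T5ₐ (= item 7148),
## T-A′₂F (provable, twin-held, final assembly landing).

## r14 (lead c3, 2026-08-17 ~08:30Z) = the twin's r11 transposed: T-A′ SPLIT as there — the twin's wave 4 landed the OUTER half of T-A′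
## (`TypeLadder.superSup` p146087 + 24 pieces) and consumed this line's inner-approximant contract p144792, so T-A′
## `stub_carvedReduction_squeezeGeometry_domains` is now GLUE over TWO registered provable leaves, T-A′₁ `stub_carvedReduction_confinedOuterHull`
## (M) and T-A′₂ `stub_carvedReduction_squeezeGeometry_domainsCore : T-A′₁ → T-A′` (L–XL), both twin-held (their wave 5); the anchor weakening
## of r13 is adopted on both sides (same T1⁻ leaf).  RESIDUE ITEMS EXIST (crux-strategist of 14005, 04:18Z): S1 = stmt-CriticalPhenomena-17698,
## T1 = stmt-CriticalPhenomena-17689 (old anchor; the r13 residue assembly `Residue.observableToSLER_of_residueMacro` shows T1⁻ suffices),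
## T5ₐ = stmt-CriticalPhenomena-7148.  OPEN (5 sorries): S1 (= item 17698), T1⁻ (research), T5ₐ (= item 7148), T-A′₁, T-A′₂ (provable, twin).

## RESHAPE r13 (lead c3, 2026-08-17 ~07:10Z): THE ANCHOR WEAKENED — T1/5a1 `stub_twoPieceSourceLocality` (K-uniform arch
## tightness; NOT implied by DCS Conj. 1 on bounded domains, twin Disproof §10.4) is replaced by the strictly weaker research stub
## T1⁻/5a1⁻ `stub_macroSourceLocality` (MACROSCOPIC source locality at one fixed radius, with the consumer's admissibility package
## as hypotheses; Conj.-1-locked in substance), SAME name + signature as the strategist line `macro-anchor-split` of the twin crux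
## (10472) so it is shared.  Justification LANDED: `Macro.stub_macroRestrictionLimit : HexObservableLimitR → T1⁻ → ARL″` and
## `Macro.macroSourceLocality_of_twoPieceSourceLocality : T1 → T1⁻` (p145850, Theorems/…ObservableToSLERMacroRestrictionLimit.lean,
## adapted from the strategist's workfile; imported — r13b, after an inlined interim while the farm rebuilt).
## `csiFatClassZeroSolid_of` now runs over `Macro.stub_macroRestrictionLimit`; nothing else
## moves.  OPEN (4 sorries): 2ʀ/S1 (research — the ONLY input not implied by Conj. 1), 5a1⁻/T1⁻ (research, Conj.1-locked),
## 5mₐ/T5ₐ (= item 7148, Conj.1-locked), T-A′ (provable, twin-held).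
## r12 (lead c3, 2026-08-17 ~06:40Z, after wave 5 = the twin's r10 transposed): OUR HALF OF 5a4″ IS LANDED — the inner
## approximant contract `Squeeze.stub_carvedReduction_innerApproximant` (= `InnerApproximant2`, p144792; parts traceInputs p144233,
## boundaryTrace p141203, liftExtension p140197, innerDomain p142050, Prep p142844, starImage p138659, oneSided p138896, fourPoint
## p139669; consumer lemma paramModulus p141485).  The v1 contract of the w3 plan was FALSE as typed (plate-domain witness, finding F6,
## `SQUEEZE_w5_plan.lean` on both items): near/far must be BY PARAMETER with hypotheses (H1)/(H2).  5a4″ is now, as in the twin's r10,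
## GLUE over the landed STAGE 1a (selection p137830), STAGE 2 (lattice p137080), T-B (ratio p131716) and ONE open provable leaf T-A′
## `stub_carvedReduction_squeezeGeometry_domains` (continuum geometry of the pinned frame; the twin's worker holds it and consumes the
## contract above for the inner domain + (C2)).  OPEN (4 sorries): 2ʀ/S1, 5a1/T1 (research), 5mₐ/T5ₐ (= item 7148), T-A′ (provable, twin).
## Noted for r13: the strategist line `macro-anchor-split` (10472, 04:25Z) weakens T1 to macroscopic source locality
## (`macroRestrictionLimit`, sorry-free in that skeleton) — adoptable here verbatim once landed as a Theorems file.

## r11 (lead c3, 2026-08-17 ~03:30Z, after wave 3): S2′ `stub_coOrientedReductionSolid` LANDED p134331 and wired; squeeze pieces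
## landed in wave 3: endcutNonSeparating p135382, legsToCrosscut p135598, noLongFingers p136284, boundaryLC p136433,
## oneSidedInjective p137110 (this line; the twin's T2b″ worker: Hexagons p133791, FamilyAscent p133885, FamilyGates p134188,
## Family p134423, Prob p134516, Faces p134609 + SPLIT glue(T-A,T-B) with T-B ratioSqueeze p131716).  Work split agreed with the
## twin lead c5 (NOTE2): their worker = T-A memo items 1–4, this line's = items 5–7 (inner approximant M′, inner family, frame).
## OPEN (4 sorries): 2ʀ, 5a1, 5mₐ (research / existing item) + 5a4″ (provable, two teams).

## RESHAPE r10 (continuation lead c3, 2026-08-17 ~01:30Z, after wave 2): FAT SPINES ADOPTED, T2c WIRED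

Both squeeze workers of wave 1 (this line's and the twin's) found independently that the r8/r9 squeeze stub 5a4′
`stub_carvedReduction_squeeze : ARL″ → MovingCarvingSqueeze` is not reachable by the fixed-domain restriction sandwich
because the family constraint admits DANGLING level pieces (a small level hexagon attached through O(1) corner cells,
floating in the limit: every fixed Jordan super-domain containing the carved centres contains its interior, and the
ratio is capped by `d(Q)^{5/8} < 1` — this line's report `SQUEEZE-report-w1.lean`, the twin's `T2bprime-PLAN.md`, both
attached to both items).  This line's worker also gave a cure inside the proof (excision: three ARL″'s, a thin channel,
kernel continuity twice), the twin lead c5 the cheaper family-side repair: the FAT-SPINE clause `FatSpine` (every level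
contains the closed ρ/8-neighbourhood of one compact connected spine through the root, and every level vertex lies in
a level hexagon dipping into the ρ/16-neighbourhood of the spine) — designer-cheap, rotation invariant, and it makes
the squeeze generic in the constraint (`MovingCarvingSqueezeP`).  r10 ADOPTS the twin's r6/r7 shape verbatim so that the
two skeletons stay identical: family constraint `FatAnchoredCoOrientedSolid`; stubs S1/2ʀ `stub_nestedRenewalFatCoSolidR`
(research, lead), T1/5a1 `stub_twoPieceSourceLocality` (research; no existing item implies it — `ANCHOR-5a1-audit.md`),
T5ₐ/5mₐ `stub_hexSimpleSubseqLimits` (= EXISTING item stmt-CriticalPhenomena-7148, `hexSimpleSubseqLimits_iff`), T2b″/5a4″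
`stub_carvedReduction_squeezeSolid` (provable; pieces landed on both cruxes, see below), S2′ `stub_coOrientedReductionSolid`
(provable, M: rotation covariance of the solid class), and T2c `stub_carvedReduction_assemblyP` — LANDED p130700 (twin
lead c5) and WIRED here.  So r10 has 5 `sorry`s: 2ʀ, 5a1, 5mₐ (research / existing item) + 5a4″, S2′ (provable, waved).

Squeeze pieces landed so far (all importable; namespaces `…Theorems.ObservableToSLER.Squeeze` (this line) and
`…Theorems.ObservableToSLE.TypeLadder` (twin)): derivFrame p129409, thinHullDeriv p129633, jordanApprox p130751,
twoPiecePush p131632, twoPieceEscape p131966, twoPieceInner p132284, twoPieceFamily p132946, pinning p133120,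
twoPieceFamilyDobrushin p133349, superDomainOfCrosscuts p133663 (this line); kernelComponent p128499, outerHull p128735,
collarDeriv p128980, cutDomain p129257, hullOfDomain p129374, reparam p129481, arcNonSeparating p129685, assemblyP p130700,
ratio p131716, shadow p132188, reverse p132576, escape p132758, inner p133010, select p133194, familyCore p133276 (twin).
Finding of this line's wave 2 (told to both items): the pinned frame DRIFTS (translated carved domains are (D−τ)−ε_j with
|ε_j| ~ gate-height error ≫ δ_j), so every fixed outer ARL-domain / super-domain must be cut from an OUTER Jordan
approximant `Dr r` (r > 1, jordanApprox p130751) of D − τ, not from D − τ itself.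

The RESIDUE ASSEMBLY `Residue.observableToSLER_of_residue` (p129881) records the r9 composition as a Theorems file
(crux from {2ʀ (r9 form), 5a1, item 7148, r9 squeeze stub}); its r10 analogue follows the same lines once 5a4″ and S2′ land.

HISTORY r1–r9: planner r1/r2 `Lines/bridge-gate-renewal.lean`; r5 @8b141745e9d8; r7 @ 18:39Z 08-16; r8/r9 (merger with the
twin, T5 split, 5m_b landed p127640) @c46f6da0ed52 / @4863d62dd208; crux `NOTES.md`; the twin's r1–r7 history is kept below.

Disproof.lean (tree copy v4 §1–§13; v6 §14 per its evidence note) honoured: §2 no `_false_without_` theorem exists (crux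
implied by its conclusion; both hypotheses consumed — `R` only inside 5a2 on class-`(0,0)` two-ball data, `HexTight` through
`MidTightN`, Prokhorov and 5m_b); §5/§7 — every use of `R` keeps rigid exact half-lattice balls at BOTH re-rooted points;
§8/§13 orientation silence — co-oriented classes reduce to `(0,0)` by rotation covariance, nonzero relative classes never
reach `R`; §10/§12/§14 concern δ-free global rows and fixed foliations, not ∃-families chosen after the mesh; the ∀R kill
(p124536) is answered by the R-bounded typing; the dangling-piece cap (wave 1) by fat spines.

(The twin's r1–r11 history, kept verbatim in r14 @aa467a704a65 of this file, is dropped from r15 for the 200 kB workfile cap;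
it is unchanged in `Cruxes/ObservableToSLE/Lines/six_class_type_ladder.lean`.)
-/

noncomputable section

open scoped BigOperators Topology NNReal ENNReal Classical BoundedContinuousFunction ComplexConjugate
open Filter Set MeasureTheory Metric
open Literature.Probability.LatticeModels (HexVertex hexGraph hexCenter triZeta triEmbed Site polyline)
open Literature.Probability.RandomPlanarGeometry
open Literature.Probability.RandomPlanarGeometry.SAW
open UpperHalfPlane (upperHalfPlaneSet)

namespace Summit.CriticalPhenomena.SAWScalingLimit.Cruxes.ObservableToSLER.BridgeGateRenewal

open Summit.CriticalPhenomena.SAWScalingLimit.Theses.SAWDefectDecoherence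
  (HexObservableLimitR HexTight ObservableToSLER)
open Summit.CriticalPhenomena.SAWScalingLimit.Theorems.ObservableToSLER.BridgeGate
open Summit.CriticalPhenomena.SAWScalingLimit.Theorems.ObservableToSLER.NestedGate

/-! ## The ladder's arithmetic (idea card; kept as the design rule for toothed families) -/

/-- The class shift of one rung through the three far sides of a half-hexagon: top `0`,
far-left `+1`, far-right `−1 = 5`. (NEW, from the idea Sketch.) -/
def rungShift : Fin 3 → Fin 6 := ![0, 1, 5]

/-- **Ladder reach** (idea Sketch, `decide`): for any two classes, two rungs at one end and one at
the other co-orient them — the cyclic distance on `Fin 6` is at most `3`.  Design rule: teeth of at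
most three generations in total offer a common class at both ends. -/
theorem ladderReach : ∀ ka kb : Fin 6, ∃ s₁ s₂ s₃ : Fin 3,
    ka + rungShift s₁ + rungShift s₂ = kb + rungShift s₃ := by
  decide

/-! ## Typed statements (r7 verbatim unless marked NEW) -/

/-- **EXACT TWO-GATE FACTORISATION** (r7 stub 1; landed p82259). -/
def GateDecomposition : Prop :=
  ∀ (Ω : Set ℂ) (δ : ℝ) (a b p q p' q' : HexVertex) (S T : Set HexVertex) (l₁ l₂ : List HexVertex)
    (B : Set (List HexVertex)),
    Disjoint S T →
    (∃ w₁ : (hexDomainGraph Ω δ).Walk a p, w₁.IsPath ∧ w₁.support = l₁ ∧ ∀ v ∈ l₁, v ∈ S) →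
    (∃ w₂ : (hexDomainGraph Ω δ).Walk p' b, w₂.IsPath ∧ w₂.support = l₂ ∧ ∀ v ∈ l₂, v ∈ T) →
    (hexDomainGraph Ω δ).Adj p q → (hexDomainGraph Ω δ).Adj q' p' →
    hexSAWWeight Ω δ a b
        {γ | ∃ mid ∈ B, mid.head? = some q ∧ mid.getLast? = some q' ∧
          (∀ v ∈ mid, v ∉ S ∧ v ∉ T) ∧ γ.walk.support = l₁ ++ mid ++ l₂} =
      ENNReal.ofReal (hexCriticalFugacity ^ (l₁.length + l₂.length)) *
        hexSAWWeight Ω δ q q'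
          {γ | γ.walk.support ∈ B ∧ ∀ v ∈ γ.walk.support, v ∉ S ∧ v ∉ T}

/-- **CLASS-ZERO WINDOWS** (r6/r7). -/
def ClassZeroWindows (Ω : Set ℂ) (δ ρ : ℝ) (S : ℕ → Set HexVertex) : Prop :=
  ∀ (n : ℕ) (p q : HexVertex), HasCleanWindow Ω δ ρ (S n) p q →
    rowOf 0 q = rowOf 0 p + 1 ∧
      ∀ x : HexVertex, (δ : ℂ) * hexCenter x ∈ ball ((δ : ℂ) * hexCenter q) ρ →
        (x ∈ S n ↔ rowOf 0 x ≤ rowOf 0 p)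

/-- **FAT LEVEL BODY UNDER EVERY CLEAN WINDOW, class-`0` form** (r7). -/
def FatUnderWindow (Ω : Set ℂ) (δ ρ : ℝ) (S : ℕ → Set HexVertex) (c : HexVertex) : Prop :=
  ∀ (n : ℕ) (p q : HexVertex), HasCleanWindow Ω δ ρ (S n) p q →
    ∃ K : Set ℂ, IsCompact K ∧ IsConnected K ∧
      (δ : ℂ) * hexCenter q - ((ρ / 2 : ℝ) : ℂ) * Complex.I ∈ K ∧ (δ : ℂ) * hexCenter c ∈ K ∧
      ∀ v : HexVertex, Metric.infDist ((δ : ℂ) * hexCenter v) K ≤ ρ / 4 → v ∈ S n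

/-- **r7's family constraint `FatAnchoredClassZero`** (the class the twin's identification stubs
speak about; the SOURCE of this line's transport stub S2). -/
def FatAnchoredClassZero : DobrushinDomain → (ℝ → HexVertex) → (ℝ → HexVertex) → ℝ → ℝ → ℝ → ℕ →
    (ℕ → Set HexVertex) → (ℕ → Set HexVertex) → Prop :=
  fun D a b δ ρ _ _ S T =>
    ((∀ n, ExteriorAnchored D.carrier δ (S n) (a δ)) ∧
      (∀ n, ExteriorAnchored D.carrier δ (T n) (b δ)) ∧
      ClassZeroWindows D.carrier δ ρ S ∧ ClassZeroWindows D.carrier δ ρ T) ∧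
    FatUnderWindow D.carrier δ ρ S (a δ) ∧ FatUnderWindow D.carrier δ ρ T (b δ)

/-- **CLASS-`k` WINDOWS (NEW).**  Every clean flat `ρ`-window of every level of `S` is of
orientation class `k`: the level lies in the signed rows `rowOf k · ≤ rowOf k p` and the far side is
the exact half-lattice `{rowOf k · ≥ rowOf k p + 1}` — the lattice clause of the co-oriented class
`(k, k)` of `R6co` (p114158). `ClassWindows 0 = ClassZeroWindows`. -/
def ClassWindows (k : Fin 6) (Ω : Set ℂ) (δ ρ : ℝ) (S : ℕ → Set HexVertex) : Prop :=
  ∀ (n : ℕ) (p q : HexVertex), HasCleanWindow Ω δ ρ (S n) p q →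
    rowOf k q = rowOf k p + 1 ∧
      ∀ x : HexVertex, (δ : ℂ) * hexCenter x ∈ ball ((δ : ℂ) * hexCenter q) ρ →
        (x ∈ S n ↔ rowOf k x ≤ rowOf k p)

/-- **FAT LEVEL BODY UNDER EVERY CLEAN WINDOW, class-`k` form (NEW)**: as `FatUnderWindow`, the
body passing through the point `δ c_q − (ρ/2)·i·ζ^k` at depth `ρ/2` on the LEVEL side of a class-`k`
window (for `k = 0`: straight below). -/
def FatUnderWindowK (k : Fin 6) (Ω : Set ℂ) (δ ρ : ℝ) (S : ℕ → Set HexVertex) (c : HexVertex) :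
    Prop :=
  ∀ (n : ℕ) (p q : HexVertex), HasCleanWindow Ω δ ρ (S n) p q →
    ∃ K : Set ℂ, IsCompact K ∧ IsConnected K ∧
      (δ : ℂ) * hexCenter q - ((ρ / 2 : ℝ) : ℂ) * Complex.I * triZeta ^ (k : ℕ) ∈ K ∧
      (δ : ℂ) * hexCenter c ∈ K ∧
      ∀ v : HexVertex, Metric.infDist ((δ : ℂ) * hexCenter v) K ≤ ρ / 4 → v ∈ S n

/-- **THE FAMILY CONSTRAINT OF THIS LINE (`FatAnchoredCoOriented`, NEW)**: exterior-anchored levels,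
and for ONE common class `j : Fin 6` (free per mesh — the designer's choice, reached by teeth of at
most three generations, `ladderReach`) class-`j` windows and class-`j` fat bodies at BOTH ends.
`FatAnchoredClassZero` is the instance `j = 0`. -/
def FatAnchoredCoOriented : DobrushinDomain → (ℝ → HexVertex) → (ℝ → HexVertex) → ℝ → ℝ → ℝ → ℕ →
    (ℕ → Set HexVertex) → (ℕ → Set HexVertex) → Prop :=
  fun D a b δ ρ _ _ S T =>
    (∀ n, ExteriorAnchored D.carrier δ (S n) (a δ)) ∧
      (∀ n, ExteriorAnchored D.carrier δ (T n) (b δ)) ∧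
      ∃ j : Fin 6,
        (ClassWindows j D.carrier δ ρ S ∧ ClassWindows j D.carrier δ ρ T) ∧
          FatUnderWindowK j D.carrier δ ρ S (a δ) ∧ FatUnderWindowK j D.carrier δ ρ T (b δ)

/-- **NESTED RENEWAL UNDER A FAMILY CONSTRAINT `P`** (r7). -/
def NestedRenewalP (P : DobrushinDomain → (ℝ → HexVertex) → (ℝ → HexVertex) → ℝ → ℝ → ℝ → ℕ →
      (ℕ → Set HexVertex) → (ℕ → Set HexVertex) → Prop) : Prop :=
  ∀ (D : DobrushinDomain) (a b : ℝ → HexVertex), IsEmbEndpointApprox hexGraph hexCenter D a b →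
    ∀ ε > (0 : ℝ), ∀ R > (0 : ℝ), ∃ ρ > (0 : ℝ), ∃ N : ℕ, ∀ᶠ δ : ℝ in 𝓝[>] 0,
      ∃ S T : ℕ → Set HexVertex,
        TameNestedFamily δ R N (a δ) S ∧ TameNestedFamily δ R N (b δ) T ∧
        P D a b δ ρ R N S T ∧
        hexSAWLaw D.carrier δ (a δ) (b δ)
            {γ | ¬ ∃ (n m : ℕ) (p q : HexVertex) (n' m' : ℕ) (p' q' : HexVertex),
                IsFirstGoodGateN D.carrier δ ρ R S (a δ) γ.walk.support n m p q ∧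
                IsFirstGoodGateN D.carrier δ ρ R T (b δ) γ.walk.support.reverse n' m' p' q' ∧
                WideLink D.carrier δ ρ (S n ∪ T n') q q'} ≤
          ENNReal.ofReal ε

/-- **NESTED RENEWAL WITH FAT CO-ORIENTED FAMILIES, r1/r2 typing (`NestedRenewalFatCo`)** — FALSE as
typed, like every `NestedRenewalP P` (landed certificate `TypeLadder.stub_not_nestedRenewalP`, p124536): the locality scale `R` is universally quantified, and for
`2R >` the diameter no wide escape exists.  Kept for the record; superseded by `NestedRenewalFatCoR`. -/
def NestedRenewalFatCo : Prop := NestedRenewalP FatAnchoredCoOriented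

/-- **NESTED RENEWAL UNDER A FAMILY CONSTRAINT `P`, LOCALITY SCALE BOUNDED (r3 typing, NEW):** as
`NestedRenewalP P` but the locality scale ranges over `(0, R₂]` for some `R₂ = R₂(D, a, b, ε) > 0` — the
only regime the nested transfer uses (it applies abundance at `R := min (R₀, R₁, R₂, η/(2(3K+1)))`). -/
def NestedRenewalPR (P : DobrushinDomain → (ℝ → HexVertex) → (ℝ → HexVertex) → ℝ → ℝ → ℝ → ℕ →
      (ℕ → Set HexVertex) → (ℕ → Set HexVertex) → Prop) : Prop :=
  ∀ (D : DobrushinDomain) (a b : ℝ → HexVertex), IsEmbEndpointApprox hexGraph hexCenter D a b →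
    ∀ ε > (0 : ℝ), ∃ R₂ > (0 : ℝ), ∀ R ∈ Set.Ioc (0 : ℝ) R₂, ∃ ρ > (0 : ℝ), ∃ N : ℕ, ∀ᶠ δ : ℝ in 𝓝[>] 0,
      ∃ S T : ℕ → Set HexVertex,
        TameNestedFamily δ R N (a δ) S ∧ TameNestedFamily δ R N (b δ) T ∧
        P D a b δ ρ R N S T ∧
        hexSAWLaw D.carrier δ (a δ) (b δ)
            {γ | ¬ ∃ (n m : ℕ) (p q : HexVertex) (n' m' : ℕ) (p' q' : HexVertex),
                IsFirstGoodGateN D.carrier δ ρ R S (a δ) γ.walk.support n m p q ∧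
                IsFirstGoodGateN D.carrier δ ρ R T (b δ) γ.walk.support.reverse n' m' p' q' ∧
                WideLink D.carrier δ ρ (S n ∪ T n') q q'} ≤
          ENNReal.ofReal ε

/-- **NESTED RENEWAL WITH FAT CO-ORIENTED FAMILIES, LOCALITY SCALE BOUNDED (`NestedRenewalFatCoR`, r3; THE
abundance input of the line — load-bearing, OPEN, research; implied by the twin's `NestedRenewalFat` once
that is re-typed the same way, `nestedRenewalFatCoR_of_fatR`).** -/
def NestedRenewalFatCoR : Prop := NestedRenewalPR FatAnchoredCoOriented

/-- **FAT SPINE (NEW in r6; the repair found by lead c5's T2b′ worker).**  Every level `S i` contains the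
closed `ρ/8`-neighbourhood (in rescaled lattice vertices) of ONE compact connected spine `K` through the rescaled
root, and every vertex of the level lies in a lattice hexagon inside the level that dips into the `ρ/16`-
neighbourhood of the spine: no DANGLING level piece (a piece attached through `O(1)` cells, floating in the
limit), for which the fixed-domain restriction sandwich of T2b is provably capped below `1`.  Designer-cheap
(teeth and roughening bumps are top slices of hexagons sunk `≥ ρ/16` into their parent), rotation invariant. -/
def FatSpine (δ ρ : ℝ) (S : ℕ → Set HexVertex) (c : HexVertex) : Prop :=
  ∀ i : ℕ, ∃ K : Set ℂ, IsCompact K ∧ IsConnected K ∧ (δ : ℂ) * hexCenter c ∈ K ∧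
    (∀ v : HexVertex, Metric.infDist ((δ : ℂ) * hexCenter v) K ≤ ρ / 8 → v ∈ S i) ∧
    (∀ v ∈ S i, ∃ (t w : HexVertex) (r : ℕ), v ∈ hexBall t r ∧ w ∈ hexBall t r ∧
      hexBall t r ⊆ S i ∧ Metric.infDist ((δ : ℂ) * hexCenter w) K ≤ ρ / 16)

/-- **`FatAnchoredClassZeroSolid` (NEW in r6)**: `FatAnchoredClassZero` with fat spines at both ends — the
class the repaired squeeze T2b″ and the generic assembly T2c speak about. -/
def FatAnchoredClassZeroSolid : DobrushinDomain → (ℝ → HexVertex) → (ℝ → HexVertex) → ℝ → ℝ → ℝ → ℕ →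
    (ℕ → Set HexVertex) → (ℕ → Set HexVertex) → Prop :=
  fun D a b δ ρ _ _ S T =>
    ((∀ n, ExteriorAnchored D.carrier δ (S n) (a δ)) ∧
      (∀ n, ExteriorAnchored D.carrier δ (T n) (b δ)) ∧
      ClassZeroWindows D.carrier δ ρ S ∧ ClassZeroWindows D.carrier δ ρ T) ∧
    FatUnderWindow D.carrier δ ρ S (a δ) ∧ FatUnderWindow D.carrier δ ρ T (b δ) ∧
    FatSpine δ ρ S (a δ) ∧ FatSpine δ ρ T (b δ)

/-- **THE FAMILY CONSTRAINT OF THIS LINE FROM r6 ON (`FatAnchoredCoOrientedSolid`, NEW)**: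
`FatAnchoredCoOriented` with fat spines at both ends (inside the `∃ j`, after the fat bodies). -/
def FatAnchoredCoOrientedSolid : DobrushinDomain → (ℝ → HexVertex) → (ℝ → HexVertex) → ℝ → ℝ → ℝ → ℕ →
    (ℕ → Set HexVertex) → (ℕ → Set HexVertex) → Prop :=
  fun D a b δ ρ _ _ S T =>
    (∀ n, ExteriorAnchored D.carrier δ (S n) (a δ)) ∧
      (∀ n, ExteriorAnchored D.carrier δ (T n) (b δ)) ∧
      ∃ j : Fin 6,
        (ClassWindows j D.carrier δ ρ S ∧ ClassWindows j D.carrier δ ρ T) ∧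
          FatUnderWindowK j D.carrier δ ρ S (a δ) ∧ FatUnderWindowK j D.carrier δ ρ T (b δ) ∧
          FatSpine δ ρ S (a δ) ∧ FatSpine δ ρ T (b δ)

/-- **NESTED RENEWAL WITH FAT CO-ORIENTED SOLID FAMILIES, LOCALITY SCALE BOUNDED (`NestedRenewalFatCoSolidR`,
r6; THE abundance input of the line — load-bearing, OPEN, research).** -/
def NestedRenewalFatCoSolidR : Prop := NestedRenewalPR FatAnchoredCoOrientedSolid

/-- **RADÓ CONTINUITY OF THE SLE(8/3) LAW** (r7; landed p81676). -/
def SLELawContinuity : Prop :=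
  ∀ (D : DobrushinDomain) (f : CurveClass ℂ →ᵇ ℝ) (ε : ℝ), 0 < ε → ∃ η > (0 : ℝ),
    ∀ (M : DobrushinDomain), (∀ t : ℝ, dist (M.boundary t) (D.boundary t) ≤ η) →
      dist (M.pt 0) (D.pt 0) ≤ η → dist (M.pt 1) (D.pt 1) ≤ η →
      ∀ μ ν : Measure (CurveClass ℂ), IsSLELaw ((8 : ℝ≥0) / 3) M μ → IsSLELaw ((8 : ℝ≥0) / 3) D ν →
        |∫ x, f x ∂μ - ∫ x, f x ∂ν| ≤ ε

/-- **CARVED MIDDLE PIECES CONVERGE TO SLE(8/3) OF THE TARGET under `P`** (r7). -/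
def CarvedToSLENP (P : DobrushinDomain → (ℝ → HexVertex) → (ℝ → HexVertex) → ℝ → ℝ → ℝ → ℕ →
      (ℕ → Set HexVertex) → (ℕ → Set HexVertex) → Prop) : Prop :=
  ∀ (D : DobrushinDomain) (a b : ℝ → HexVertex), IsEmbEndpointApprox hexGraph hexCenter D a b →
    ∀ (ν : Measure (CurveClass ℂ)), IsSLELaw ((8 : ℝ≥0) / 3) D ν →
    ∀ (f : CurveClass ℂ →ᵇ ℝ) (ε : ℝ), 0 < ε →
      ∃ R₀ > (0 : ℝ), ∀ R ∈ Set.Ioc (0 : ℝ) R₀, ∀ ρ > (0 : ℝ), ∀ N : ℕ,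
        ∀ᶠ δ : ℝ in 𝓝[>] 0, ∀ S T : ℕ → Set HexVertex,
          TameNestedFamily δ R N (a δ) S → TameNestedFamily δ R N (b δ) T →
          P D a b δ ρ R N S T →
          hexSAWLaw D.carrier δ (a δ) (b δ)
            {γ | ∃ (n m : ℕ) (p q : HexVertex) (n' m' : ℕ) (p' q' : HexVertex),
                IsFirstGoodGateN D.carrier δ ρ R S (a δ) γ.walk.support n m p q ∧
                IsFirstGoodGateN D.carrier δ ρ R T (b δ) γ.walk.support.reverse n' m' p' q' ∧
                WideLink D.carrier δ ρ (S n ∪ T n') q q' ∧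
                ε < |(∫ ξ, f ξ.curve ∂(carvedLaw D.carrier δ (S n ∪ T n') q q')) - ∫ x, f x ∂ν|} ≤
            ENNReal.ofReal ε

/-- **CARVED SEQUENTIAL IDENTIFICATION UNDER `P`, WITH TIGHTNESS AND MODULUS GIVEN (CSI-M)** (r7). -/
def CarvedSeqIdentificationPM (P : DobrushinDomain → (ℝ → HexVertex) → (ℝ → HexVertex) → ℝ → ℝ → ℝ → ℕ →
      (ℕ → Set HexVertex) → (ℕ → Set HexVertex) → Prop) : Prop :=
  ∀ (D : DobrushinDomain) (a b : ℝ → HexVertex), IsEmbEndpointApprox hexGraph hexCenter D a b →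
    ∀ (ν : Measure (CurveClass ℂ)), IsSLELaw ((8 : ℝ≥0) / 3) D ν →
    ∀ (f : CurveClass ℂ →ᵇ ℝ) (ε : ℝ), 0 < ε →
      ∃ R₀ > (0 : ℝ), ∀ R ∈ Set.Ioc (0 : ℝ) R₀, ∀ ρ > (0 : ℝ), ∀ N : ℕ,
        ∀ (δ : ℕ → ℝ) (S T : ℕ → ℕ → Set HexVertex) (n n' : ℕ → ℕ) (q q' : ℕ → HexVertex),
          Tendsto δ atTop (𝓝[>] 0) →
          (∀ k, TameNestedFamily (δ k) R N (a (δ k)) (S k) ∧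
            TameNestedFamily (δ k) R N (b (δ k)) (T k) ∧
            P D a b (δ k) ρ R N (S k) (T k)) →
          (∀ k, ∃ (γ : HexDomainSAW D.carrier (δ k) (a (δ k)) (b (δ k))) (m : ℕ) (p : HexVertex)
              (m' : ℕ) (p' : HexVertex),
            IsFirstGoodGateN D.carrier (δ k) ρ R (S k) (a (δ k)) γ.walk.support (n k) m p (q k) ∧
            IsFirstGoodGateN D.carrier (δ k) ρ R (T k) (b (δ k)) γ.walk.support.reverse
              (n' k) m' p' (q' k) ∧
            WideLink D.carrier (δ k) ρ (S k (n k) ∪ T k (n' k)) (q k) (q' k)) →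
          (∀ k, IsProbabilityMeasure
            (carvedLaw D.carrier (δ k) (S k (n k) ∪ T k (n' k)) (q k) (q' k))) →
          (∀ η > (0 : ℝ), ∃ 𝒦 : Set (CurveClass ℂ), IsCompact 𝒦 ∧ ∀ᶠ k in atTop,
            carvedLaw D.carrier (δ k) (S k (n k) ∪ T k (n' k)) (q k) (q' k)
              {ξ | ξ.curve ∉ 𝒦} ≤ ENNReal.ofReal η) →
          (∀ ε' > (0 : ℝ), ∀ η > (0 : ℝ), ∃ θ > (0 : ℝ), ∀ᶠ k in atTop,
            carvedLaw D.carrier (δ k) (S k (n k) ∪ T k (n' k)) (q k) (q' k)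
              {ξ | ξ.curve ∉ CurveClass.modulusClass ε' θ} ≤ ENNReal.ofReal η) →
          ∀ᶠ k in atTop,
            |(∫ ξ, f ξ.curve ∂(carvedLaw D.carrier (δ k) (S k (n k) ∪ T k (n' k)) (q k) (q' k))) -
                ∫ x, f x ∂ν| ≤ ε

/-- **AVERAGED TIGHTNESS OF THE CARVED MIDDLE PIECES** (r7; landed p116996). -/
def MidTightN : Prop :=
  ∀ (D : DobrushinDomain) (a b : ℝ → HexVertex), IsEmbEndpointApprox hexGraph hexCenter D a b →
    ∃ R₂ > (0 : ℝ), ∀ R ∈ Set.Ioc (0 : ℝ) R₂, ∀ ρ > (0 : ℝ), ∀ N : ℕ, ∀ η > (0 : ℝ),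
      ∃ 𝒦 : Set (CurveClass ℂ), IsCompact 𝒦 ∧
        ∀ᶠ δ : ℝ in 𝓝[>] 0, ∀ S T : ℕ → Set HexVertex,
          TameNestedFamily δ R N (a δ) S → TameNestedFamily δ R N (b δ) T →
          hexSAWLaw D.carrier δ (a δ) (b δ)
            {γ | ∃ (n m : ℕ) (p q : HexVertex) (n' m' : ℕ) (p' q' : HexVertex),
                IsFirstGoodGateN D.carrier δ ρ R S (a δ) γ.walk.support n m p q ∧
                IsFirstGoodGateN D.carrier δ ρ R T (b δ) γ.walk.support.reverse n' m' p' q' ∧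
                ENNReal.ofReal η <
                  carvedLaw D.carrier δ (S n ∪ T n') q q' {ξ | ξ.curve ∉ 𝒦}} ≤
            ENNReal.ofReal η

/-- **UNIFORM INJECTIVITY MODULUS OF THE CRITICAL HEXAGONAL SAW** (r7; OPEN). -/
def HexUniformModulus : Prop :=
  ∀ (D : DobrushinDomain) (a b : ℝ → HexVertex), IsEmbEndpointApprox hexGraph hexCenter D a b →
    ∀ ε > (0 : ℝ), ∀ η > (0 : ℝ), ∃ θ > (0 : ℝ), ∀ᶠ δ : ℝ in 𝓝[>] 0,
      hexSAWLaw D.carrier δ (a δ) (b δ) {γ | γ.curve ∉ CurveClass.modulusClass ε θ} ≤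
        ENNReal.ofReal η

/-- **AVERAGED MODULUS OF THE CARVED MIDDLE PIECES** (r7). -/
def MidModulusN : Prop :=
  ∀ (D : DobrushinDomain) (a b : ℝ → HexVertex), IsEmbEndpointApprox hexGraph hexCenter D a b →
    ∃ R₃ > (0 : ℝ), ∀ R ∈ Set.Ioc (0 : ℝ) R₃, ∀ ρ > (0 : ℝ), ∀ N : ℕ, ∀ ε > (0 : ℝ), ∀ η > (0 : ℝ),
      ∃ θ > (0 : ℝ),
        ∀ᶠ δ : ℝ in 𝓝[>] 0, ∀ S T : ℕ → Set HexVertex,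
          TameNestedFamily δ R N (a δ) S → TameNestedFamily δ R N (b δ) T →
          hexSAWLaw D.carrier δ (a δ) (b δ)
            {γ | ∃ (n m : ℕ) (p q : HexVertex) (n' m' : ℕ) (p' q' : HexVertex),
                IsFirstGoodGateN D.carrier δ ρ R S (a δ) γ.walk.support n m p q ∧
                IsFirstGoodGateN D.carrier δ ρ R T (b δ) γ.walk.support.reverse n' m' p' q' ∧
                ENNReal.ofReal η <
                  carvedLaw D.carrier δ (S n ∪ T n') q q'
                    {ξ | ξ.curve ∉ CurveClass.modulusClass ε θ}} ≤
            ENNReal.ofReal η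

/-- **Identification everywhere** (the `hid` hypothesis of `convergesInLawToSLE_of_identification`). -/
def FullIdentification : Prop :=
  ∀ (D : DobrushinDomain) (a b : ℝ → HexVertex),
    IsEmbEndpointApprox hexGraph hexCenter D a b →
    ∀ μ : Measure (CurveClass ℂ), IsProbabilityMeasure μ →
      IsSubseqLimitLaw (fun δ (γ : HexDomainSAW D.carrier δ (a δ) (b δ)) => γ.curve)
        (fun δ => hexSAWLaw D.carrier δ (a δ) (b δ)) μ →
      IsSLELaw ((8 : ℝ≥0) / 3) D μ

/-- **TWO-PIECE SOURCE LOCALITY (the ANCHOR; r7 5a1; OPEN).** -/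
def TwoPieceSourceLocality : Prop :=
  ∀ (E : DobrushinDomain) (ρ : ℝ) (Λ : ℝ → Finset HexVertex) (m₀ : ℝ → ℤ)
    (a : ℝ → Sym2 HexVertex),
    0 < ρ → E.carrier ∩ ball (E.pt 0) ρ = {z : ℂ | (E.pt 0).im < z.im} ∩ ball (E.pt 0) ρ →
    (∀ᶠ δ : ℝ in 𝓝[>] 0, hexDomainSimplyConnected (Λ δ) ∧ a δ ∈ hexDomainBoundary (Λ δ) ∧
      (∀ v ∈ Λ δ, (δ : ℂ) * hexCenter v ∈ E.carrier) ∧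
      (∀ v : HexVertex, (δ : ℂ) * hexCenter v ∈ ball (E.pt 0) ρ → (v ∈ Λ δ ↔ m₀ δ ≤ v.1 1))) →
    Tendsto (fun δ : ℝ => (δ : ℂ) * hexMidpoint (a δ)) (𝓝[>] 0) (𝓝 (E.pt 0)) →
    ∀ ε : ℝ, 0 < ε → ∃ K : ℝ, 0 < K ∧ ∃ t₀ : ℝ, 0 < t₀ ∧
      ∀ (s : ℝ → Sym2 HexVertex) (t : ℝ), t ≠ 0 → |t| < t₀ →
        (∀ᶠ δ : ℝ in 𝓝[>] 0, s δ ∈ hexDomainBoundary (Λ δ) ∧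
          (hexMidpoint (s δ)).im = (hexMidpoint (a δ)).im) →
        Tendsto (fun δ : ℝ => (δ : ℂ) * hexMidpoint (s δ)) (𝓝[>] 0) (𝓝 (E.pt 0 + t)) →
        ∀ᶠ δ : ℝ in 𝓝[>] 0,
          (∑ γ : HexMidEdgeSAW (Λ δ) (a δ) (s δ),
              if ∃ v ∈ γ.verts, K * |t| ≤ dist ((δ : ℂ) * hexCenter v) ((δ : ℂ) * hexMidpoint (a δ))
              then hexCriticalFugacity ^ γ.length else 0) ≤
            ε * ∑ γ : HexMidEdgeSAW (Λ δ) (a δ) (s δ), hexCriticalFugacity ^ γ.length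

/-- **MACROSCOPIC SOURCE LOCALITY (`MacroSourceLocality`, T1⁻, r11; the weakened anchor, = stub 2 of the strategist line
`macro-anchor-split` and the twin r13 leaf, same text): `TwoPieceSourceLocality` with the `K |t|`-threshold replaced by a fixed radius `r`
(`∀ ε > 0, ∀ r > 0, ∃ t₀ > 0, …`) and the full admissibility package (preconnectedness, compact exhaustion) in the hypotheses.  Implied by
`TwoPieceSourceLocality` (`Macro.macroSourceLocality_of_twoPieceSourceLocality`, p145850); sufficient for ARL″ (`Macro.stub_macroRestrictionLimit`).** -/
def MacroSourceLocality : Prop :=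
  ∀ (E : DobrushinDomain) (ρ : ℝ) (Λ : ℝ → Finset HexVertex) (m₀ : ℝ → ℤ)
    (a : ℝ → Sym2 HexVertex),
    0 < ρ → E.carrier ∩ ball (E.pt 0) ρ = {z : ℂ | (E.pt 0).im < z.im} ∩ ball (E.pt 0) ρ →
    (∀ᶠ δ : ℝ in 𝓝[>] 0, hexDomainSimplyConnected (Λ δ) ∧
      (hexGraph.induce (↑(Λ δ) : Set HexVertex)).Preconnected ∧ a δ ∈ hexDomainBoundary (Λ δ) ∧
      (∀ v ∈ Λ δ, (δ : ℂ) * hexCenter v ∈ E.carrier) ∧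
      (∀ v : HexVertex, (δ : ℂ) * hexCenter v ∈ ball (E.pt 0) ρ → (v ∈ Λ δ ↔ m₀ δ ≤ v.1 1))) →
    (∀ K : Set ℂ, IsCompact K → K ⊆ E.carrier →
      ∀ᶠ δ : ℝ in 𝓝[>] 0, ∀ v : HexVertex, (δ : ℂ) * hexCenter v ∈ K → v ∈ Λ δ) →
    Tendsto (fun δ : ℝ => (δ : ℂ) * hexMidpoint (a δ)) (𝓝[>] 0) (𝓝 (E.pt 0)) →
    ∀ ε : ℝ, 0 < ε → ∀ r : ℝ, 0 < r → ∃ t₀ : ℝ, 0 < t₀ ∧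
      ∀ (s : ℝ → Sym2 HexVertex) (t : ℝ), t ≠ 0 → |t| < t₀ →
        (∀ᶠ δ : ℝ in 𝓝[>] 0, s δ ∈ hexDomainBoundary (Λ δ) ∧
          (hexMidpoint (s δ)).im = (hexMidpoint (a δ)).im) →
        Tendsto (fun δ : ℝ => (δ : ℂ) * hexMidpoint (s δ)) (𝓝[>] 0) (𝓝 (E.pt 0 + t)) →
        ∀ᶠ δ : ℝ in 𝓝[>] 0,
          (∑ γ : HexMidEdgeSAW (Λ δ) (a δ) (s δ),
              if ∃ v ∈ γ.verts, r ≤ dist ((δ : ℂ) * hexCenter v) ((δ : ℂ) * hexMidpoint (a δ))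
              then hexCriticalFugacity ^ γ.length else 0) ≤
            ε * ∑ γ : HexMidEdgeSAW (Λ δ) (a δ) (s δ), hexCriticalFugacity ^ γ.length

/-- **TWO-PIECE ADMISSIBLE RESTRICTION LIMIT (ARL″; the entry point of the line into crux 10472's
landed chain).**  10472's `AdmissibleRestrictionLimit` with `IsFloorDomain` replaced by two-piece
flatness, a common free threshold `m₀ δ` in the ball at `pt 0` and SEPARATE free thresholds
`m₁ δ`, `m₁' δ` for `Λ ⊇ Λ'` in the ball at `pt 1`; conclusion
`Z_{Λ' δ}(a, b)/Z_{Λ δ}(a, b) → Φ'_A(0)^{5/8}` (LSW value). -/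
def TwoPieceAdmRestrictionLimit : Prop :=
  ∀ (D D' : DobrushinDomain) (ρ : ℝ) (φ : ConformalEquiv upperHalfPlaneSet D.carrier)
    (Φ : ConformalEquiv (upperHalfPlaneSet \ φ.pullbackHull D') upperHalfPlaneSet) (d : ℝ)
    (Λ Λ' : ℝ → Finset HexVertex) (m₀ m₁ m₁' : ℝ → ℤ) (a b : ℝ → Sym2 HexVertex),
    (0 < ρ ∧ ∀ i : Fin 2, D.carrier ∩ ball (D.pt i) ρ = {z : ℂ | (D.pt i).im < z.im} ∩ ball (D.pt i) ρ) →
    D.IsHullSubdomain D' → D.IsChordalUniformizing φ →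
    IsRestrictionMap (φ.pullbackHull D') Φ → HasRestrictionDeriv (φ.pullbackHull D') Φ d →
    (∀ᶠ δ : ℝ in 𝓝[>] 0,
      Λ' δ ⊆ Λ δ ∧ hexDomainSimplyConnected (Λ δ) ∧ hexDomainSimplyConnected (Λ' δ) ∧
      (hexGraph.induce (↑(Λ δ) : Set HexVertex)).Preconnected ∧
      (hexGraph.induce (↑(Λ' δ) : Set HexVertex)).Preconnected ∧
      a δ ∈ hexDomainBoundary (Λ δ) ∧ b δ ∈ hexDomainBoundary (Λ δ) ∧
      a δ ∈ hexDomainBoundary (Λ' δ) ∧ b δ ∈ hexDomainBoundary (Λ' δ) ∧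
      Nonempty (HexMidEdgeSAW (Λ' δ) (a δ) (b δ)) ∧
      (∀ v ∈ Λ δ, (δ : ℂ) * hexCenter v ∈ D.carrier) ∧
      (∀ v ∈ Λ' δ, (δ : ℂ) * hexCenter v ∈ D'.carrier) ∧
      (∀ v : HexVertex, (δ : ℂ) * hexCenter v ∈ ball (D.pt 0) ρ →
        ((v ∈ Λ δ ↔ m₀ δ ≤ v.1 1) ∧ (v ∈ Λ' δ ↔ m₀ δ ≤ v.1 1))) ∧
      (∀ v : HexVertex, (δ : ℂ) * hexCenter v ∈ ball (D.pt 1) ρ →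
        ((v ∈ Λ δ ↔ m₁ δ ≤ v.1 1) ∧ (v ∈ Λ' δ ↔ m₁' δ ≤ v.1 1)))) →
    (∀ K : Set ℂ, IsCompact K → K ⊆ D.carrier →
      ∀ᶠ δ : ℝ in 𝓝[>] 0, ∀ v : HexVertex, (δ : ℂ) * hexCenter v ∈ K → v ∈ Λ δ) →
    (∀ K : Set ℂ, IsCompact K → K ⊆ D'.carrier →
      ∀ᶠ δ : ℝ in 𝓝[>] 0, ∀ v : HexVertex, (δ : ℂ) * hexCenter v ∈ K → v ∈ Λ' δ) →
    Tendsto (fun δ : ℝ => (δ : ℂ) * hexMidpoint (a δ)) (𝓝[>] 0) (𝓝 (D.pt 0)) →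
    Tendsto (fun δ : ℝ => (δ : ℂ) * hexMidpoint (b δ)) (𝓝[>] 0) (𝓝 (D.pt 1)) →
    Tendsto (fun δ : ℝ =>
        (∑ γ : HexMidEdgeSAW (Λ' δ) (a δ) (b δ), hexCriticalFugacity ^ γ.length) /
          (∑ γ : HexMidEdgeSAW (Λ δ) (a δ) (b δ), hexCriticalFugacity ^ γ.length)) (𝓝[>] 0)
      (𝓝 (d ^ ((5 : ℝ) / 8)))

/-- **TWO-PIECE ADMISSIBLE IDENTIFICATION (fixed two-piece flat domain, GIVEN admissible family;
measure-free typing over the Duminil-Copin–Smirnov weights `x_c^{ℓ(γ)}` on mid-edge walks).**  For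
a two-piece flat Dobrushin domain `M` and an admissible family `Λ δ` in the sense of `R`: every
probability weak limit `μ` of the rescaled polylines under the DCS laws along meshes `s n → 0⁺` on
which the laws have a uniform injectivity modulus is chordal SLE(8/3) in `M`. -/
def TwoPieceAdmIdentification : Prop :=
  ∀ (M : DobrushinDomain) (ρ : ℝ) (Λ : ℝ → Finset HexVertex) (m : Fin 2 → ℝ → ℤ)
    (a b : ℝ → Sym2 HexVertex),
    (0 < ρ ∧ ∀ i : Fin 2, M.carrier ∩ ball (M.pt i) ρ = {z : ℂ | (M.pt i).im < z.im} ∩ ball (M.pt i) ρ) →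
    (∀ᶠ δ : ℝ in 𝓝[>] 0, hexDomainSimplyConnected (Λ δ) ∧ a δ ∈ hexDomainBoundary (Λ δ) ∧
      b δ ∈ hexDomainBoundary (Λ δ) ∧ Nonempty (HexMidEdgeSAW (Λ δ) (a δ) (b δ)) ∧
      (hexGraph.induce (↑(Λ δ) : Set HexVertex)).Preconnected ∧
      (∀ v ∈ Λ δ, (δ : ℂ) * hexCenter v ∈ M.carrier) ∧
      (∀ i : Fin 2, ∀ v : HexVertex, (δ : ℂ) * hexCenter v ∈ ball (M.pt i) ρ →
        (v ∈ Λ δ ↔ m i δ ≤ v.1 1))) →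
    (∀ K : Set ℂ, IsCompact K → K ⊆ M.carrier →
      ∀ᶠ δ : ℝ in 𝓝[>] 0, ∀ v : HexVertex, (δ : ℂ) * hexCenter v ∈ K → v ∈ Λ δ) →
    Tendsto (fun δ : ℝ => (δ : ℂ) * hexMidpoint (a δ)) (𝓝[>] 0) (𝓝 (M.pt 0)) →
    Tendsto (fun δ : ℝ => (δ : ℂ) * hexMidpoint (b δ)) (𝓝[>] 0) (𝓝 (M.pt 1)) →
    ∀ (μ : Measure (CurveClass ℂ)) (s : ℕ → ℝ), IsProbabilityMeasure μ →
      Tendsto s atTop (𝓝[>] 0) →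
      (∀ f : CurveClass ℂ →ᵇ ℝ,
        Tendsto (fun n =>
          (∑ γ : HexMidEdgeSAW (Λ (s n)) (a (s n)) (b (s n)),
              hexCriticalFugacity ^ γ.length *
                f (CurveClass.mk ⟨polyline (γ.verts.map fun v => ((s n : ℝ) : ℂ) * hexCenter v)⟩)) /
            (∑ γ : HexMidEdgeSAW (Λ (s n)) (a (s n)) (b (s n)), hexCriticalFugacity ^ γ.length))
          atTop (𝓝 (∫ x, f x ∂μ))) →
      (∀ ε η : ℝ, 0 < ε → 0 < η → ∃ θ : ℝ, 0 < θ ∧ ∀ᶠ n in atTop,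
        (∑ γ : HexMidEdgeSAW (Λ (s n)) (a (s n)) (b (s n)),
            if CurveClass.mk ⟨polyline (γ.verts.map fun v => ((s n : ℝ) : ℂ) * hexCenter v)⟩ ∉
                CurveClass.modulusClass ε θ
            then hexCriticalFugacity ^ γ.length else 0) ≤
          η * ∑ γ : HexMidEdgeSAW (Λ (s n)) (a (s n)) (b (s n)), hexCriticalFugacity ^ γ.length) →
      IsSLELaw ((8 : ℝ≥0) / 3) M μ

/-- **THE MOVING-CARVING SQUEEZE (`MovingCarvingSqueeze`, NEW in r4; designed and typed by the T2b stub-worker of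
lead c3, = the first hypothesis of the LANDED `TypeLadder.stub_carvedReduction_assembly`, p125956, verbatim):** items
(G1)–(G7) of the twin's audit of 5a4 — for every closeness level `η` a locality radius `R₀` such that, along every
sequence of fat class-zero tame carvings with realised gates and every subsequence, a further subsequence admits ONE
fixed two-piece flat Dobrushin domain `M`, `η`-close to `D` after translating back by `τ`, with a T2a-admissible
lattice family `Λ'`, lattice translations carrying `Λ'(δ_j)` onto a sub-family cell of the `j`-th carved law (gates
matching, no bad edge, misses `S ∪ T`) of carved mass `≥ 1 − ε'` eventually. -/
def MovingCarvingSqueeze : Prop :=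
    ∀ (D : DobrushinDomain) (a b : ℝ → HexVertex), IsEmbEndpointApprox hexGraph hexCenter D a b →
      ∀ η > (0 : ℝ), ∃ R₀ > (0 : ℝ), ∀ R ∈ Set.Ioc (0 : ℝ) R₀, ∀ ρ > (0 : ℝ), ∀ N : ℕ,
          ∀ (δ : ℕ → ℝ) (S T : ℕ → ℕ → Set HexVertex) (n n' : ℕ → ℕ) (q q' : ℕ → HexVertex),
            Tendsto δ atTop (𝓝[>] 0) →
            (∀ k, TameNestedFamily (δ k) R N (a (δ k)) (S k) ∧
              TameNestedFamily (δ k) R N (b (δ k)) (T k) ∧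
              (((∀ i, ExteriorAnchored D.carrier (δ k) (S k i) (a (δ k))) ∧
          (∀ i, ExteriorAnchored D.carrier (δ k) (T k i) (b (δ k))) ∧
          (∀ (i : ℕ) (p q : HexVertex), HasCleanWindow D.carrier (δ k) ρ (S k i) p q →
            rowOf 0 q = rowOf 0 p + 1 ∧
              ∀ x : HexVertex, ((δ k : ℝ) : ℂ) * hexCenter x ∈ ball (((δ k : ℝ) : ℂ) * hexCenter q) ρ →
                (x ∈ S k i ↔ rowOf 0 x ≤ rowOf 0 p)) ∧
          (∀ (i : ℕ) (p q : HexVertex), HasCleanWindow D.carrier (δ k) ρ (T k i) p q →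
            rowOf 0 q = rowOf 0 p + 1 ∧
              ∀ x : HexVertex, ((δ k : ℝ) : ℂ) * hexCenter x ∈ ball (((δ k : ℝ) : ℂ) * hexCenter q) ρ →
                (x ∈ T k i ↔ rowOf 0 x ≤ rowOf 0 p))) ∧
          (∀ (i : ℕ) (p q : HexVertex), HasCleanWindow D.carrier (δ k) ρ (S k i) p q →
            ∃ K : Set ℂ, IsCompact K ∧ IsConnected K ∧
              ((δ k : ℝ) : ℂ) * hexCenter q - ((ρ / 2 : ℝ) : ℂ) * Complex.I ∈ K ∧ ((δ k : ℝ) : ℂ) * hexCenter (a (δ k)) ∈ K ∧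
              ∀ v : HexVertex, Metric.infDist (((δ k : ℝ) : ℂ) * hexCenter v) K ≤ ρ / 4 → v ∈ S k i) ∧
          (∀ (i : ℕ) (p q : HexVertex), HasCleanWindow D.carrier (δ k) ρ (T k i) p q →
            ∃ K : Set ℂ, IsCompact K ∧ IsConnected K ∧
              ((δ k : ℝ) : ℂ) * hexCenter q - ((ρ / 2 : ℝ) : ℂ) * Complex.I ∈ K ∧ ((δ k : ℝ) : ℂ) * hexCenter (b (δ k)) ∈ K ∧
              ∀ v : HexVertex, Metric.infDist (((δ k : ℝ) : ℂ) * hexCenter v) K ≤ ρ / 4 → v ∈ T k i))) →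
            (∀ k, ∃ (γ : HexDomainSAW D.carrier (δ k) (a (δ k)) (b (δ k))) (m : ℕ) (p : HexVertex)
                (m' : ℕ) (p' : HexVertex),
              IsFirstGoodGateN D.carrier (δ k) ρ R (S k) (a (δ k)) γ.walk.support (n k) m p (q k) ∧
              IsFirstGoodGateN D.carrier (δ k) ρ R (T k) (b (δ k)) γ.walk.support.reverse
                (n' k) m' p' (q' k) ∧
              WideLink D.carrier (δ k) ρ (S k (n k) ∪ T k (n' k)) (q k) (q' k)) →
            ∀ ε' > (0 : ℝ), ∀ φ : ℕ → ℕ, StrictMono φ →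
              ∃ (ψ : ℕ → ℕ) (M : DobrushinDomain) (τ : ℂ) (ρ' : ℝ) (Λ' : ℝ → Finset HexVertex)
                (m : Fin 2 → ℝ → ℤ) (a' b' : ℝ → Sym2 HexVertex) (x : ℕ → Site 2)
                (Λ'' : ℕ → Finset HexVertex) (pu pv : ℕ → HexVertex),
                StrictMono ψ ∧
                (∀ t : ℝ, dist (M.boundary t + τ) (D.boundary t) ≤ η) ∧
                dist (M.pt 0 + τ) (D.pt 0) ≤ η ∧ dist (M.pt 1 + τ) (D.pt 1) ≤ η ∧
                (0 < ρ' ∧ ∀ i : Fin 2,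
                  M.carrier ∩ ball (M.pt i) ρ' = {z : ℂ | (M.pt i).im < z.im} ∩ ball (M.pt i) ρ') ∧
                (∀ᶠ δ' : ℝ in 𝓝[>] 0, hexDomainSimplyConnected (Λ' δ') ∧
                  a' δ' ∈ hexDomainBoundary (Λ' δ') ∧ b' δ' ∈ hexDomainBoundary (Λ' δ') ∧
                  Nonempty (HexMidEdgeSAW (Λ' δ') (a' δ') (b' δ')) ∧
                  (hexGraph.induce (↑(Λ' δ') : Set HexVertex)).Preconnected ∧
                  (∀ v ∈ Λ' δ', (δ' : ℂ) * hexCenter v ∈ M.carrier) ∧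
                  (∀ i : Fin 2, ∀ v : HexVertex, (δ' : ℂ) * hexCenter v ∈ ball (M.pt i) ρ' →
                    (v ∈ Λ' δ' ↔ m i δ' ≤ v.1 1))) ∧
                (∀ K : Set ℂ, IsCompact K → K ⊆ M.carrier →
                  ∀ᶠ δ' : ℝ in 𝓝[>] 0, ∀ v : HexVertex, (δ' : ℂ) * hexCenter v ∈ K → v ∈ Λ' δ') ∧
                Tendsto (fun δ' : ℝ => (δ' : ℂ) * hexMidpoint (a' δ')) (𝓝[>] 0) (𝓝 (M.pt 0)) ∧
                Tendsto (fun δ' : ℝ => (δ' : ℂ) * hexMidpoint (b' δ')) (𝓝[>] 0) (𝓝 (M.pt 1)) ∧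
                Tendsto (fun j : ℕ => ((δ (φ (ψ j)) : ℝ) : ℂ) *
                  Literature.Probability.LatticeModels.triEmbed (x j)) atTop (𝓝 τ) ∧
                (∀ j : ℕ,
                  (∀ w : HexVertex, w ∈ Λ'' j ↔ ((-(x j) + w.1, w.2) : HexVertex) ∈ Λ' (δ (φ (ψ j)))) ∧
                  (∀ w ∈ Λ'' j, w ∉ S (φ (ψ j)) (n (φ (ψ j))) ∪ T (φ (ψ j)) (n' (φ (ψ j)))) ∧
                  (∀ w ∈ Λ'' j, ∀ y ∈ Λ'' j, hexGraph.Adj w y →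
                    (hexDomainGraph D.carrier (δ (φ (ψ j)))).Adj w y) ∧
                  q (φ (ψ j)) ∈ Λ'' j ∧
                  pu j ∈ S (φ (ψ j)) (n (φ (ψ j))) ∪ T (φ (ψ j)) (n' (φ (ψ j))) ∧
                  pv j ∈ S (φ (ψ j)) (n (φ (ψ j))) ∪ T (φ (ψ j)) (n' (φ (ψ j))) ∧
                  hexGraph.Adj (q (φ (ψ j))) (pu j) ∧
                  s(q (φ (ψ j)), pu j) ≠ s(q' (φ (ψ j)), pv j) ∧
                  (a' (δ (φ (ψ j)))).map (fun w : HexVertex => ((x j + w.1, w.2) : HexVertex)) =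
                    s(q (φ (ψ j)), pu j) ∧
                  (b' (δ (φ (ψ j)))).map (fun w : HexVertex => ((x j + w.1, w.2) : HexVertex)) =
                    s(q' (φ (ψ j)), pv j)) ∧
                (∀ᶠ j : ℕ in atTop, 1 - ε' ≤
                  (carvedLaw D.carrier (δ (φ (ψ j))) (S (φ (ψ j)) (n (φ (ψ j))) ∪ T (φ (ψ j)) (n' (φ (ψ j))))
                    (q (φ (ψ j))) (q' (φ (ψ j))) {ξ | ∀ w ∈ ξ.walk.support, w ∈ Λ'' j}).toReal)

/-- **THE MOVING-CARVING SQUEEZE UNDER A FAMILY CONSTRAINT `P` (`MovingCarvingSqueezeP`, NEW in r6)**: as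
`MovingCarvingSqueeze` (= the instance `P := FatAnchoredClassZero`) with the per-mesh family block replaced by
`P D a b (δ k) ρ R N (S k) (T k)`; the landed assembly p125956 is verbatim generic in this block (it only hands it to
the squeeze), whence the r6 stub T2c `stub_carvedReduction_assemblyP`. -/
def MovingCarvingSqueezeP (P : DobrushinDomain → (ℝ → HexVertex) → (ℝ → HexVertex) → ℝ → ℝ → ℝ → ℕ →
      (ℕ → Set HexVertex) → (ℕ → Set HexVertex) → Prop) : Prop :=
    ∀ (D : DobrushinDomain) (a b : ℝ → HexVertex), IsEmbEndpointApprox hexGraph hexCenter D a b →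
      ∀ η > (0 : ℝ), ∃ R₀ > (0 : ℝ), ∀ R ∈ Set.Ioc (0 : ℝ) R₀, ∀ ρ > (0 : ℝ), ∀ N : ℕ,
          ∀ (δ : ℕ → ℝ) (S T : ℕ → ℕ → Set HexVertex) (n n' : ℕ → ℕ) (q q' : ℕ → HexVertex),
            Tendsto δ atTop (𝓝[>] 0) →
            (∀ k, TameNestedFamily (δ k) R N (a (δ k)) (S k) ∧
              TameNestedFamily (δ k) R N (b (δ k)) (T k) ∧
              P D a b (δ k) ρ R N (S k) (T k)) →
            (∀ k, ∃ (γ : HexDomainSAW D.carrier (δ k) (a (δ k)) (b (δ k))) (m : ℕ) (p : HexVertex)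
                (m' : ℕ) (p' : HexVertex),
              IsFirstGoodGateN D.carrier (δ k) ρ R (S k) (a (δ k)) γ.walk.support (n k) m p (q k) ∧
              IsFirstGoodGateN D.carrier (δ k) ρ R (T k) (b (δ k)) γ.walk.support.reverse
                (n' k) m' p' (q' k) ∧
              WideLink D.carrier (δ k) ρ (S k (n k) ∪ T k (n' k)) (q k) (q' k)) →
            ∀ ε' > (0 : ℝ), ∀ φ : ℕ → ℕ, StrictMono φ →
              ∃ (ψ : ℕ → ℕ) (M : DobrushinDomain) (τ : ℂ) (ρ' : ℝ) (Λ' : ℝ → Finset HexVertex)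
                (m : Fin 2 → ℝ → ℤ) (a' b' : ℝ → Sym2 HexVertex) (x : ℕ → Site 2)
                (Λ'' : ℕ → Finset HexVertex) (pu pv : ℕ → HexVertex),
                StrictMono ψ ∧
                (∀ t : ℝ, dist (M.boundary t + τ) (D.boundary t) ≤ η) ∧
                dist (M.pt 0 + τ) (D.pt 0) ≤ η ∧ dist (M.pt 1 + τ) (D.pt 1) ≤ η ∧
                (0 < ρ' ∧ ∀ i : Fin 2,
                  M.carrier ∩ ball (M.pt i) ρ' = {z : ℂ | (M.pt i).im < z.im} ∩ ball (M.pt i) ρ') ∧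
                (∀ᶠ δ' : ℝ in 𝓝[>] 0, hexDomainSimplyConnected (Λ' δ') ∧
                  a' δ' ∈ hexDomainBoundary (Λ' δ') ∧ b' δ' ∈ hexDomainBoundary (Λ' δ') ∧
                  Nonempty (HexMidEdgeSAW (Λ' δ') (a' δ') (b' δ')) ∧
                  (hexGraph.induce (↑(Λ' δ') : Set HexVertex)).Preconnected ∧
                  (∀ v ∈ Λ' δ', (δ' : ℂ) * hexCenter v ∈ M.carrier) ∧
                  (∀ i : Fin 2, ∀ v : HexVertex, (δ' : ℂ) * hexCenter v ∈ ball (M.pt i) ρ' →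
                    (v ∈ Λ' δ' ↔ m i δ' ≤ v.1 1))) ∧
                (∀ K : Set ℂ, IsCompact K → K ⊆ M.carrier →
                  ∀ᶠ δ' : ℝ in 𝓝[>] 0, ∀ v : HexVertex, (δ' : ℂ) * hexCenter v ∈ K → v ∈ Λ' δ') ∧
                Tendsto (fun δ' : ℝ => (δ' : ℂ) * hexMidpoint (a' δ')) (𝓝[>] 0) (𝓝 (M.pt 0)) ∧
                Tendsto (fun δ' : ℝ => (δ' : ℂ) * hexMidpoint (b' δ')) (𝓝[>] 0) (𝓝 (M.pt 1)) ∧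
                Tendsto (fun j : ℕ => ((δ (φ (ψ j)) : ℝ) : ℂ) *
                  Literature.Probability.LatticeModels.triEmbed (x j)) atTop (𝓝 τ) ∧
                (∀ j : ℕ,
                  (∀ w : HexVertex, w ∈ Λ'' j ↔ ((-(x j) + w.1, w.2) : HexVertex) ∈ Λ' (δ (φ (ψ j)))) ∧
                  (∀ w ∈ Λ'' j, w ∉ S (φ (ψ j)) (n (φ (ψ j))) ∪ T (φ (ψ j)) (n' (φ (ψ j)))) ∧
                  (∀ w ∈ Λ'' j, ∀ y ∈ Λ'' j, hexGraph.Adj w y →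
                    (hexDomainGraph D.carrier (δ (φ (ψ j)))).Adj w y) ∧
                  q (φ (ψ j)) ∈ Λ'' j ∧
                  pu j ∈ S (φ (ψ j)) (n (φ (ψ j))) ∪ T (φ (ψ j)) (n' (φ (ψ j))) ∧
                  pv j ∈ S (φ (ψ j)) (n (φ (ψ j))) ∪ T (φ (ψ j)) (n' (φ (ψ j))) ∧
                  hexGraph.Adj (q (φ (ψ j))) (pu j) ∧
                  s(q (φ (ψ j)), pu j) ≠ s(q' (φ (ψ j)), pv j) ∧
                  (a' (δ (φ (ψ j)))).map (fun w : HexVertex => ((x j + w.1, w.2) : HexVertex)) =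
                    s(q (φ (ψ j)), pu j) ∧
                  (b' (δ (φ (ψ j)))).map (fun w : HexVertex => ((x j + w.1, w.2) : HexVertex)) =
                    s(q' (φ (ψ j)), pv j)) ∧
                (∀ᶠ j : ℕ in atTop, 1 - ε' ≤
                  (carvedLaw D.carrier (δ (φ (ψ j))) (S (φ (ψ j)) (n (φ (ψ j))) ∪ T (φ (ψ j)) (n' (φ (ψ j))))
                    (q (φ (ψ j))) (q' (φ (ψ j))) {ξ | ∀ w ∈ ξ.walk.support, w ∈ Λ'' j}).toReal)

/-! ## Registered stubs (r6; signatures INLINED over landed vocabulary) -/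

/-- STUB (landed) — `GateDecomposition` (p82259). -/
theorem stub_gateDecomposition :
    ∀ (Ω : Set ℂ) (δ : ℝ) (a b p q p' q' : HexVertex) (S T : Set HexVertex) (l₁ l₂ : List HexVertex)
      (B : Set (List HexVertex)),
      Disjoint S T →
      (∃ w₁ : (hexDomainGraph Ω δ).Walk a p, w₁.IsPath ∧ w₁.support = l₁ ∧ ∀ v ∈ l₁, v ∈ S) →
      (∃ w₂ : (hexDomainGraph Ω δ).Walk p' b, w₂.IsPath ∧ w₂.support = l₂ ∧ ∀ v ∈ l₂, v ∈ T) →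
      (hexDomainGraph Ω δ).Adj p q → (hexDomainGraph Ω δ).Adj q' p' →
      hexSAWWeight Ω δ a b
          {γ | ∃ mid ∈ B, mid.head? = some q ∧ mid.getLast? = some q' ∧
            (∀ v ∈ mid, v ∉ S ∧ v ∉ T) ∧ γ.walk.support = l₁ ++ mid ++ l₂} =
        ENNReal.ofReal (hexCriticalFugacity ^ (l₁.length + l₂.length)) *
          hexSAWWeight Ω δ q q'
            {γ | γ.walk.support ∈ B ∧ ∀ v ∈ γ.walk.support, v ∉ S ∧ v ∉ T} :=
  Summit.CriticalPhenomena.SAWScalingLimit.Theorems.ObservableToSLER.BridgeGate.stub_gateDecomposition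

/-- STUB S1 (r6 typing) — `NestedRenewalFatCoSolidR = NestedRenewalPR FatAnchoredCoOrientedSolid` (size XL; OPEN —
the abundance input; renewal species; HARDEST, held by the lead).  r3: the locality scale is bounded,
`∀ ε > 0, ∃ R₂ > 0, ∀ R ∈ Ioc 0 R₂, …` (the r1/r2 typing `∀ R > 0` is FALSE: landed `TypeLadder.stub_not_nestedRenewalP`, p124536);
r6: the designed families carry FAT SPINES (`FatSpine`; no dangling level pieces — the T2b′ worker's finding).
Designed families (why plausible): δ-fine stacks of solid levels whose only clean windows are of one
common class `j` at both ends, realised WITHOUT bubbles by TOOTHED levels — far half-hexagons ("teeth",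
size `n₂ ≪ n₁`) hung at fixed positions on the natural exit sides, sub-teeth (`n₃ ≪ n₂`) on tooth sides,
every non-target side roughened at scale `< ρ` by bumps that are top slices of hexagons sunk `≥ ρ/16` into
their parent (spine clause); teeth slide with the level (nestedness), a tooth side of a class-`k` side has
class `k ± 1`, three generations reach every class (`ladderReach`); solid `ρ/4`-cores (fat bodies, spines);
`N` after `ρ`.  Continuum shadow TRUE for SLE(8/3) (support theorem per scale, prescribed-side
single crossings of half-hexagons have positive probability, decorrelation of separated scales, renewal
rows of density `(r/δ)^{3/4}`); lattice statement OPEN (no quasi-independence across scales for the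
critical SAW).  Sources: arXiv:0909.0203 Thm 1.2/1.3, arXiv:1008.4321 §2, Kesten1963 §4, idea card
six-class-type-ladder. -/
theorem stub_nestedRenewalFatCoSolidR :
    ∀ (D : DobrushinDomain) (a b : ℝ → HexVertex), IsEmbEndpointApprox hexGraph hexCenter D a b →
      ∀ ε > (0 : ℝ), ∃ R₂ > (0 : ℝ), ∀ R ∈ Set.Ioc (0 : ℝ) R₂, ∃ ρ > (0 : ℝ), ∃ N : ℕ, ∀ᶠ δ : ℝ in 𝓝[>] 0,
        ∃ S T : ℕ → Set HexVertex,
          TameNestedFamily δ R N (a δ) S ∧ TameNestedFamily δ R N (b δ) T ∧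
          ((∀ n, ExteriorAnchored D.carrier δ (S n) (a δ)) ∧
            (∀ n, ExteriorAnchored D.carrier δ (T n) (b δ)) ∧
            ∃ j : Fin 6,
              ((∀ (n : ℕ) (p q : HexVertex), HasCleanWindow D.carrier δ ρ (S n) p q →
                  rowOf j q = rowOf j p + 1 ∧
                    ∀ x : HexVertex, (δ : ℂ) * hexCenter x ∈ ball ((δ : ℂ) * hexCenter q) ρ →
                      (x ∈ S n ↔ rowOf j x ≤ rowOf j p)) ∧
                (∀ (n : ℕ) (p q : HexVertex), HasCleanWindow D.carrier δ ρ (T n) p q →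
                  rowOf j q = rowOf j p + 1 ∧
                    ∀ x : HexVertex, (δ : ℂ) * hexCenter x ∈ ball ((δ : ℂ) * hexCenter q) ρ →
                      (x ∈ T n ↔ rowOf j x ≤ rowOf j p))) ∧
              (∀ (n : ℕ) (p q : HexVertex), HasCleanWindow D.carrier δ ρ (S n) p q →
                ∃ K : Set ℂ, IsCompact K ∧ IsConnected K ∧
                  (δ : ℂ) * hexCenter q - ((ρ / 2 : ℝ) : ℂ) * Complex.I * triZeta ^ (j : ℕ) ∈ K ∧
                  (δ : ℂ) * hexCenter (a δ) ∈ K ∧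
                  ∀ v : HexVertex, Metric.infDist ((δ : ℂ) * hexCenter v) K ≤ ρ / 4 → v ∈ S n) ∧
              (∀ (n : ℕ) (p q : HexVertex), HasCleanWindow D.carrier δ ρ (T n) p q →
                ∃ K : Set ℂ, IsCompact K ∧ IsConnected K ∧
                  (δ : ℂ) * hexCenter q - ((ρ / 2 : ℝ) : ℂ) * Complex.I * triZeta ^ (j : ℕ) ∈ K ∧
                  (δ : ℂ) * hexCenter (b δ) ∈ K ∧
                  ∀ v : HexVertex, Metric.infDist ((δ : ℂ) * hexCenter v) K ≤ ρ / 4 → v ∈ T n) ∧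
              (∀ n : ℕ, ∃ K : Set ℂ, IsCompact K ∧ IsConnected K ∧ (δ : ℂ) * hexCenter (a δ) ∈ K ∧
                (∀ v : HexVertex, Metric.infDist ((δ : ℂ) * hexCenter v) K ≤ ρ / 8 → v ∈ S n) ∧
                (∀ v ∈ S n, ∃ (t w : HexVertex) (r : ℕ), v ∈ hexBall t r ∧ w ∈ hexBall t r ∧
                  hexBall t r ⊆ S n ∧ Metric.infDist ((δ : ℂ) * hexCenter w) K ≤ ρ / 16)) ∧
              (∀ n : ℕ, ∃ K : Set ℂ, IsCompact K ∧ IsConnected K ∧ (δ : ℂ) * hexCenter (b δ) ∈ K ∧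
                (∀ v : HexVertex, Metric.infDist ((δ : ℂ) * hexCenter v) K ≤ ρ / 8 → v ∈ T n) ∧
                (∀ v ∈ T n, ∃ (t w : HexVertex) (r : ℕ), v ∈ hexBall t r ∧ w ∈ hexBall t r ∧
                  hexBall t r ⊆ T n ∧ Metric.infDist ((δ : ℂ) * hexCenter w) K ≤ ρ / 16))) ∧
          hexSAWLaw D.carrier δ (a δ) (b δ)
              {γ | ¬ ∃ (n m : ℕ) (p q : HexVertex) (n' m' : ℕ) (p' q' : HexVertex),
                  IsFirstGoodGateN D.carrier δ ρ R S (a δ) γ.walk.support n m p q ∧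
                  IsFirstGoodGateN D.carrier δ ρ R T (b δ) γ.walk.support.reverse n' m' p' q' ∧
                  WideLink D.carrier δ ρ (S n ∪ T n') q q'} ≤
            ENNReal.ofReal ε := by
  sorry

/-- STUB (landed) — `SLELawContinuity` (p81676). -/
theorem stub_sleLawContinuity :
    ∀ (D : DobrushinDomain) (f : CurveClass ℂ →ᵇ ℝ) (ε : ℝ), 0 < ε → ∃ η > (0 : ℝ),
      ∀ (M : DobrushinDomain), (∀ t : ℝ, dist (M.boundary t) (D.boundary t) ≤ η) →
        dist (M.pt 0) (D.pt 0) ≤ η → dist (M.pt 1) (D.pt 1) ≤ η →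
        ∀ μ ν : Measure (CurveClass ℂ), IsSLELaw ((8 : ℝ≥0) / 3) M μ → IsSLELaw ((8 : ℝ≥0) / 3) D ν →
          |∫ x, f x ∂μ - ∫ x, f x ∂ν| ≤ ε :=
  Summit.CriticalPhenomena.SAWScalingLimit.Theorems.ObservableToSLER.BridgeGate.stub_sleLawContinuity

/-- STUB T1⁻ `stub_macroSourceLocality` (r11, replacing T1 `stub_twoPieceSourceLocality`; OPEN research, Conjecture-1-locked in substance;
SAME name + signature as stub 2 of the strategist line `macro-anchor-split` (10472) and the twin r13 leaf (14005)) — **`MacroSourceLocality`**: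
macroscopic source locality of the critical hexagonal SAW at a flat boundary point (the weighted fraction of walks from `a δ` to a boundary
mid-edge at distance `|t| < t₀` on the same line that reach distance `r` from `a` is `≤ ε`, eventually in `δ`). -/
theorem stub_macroSourceLocality :
    ∀ (E : DobrushinDomain) (ρ : ℝ) (Λ : ℝ → Finset HexVertex) (m₀ : ℝ → ℤ)
      (a : ℝ → Sym2 HexVertex),
      0 < ρ → E.carrier ∩ ball (E.pt 0) ρ = {z : ℂ | (E.pt 0).im < z.im} ∩ ball (E.pt 0) ρ →
      (∀ᶠ δ : ℝ in 𝓝[>] 0, hexDomainSimplyConnected (Λ δ) ∧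
        (hexGraph.induce (↑(Λ δ) : Set HexVertex)).Preconnected ∧ a δ ∈ hexDomainBoundary (Λ δ) ∧
        (∀ v ∈ Λ δ, (δ : ℂ) * hexCenter v ∈ E.carrier) ∧
        (∀ v : HexVertex, (δ : ℂ) * hexCenter v ∈ ball (E.pt 0) ρ → (v ∈ Λ δ ↔ m₀ δ ≤ v.1 1))) →
      (∀ K : Set ℂ, IsCompact K → K ⊆ E.carrier →
        ∀ᶠ δ : ℝ in 𝓝[>] 0, ∀ v : HexVertex, (δ : ℂ) * hexCenter v ∈ K → v ∈ Λ δ) →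
      Tendsto (fun δ : ℝ => (δ : ℂ) * hexMidpoint (a δ)) (𝓝[>] 0) (𝓝 (E.pt 0)) →
      ∀ ε : ℝ, 0 < ε → ∀ r : ℝ, 0 < r → ∃ t₀ : ℝ, 0 < t₀ ∧
        ∀ (s : ℝ → Sym2 HexVertex) (t : ℝ), t ≠ 0 → |t| < t₀ →
          (∀ᶠ δ : ℝ in 𝓝[>] 0, s δ ∈ hexDomainBoundary (Λ δ) ∧
            (hexMidpoint (s δ)).im = (hexMidpoint (a δ)).im) →
          Tendsto (fun δ : ℝ => (δ : ℂ) * hexMidpoint (s δ)) (𝓝[>] 0) (𝓝 (E.pt 0 + t)) →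
          ∀ᶠ δ : ℝ in 𝓝[>] 0,
            (∑ γ : HexMidEdgeSAW (Λ δ) (a δ) (s δ),
                if ∃ v ∈ γ.verts, r ≤ dist ((δ : ℂ) * hexCenter v) ((δ : ℂ) * hexMidpoint (a δ))
                then hexCriticalFugacity ^ γ.length else 0) ≤
              ε * ∑ γ : HexMidEdgeSAW (Λ δ) (a δ) (s δ), hexCriticalFugacity ^ γ.length := by
  sorry

/-- STUB T2a (LANDED p126992, lead c4; `TypeLadder.stub_twoPieceAdmIdentification`, completing the twin's
5a3 chain `ObservableToSLER.TwoPiece.*`) — `TwoPieceAdmRestrictionLimit → TwoPieceAdmIdentification` (= twin r7 stub 5a3, SAME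
signature, shared: whichever crux lands it first closes both; size L; the LSW
closing for a FIXED two-piece flat domain and a GIVEN admissible family: restriction limits for `M`
and its smooth hull subdomains from ARL″ (sub-families `Λ δ ∩ M'`), boundary avoidance / chordal
carrier from `d → 1` on collars (port of 10472 `stub_chordalCarrier_ofModulus` p77021 to DCS laws),
simplicity from the modulus hypothesis, identification of the filling by the plus-side separation +
`CurveClass.Measure.ext_of_missCode_injOn` + [LSW03] Thm 6.1 (port of `stub_restrictionIdentifies`
p85931, generic in the law); `R` and the anchor enter only through ARL″. -/
theorem stub_twoPieceAdmIdentification :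
    (∀ (D D' : DobrushinDomain) (ρ : ℝ) (φ : ConformalEquiv upperHalfPlaneSet D.carrier)
      (Φ : ConformalEquiv (upperHalfPlaneSet \ φ.pullbackHull D') upperHalfPlaneSet) (d : ℝ)
      (Λ Λ' : ℝ → Finset HexVertex) (m₀ m₁ m₁' : ℝ → ℤ) (a b : ℝ → Sym2 HexVertex),
      (0 < ρ ∧ ∀ i : Fin 2, D.carrier ∩ ball (D.pt i) ρ = {z : ℂ | (D.pt i).im < z.im} ∩ ball (D.pt i) ρ) →
      D.IsHullSubdomain D' → D.IsChordalUniformizing φ →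
      IsRestrictionMap (φ.pullbackHull D') Φ → HasRestrictionDeriv (φ.pullbackHull D') Φ d →
      (∀ᶠ δ : ℝ in 𝓝[>] 0,
        Λ' δ ⊆ Λ δ ∧ hexDomainSimplyConnected (Λ δ) ∧ hexDomainSimplyConnected (Λ' δ) ∧
        (hexGraph.induce (↑(Λ δ) : Set HexVertex)).Preconnected ∧
        (hexGraph.induce (↑(Λ' δ) : Set HexVertex)).Preconnected ∧
        a δ ∈ hexDomainBoundary (Λ δ) ∧ b δ ∈ hexDomainBoundary (Λ δ) ∧
        a δ ∈ hexDomainBoundary (Λ' δ) ∧ b δ ∈ hexDomainBoundary (Λ' δ) ∧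
        Nonempty (HexMidEdgeSAW (Λ' δ) (a δ) (b δ)) ∧
        (∀ v ∈ Λ δ, (δ : ℂ) * hexCenter v ∈ D.carrier) ∧
        (∀ v ∈ Λ' δ, (δ : ℂ) * hexCenter v ∈ D'.carrier) ∧
        (∀ v : HexVertex, (δ : ℂ) * hexCenter v ∈ ball (D.pt 0) ρ →
          ((v ∈ Λ δ ↔ m₀ δ ≤ v.1 1) ∧ (v ∈ Λ' δ ↔ m₀ δ ≤ v.1 1))) ∧
        (∀ v : HexVertex, (δ : ℂ) * hexCenter v ∈ ball (D.pt 1) ρ →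
          ((v ∈ Λ δ ↔ m₁ δ ≤ v.1 1) ∧ (v ∈ Λ' δ ↔ m₁' δ ≤ v.1 1)))) →
      (∀ K : Set ℂ, IsCompact K → K ⊆ D.carrier →
        ∀ᶠ δ : ℝ in 𝓝[>] 0, ∀ v : HexVertex, (δ : ℂ) * hexCenter v ∈ K → v ∈ Λ δ) →
      (∀ K : Set ℂ, IsCompact K → K ⊆ D'.carrier →
        ∀ᶠ δ : ℝ in 𝓝[>] 0, ∀ v : HexVertex, (δ : ℂ) * hexCenter v ∈ K → v ∈ Λ' δ) →
      Tendsto (fun δ : ℝ => (δ : ℂ) * hexMidpoint (a δ)) (𝓝[>] 0) (𝓝 (D.pt 0)) →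
      Tendsto (fun δ : ℝ => (δ : ℂ) * hexMidpoint (b δ)) (𝓝[>] 0) (𝓝 (D.pt 1)) →
      Tendsto (fun δ : ℝ =>
          (∑ γ : HexMidEdgeSAW (Λ' δ) (a δ) (b δ), hexCriticalFugacity ^ γ.length) /
            (∑ γ : HexMidEdgeSAW (Λ δ) (a δ) (b δ), hexCriticalFugacity ^ γ.length)) (𝓝[>] 0)
        (𝓝 (d ^ ((5 : ℝ) / 8)))) →
    ∀ (M : DobrushinDomain) (ρ : ℝ) (Λ : ℝ → Finset HexVertex) (m : Fin 2 → ℝ → ℤ)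
      (a b : ℝ → Sym2 HexVertex),
      (0 < ρ ∧ ∀ i : Fin 2, M.carrier ∩ ball (M.pt i) ρ = {z : ℂ | (M.pt i).im < z.im} ∩ ball (M.pt i) ρ) →
      (∀ᶠ δ : ℝ in 𝓝[>] 0, hexDomainSimplyConnected (Λ δ) ∧ a δ ∈ hexDomainBoundary (Λ δ) ∧
        b δ ∈ hexDomainBoundary (Λ δ) ∧ Nonempty (HexMidEdgeSAW (Λ δ) (a δ) (b δ)) ∧
        (hexGraph.induce (↑(Λ δ) : Set HexVertex)).Preconnected ∧
        (∀ v ∈ Λ δ, (δ : ℂ) * hexCenter v ∈ M.carrier) ∧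
        (∀ i : Fin 2, ∀ v : HexVertex, (δ : ℂ) * hexCenter v ∈ ball (M.pt i) ρ →
          (v ∈ Λ δ ↔ m i δ ≤ v.1 1))) →
      (∀ K : Set ℂ, IsCompact K → K ⊆ M.carrier →
        ∀ᶠ δ : ℝ in 𝓝[>] 0, ∀ v : HexVertex, (δ : ℂ) * hexCenter v ∈ K → v ∈ Λ δ) →
      Tendsto (fun δ : ℝ => (δ : ℂ) * hexMidpoint (a δ)) (𝓝[>] 0) (𝓝 (M.pt 0)) →
      Tendsto (fun δ : ℝ => (δ : ℂ) * hexMidpoint (b δ)) (𝓝[>] 0) (𝓝 (M.pt 1)) →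
      ∀ (μ : Measure (CurveClass ℂ)) (s : ℕ → ℝ), IsProbabilityMeasure μ →
        Tendsto s atTop (𝓝[>] 0) →
        (∀ f : CurveClass ℂ →ᵇ ℝ,
          Tendsto (fun n =>
            (∑ γ : HexMidEdgeSAW (Λ (s n)) (a (s n)) (b (s n)),
                hexCriticalFugacity ^ γ.length *
                  f (CurveClass.mk ⟨polyline (γ.verts.map fun v => ((s n : ℝ) : ℂ) * hexCenter v)⟩)) /
              (∑ γ : HexMidEdgeSAW (Λ (s n)) (a (s n)) (b (s n)), hexCriticalFugacity ^ γ.length))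
            atTop (𝓝 (∫ x, f x ∂μ))) →
        (∀ ε η : ℝ, 0 < ε → 0 < η → ∃ θ : ℝ, 0 < θ ∧ ∀ᶠ n in atTop,
          (∑ γ : HexMidEdgeSAW (Λ (s n)) (a (s n)) (b (s n)),
              if CurveClass.mk ⟨polyline (γ.verts.map fun v => ((s n : ℝ) : ℂ) * hexCenter v)⟩ ∉
                  CurveClass.modulusClass ε θ
              then hexCriticalFugacity ^ γ.length else 0) ≤
            η * ∑ γ : HexMidEdgeSAW (Λ (s n)) (a (s n)) (b (s n)), hexCriticalFugacity ^ γ.length) →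
        IsSLELaw ((8 : ℝ≥0) / 3) M μ :=
  -- LANDED (lead c4, p126992: Theorems/SAWDevelopingMapObservableToSLETypeLadderTwoPieceAdmIdentification.lean)
  Summit.CriticalPhenomena.SAWScalingLimit.Theorems.ObservableToSLE.TypeLadder.stub_twoPieceAdmIdentification

/-- STUB T-A′₁ `stub_carvedReduction_confinedOuterHull` (r11, NEW registered leaf; provable, size M) — **CONFINED Jordan outer
approximants of a `*`-hull**: `TypeLadder.stub_carvedReduction_outerHull` (p128735: swallow a far part `B` of the hull `A` of the limit carving by a
Jordan hull subdomain `D''` whose hull stays `r/4`-far from `cl(ℍ ∖ A)`) WITH THE SWALLOWED PART CONFINED: every point of `ℍ` outside the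
prescribed open set `W ⊇ B` and outside the thin real strip `{im < θ, |re| < Rb + 1}` stays in `D''`.  (Proof = p128735's with the separating
neighbourhoods `U C` intersected with `W ∪ strip`: the real fillings of the clusters lie in `B ∪ [-Rb, Rb]`.)  Needed because (R) is demanded of
the FINAL outer approximant `E_n`: the swallowed set may only run through the persistently removed zone, never through necks or pockets
(finding C of the wave-4 log; twin (F4)). -/
theorem stub_carvedReduction_confinedOuterHull :
    (∀ (D : DobrushinDomain) (φ : ConformalEquiv upperHalfPlaneSet D.carrier) (A B W : Set ℂ) (r Rb θ : ℝ),
      D.IsChordalUniformizing φ → IsStarHull A → IsStarHull B → 0 < r → 0 ≤ Rb → 0 < θ →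
      (∀ w ∈ B, r ≤ infDist w (closure (upperHalfPlaneSet \ A))) →
      IsOpen W → B ⊆ W → B ⊆ closedBall 0 Rb →
      ∃ D'' : DobrushinDomain, D.IsHullSubdomain D'' ∧
        (∀ w ∈ upperHalfPlaneSet, infDist w (closure (upperHalfPlaneSet \ A)) ≤ r / 4 → φ w ∈ D''.carrier) ∧
        (∀ w ∈ upperHalfPlaneSet, w ∉ W → (θ ≤ w.im ∨ Rb + 1 ≤ |w.re|) → φ w ∈ D''.carrier) ∧
        B ⊆ φ.pullbackHull D'' ∧ φ.pullbackHull D'' ⊆ A ∧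
        (∀ w ∈ φ.pullbackHull D'', r / 4 ≤ infDist w (closure (upperHalfPlaneSet \ A)))) :=
  -- LANDED (wave 5 worker A, p147799: Theorems/SAWDevelopingMapObservableToSLETypeLadderCarvedReductionSqueezeConfinedOuterHull.lean)
  Summit.CriticalPhenomena.SAWScalingLimit.Theorems.ObservableToSLE.TypeLadder.stub_carvedReduction_confinedOuterHull

/-- STUB T-A′₂F `stub_carvedReduction_squeezeGeometry_domainsCoreF` (twin r12 registered leaf; **LANDED p162460 by the twin**, wired r16) — **T-A′ from the
confined outer approximants**: `T-A′₁ → T-A′`.  What it does (wave-4 log §E10/§F/§G): limit bulk `M̂` (bulk component of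
`(D − τ) ∩ E^sup ∖ Z₀`, `Z₀` = closed limit hexagons + closed cores, connected per side by FAT CONNECTORS), its `*`-hull `A` by
`stub_carvedReduction_hullOfDomain` p129374, the twin's inner approximant `M′` (`Squeeze.stub_carvedReduction_innerApproximant` p144792, (H1)/(H2)
by `Squeeze.stub_carvedReduction_paramModulus` p141485, no long fingers p136284), confined outer approximants `E_n` by T-A′₁ with (R) transferred
from `TypeLadder.superSup` (p146087) / `reachSup` (p144973), the frame `Squeeze.stub_carvedReduction_derivFrame` p129409 (`1 - ε'/2 ≤ d`), a
restriction datum of the pulled-back hull (`IsStarHull.existsUnique_isRestrictionMap` / `exists_hasRestrictionDeriv`), (MD), (MU), and the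
35-clause assembly with `E := E_{n₀}`, `M := M′`. -/
theorem stub_carvedReduction_squeezeGeometry_domainsCoreF :
    (∀ (D : DobrushinDomain) (φ : ConformalEquiv upperHalfPlaneSet D.carrier) (A B W : Set ℂ) (r Rb θ : ℝ),
      D.IsChordalUniformizing φ → IsStarHull A → IsStarHull B → 0 < r → 0 ≤ Rb → 0 < θ →
      (∀ w ∈ B, r ≤ infDist w (closure (upperHalfPlaneSet \ A))) →
      IsOpen W → B ⊆ W → B ⊆ closedBall 0 Rb →
      ∃ D'' : DobrushinDomain, D.IsHullSubdomain D'' ∧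
        (∀ w ∈ upperHalfPlaneSet, infDist w (closure (upperHalfPlaneSet \ A)) ≤ r / 4 → φ w ∈ D''.carrier) ∧
        (∀ w ∈ upperHalfPlaneSet, w ∉ W → (θ ≤ w.im ∨ Rb + 1 ≤ |w.re|) → φ w ∈ D''.carrier) ∧
        B ⊆ φ.pullbackHull D'' ∧ φ.pullbackHull D'' ⊆ A ∧
        (∀ w ∈ φ.pullbackHull D'', r / 4 ≤ infDist w (closure (upperHalfPlaneSet \ A)))) →
    (∀ (D : DobrushinDomain) (a b : ℝ → HexVertex), IsEmbEndpointApprox hexGraph hexCenter D a b →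
      ∀ η > (0 : ℝ), ∃ R₀ > (0 : ℝ), ∀ R ∈ Set.Ioc (0 : ℝ) R₀, ∀ ρ > (0 : ℝ), ∀ N : ℕ,
          ∀ (δ : ℕ → ℝ) (S T : ℕ → ℕ → Set HexVertex) (n n' : ℕ → ℕ) (q q' : ℕ → HexVertex),
            Tendsto δ atTop (𝓝[>] 0) →
            (∀ k, TameNestedFamily (δ k) R N (a (δ k)) (S k) ∧
              TameNestedFamily (δ k) R N (b (δ k)) (T k) ∧
              (((∀ i, ExteriorAnchored D.carrier (δ k) (S k i) (a (δ k))) ∧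
          (∀ i, ExteriorAnchored D.carrier (δ k) (T k i) (b (δ k))) ∧
          (∀ (i : ℕ) (p q : HexVertex), HasCleanWindow D.carrier (δ k) ρ (S k i) p q →
            rowOf 0 q = rowOf 0 p + 1 ∧
              ∀ x : HexVertex, ((δ k : ℝ) : ℂ) * hexCenter x ∈ ball (((δ k : ℝ) : ℂ) * hexCenter q) ρ →
                (x ∈ S k i ↔ rowOf 0 x ≤ rowOf 0 p)) ∧
          (∀ (i : ℕ) (p q : HexVertex), HasCleanWindow D.carrier (δ k) ρ (T k i) p q →
            rowOf 0 q = rowOf 0 p + 1 ∧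
              ∀ x : HexVertex, ((δ k : ℝ) : ℂ) * hexCenter x ∈ ball (((δ k : ℝ) : ℂ) * hexCenter q) ρ →
                (x ∈ T k i ↔ rowOf 0 x ≤ rowOf 0 p))) ∧
          (∀ (i : ℕ) (p q : HexVertex), HasCleanWindow D.carrier (δ k) ρ (S k i) p q →
            ∃ K : Set ℂ, IsCompact K ∧ IsConnected K ∧
              ((δ k : ℝ) : ℂ) * hexCenter q - ((ρ / 2 : ℝ) : ℂ) * Complex.I ∈ K ∧ ((δ k : ℝ) : ℂ) * hexCenter (a (δ k)) ∈ K ∧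
              ∀ v : HexVertex, Metric.infDist (((δ k : ℝ) : ℂ) * hexCenter v) K ≤ ρ / 4 → v ∈ S k i) ∧
          (∀ (i : ℕ) (p q : HexVertex), HasCleanWindow D.carrier (δ k) ρ (T k i) p q →
            ∃ K : Set ℂ, IsCompact K ∧ IsConnected K ∧
              ((δ k : ℝ) : ℂ) * hexCenter q - ((ρ / 2 : ℝ) : ℂ) * Complex.I ∈ K ∧ ((δ k : ℝ) : ℂ) * hexCenter (b (δ k)) ∈ K ∧
              ∀ v : HexVertex, Metric.infDist (((δ k : ℝ) : ℂ) * hexCenter v) K ≤ ρ / 4 → v ∈ T k i) ∧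
          (∀ i : ℕ, ∃ K : Set ℂ, IsCompact K ∧ IsConnected K ∧ ((δ k : ℝ) : ℂ) * hexCenter (a (δ k)) ∈ K ∧
            (∀ v : HexVertex, Metric.infDist (((δ k : ℝ) : ℂ) * hexCenter v) K ≤ ρ / 8 → v ∈ S k i) ∧
            (∀ v ∈ S k i, ∃ (t w : HexVertex) (r : ℕ), v ∈ hexBall t r ∧ w ∈ hexBall t r ∧
              hexBall t r ⊆ S k i ∧ Metric.infDist (((δ k : ℝ) : ℂ) * hexCenter w) K ≤ ρ / 16)) ∧
          (∀ i : ℕ, ∃ K : Set ℂ, IsCompact K ∧ IsConnected K ∧ ((δ k : ℝ) : ℂ) * hexCenter (b (δ k)) ∈ K ∧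
            (∀ v : HexVertex, Metric.infDist (((δ k : ℝ) : ℂ) * hexCenter v) K ≤ ρ / 8 → v ∈ T k i) ∧
            (∀ v ∈ T k i, ∃ (t w : HexVertex) (r : ℕ), v ∈ hexBall t r ∧ w ∈ hexBall t r ∧
              hexBall t r ⊆ T k i ∧ Metric.infDist (((δ k : ℝ) : ℂ) * hexCenter w) K ≤ ρ / 16)))) →
            (∀ k, ∃ (γ : HexDomainSAW D.carrier (δ k) (a (δ k)) (b (δ k))) (m : ℕ) (p : HexVertex)
                (m' : ℕ) (p' : HexVertex),
              IsFirstGoodGateN D.carrier (δ k) ρ R (S k) (a (δ k)) γ.walk.support (n k) m p (q k) ∧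
              IsFirstGoodGateN D.carrier (δ k) ρ R (T k) (b (δ k)) γ.walk.support.reverse
                (n' k) m' p' (q' k) ∧
              WideLink D.carrier (δ k) ρ (S k (n k) ∪ T k (n' k)) (q k) (q' k)) →
            ∀ ε' > (0 : ℝ), ∀ φ : ℕ → ℕ, StrictMono φ →
              ∀ (ψ₀ : ℕ → ℕ) (x : ℕ → Site 2) (τ P₀ P₁ : ℂ),
                StrictMono ψ₀ ∧ (StrictAnti fun j => δ (φ (ψ₀ j))) ∧ (∀ j, 0 < δ (φ (ψ₀ j))) ∧
                Tendsto (fun j => δ (φ (ψ₀ j))) atTop (𝓝[>] 0) ∧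
                Tendsto (fun j => ((δ (φ (ψ₀ j)) : ℝ) : ℂ) * triEmbed (x j)) atTop (𝓝 τ) ∧
                (∀ k, (q k).2 = 0) ∧ (∀ k, (q' k).2 = 0) ∧
                Tendsto (fun j => ((δ (φ (ψ₀ j)) : ℝ) : ℂ) *
                  hexCenter (((q (φ (ψ₀ j))).1 - x j, 0) : HexVertex)) atTop (𝓝 P₀) ∧
                Tendsto (fun j => ((δ (φ (ψ₀ j)) : ℝ) : ℂ) *
                  hexCenter (((q' (φ (ψ₀ j))).1 - x j, 0) : HexVertex)) atTop (𝓝 P₁) ∧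
                (∀ j, P₀.im < (((δ (φ (ψ₀ j)) : ℝ) : ℂ) * hexCenter (((q (φ (ψ₀ j))).1 - x j, 0) : HexVertex)).im) ∧
                (∀ j, P₁.im < (((δ (φ (ψ₀ j)) : ℝ) : ℂ) * hexCenter (((q' (φ (ψ₀ j))).1 - x j, 0) : HexVertex)).im) ∧
                Tendsto (fun j => ((δ (φ (ψ₀ j)) : ℝ) : ℂ) * hexCenter (q (φ (ψ₀ j)))) atTop (𝓝 (P₀ + τ)) ∧
                Tendsto (fun j => ((δ (φ (ψ₀ j)) : ℝ) : ℂ) * hexCenter (q' (φ (ψ₀ j)))) atTop (𝓝 (P₁ + τ)) ∧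
                (∀ᶠ j in atTop, ∀ v : HexVertex,
                  ((δ (φ (ψ₀ j)) : ℝ) : ℂ) * hexCenter v - ((δ (φ (ψ₀ j)) : ℝ) : ℂ) * triEmbed (x j) ∈ ball P₀ (ρ / 2) →
                    (v ∈ S (φ (ψ₀ j)) (n (φ (ψ₀ j))) ∪ T (φ (ψ₀ j)) (n' (φ (ψ₀ j))) ↔
                      v.1 1 < (q (φ (ψ₀ j))).1 1)) ∧
                (∀ᶠ j in atTop, ∀ v : HexVertex,
                  ((δ (φ (ψ₀ j)) : ℝ) : ℂ) * hexCenter v - ((δ (φ (ψ₀ j)) : ℝ) : ℂ) * triEmbed (x j) ∈ ball P₁ (ρ / 2) →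
                    (v ∈ S (φ (ψ₀ j)) (n (φ (ψ₀ j))) ∪ T (φ (ψ₀ j)) (n' (φ (ψ₀ j))) ↔
                      v.1 1 < (q' (φ (ψ₀ j))).1 1)) ∧
                (∀ᶠ j in atTop,
                  closedBall (P₀ + ((δ (φ (ψ₀ j)) : ℝ) : ℂ) * triEmbed (x j)) (ρ / 2) ⊆ D.carrier ∧
                  closedBall (P₁ + ((δ (φ (ψ₀ j)) : ℝ) : ℂ) * triEmbed (x j)) (ρ / 2) ⊆ D.carrier) ∧
                (∀ k, q k ∈ embMeshDomain hexGraph hexCenter D.carrier (δ k)) ∧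
                (∀ᶠ k in atTop, IsProbabilityMeasure
                  (carvedLaw D.carrier (δ k) (S k (n k) ∪ T k (n' k)) (q k) (q' k))) →
              ∃ (ψ₀ : ℕ → ℕ) (E M : DobrushinDomain) (τ : ℂ) (x : ℕ → Site 2)
                (φE : ConformalEquiv upperHalfPlaneSet E.carrier)
                (Φ : ConformalEquiv (upperHalfPlaneSet \ φE.pullbackHull M) upperHalfPlaneSet) (d : ℝ)
                (ρw ρc ρc' ρF : ℝ),
                (StrictMono ψ₀) ∧
                (StrictAnti fun j => δ (φ (ψ₀ j))) ∧
                (∀ j, 0 < δ (φ (ψ₀ j))) ∧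
                (Tendsto (fun j => δ (φ (ψ₀ j))) atTop (𝓝[>] 0)) ∧
                (Tendsto (fun j => ((δ (φ (ψ₀ j)) : ℝ) : ℂ) * triEmbed (x j)) atTop (𝓝 τ)) ∧
                (E.IsHullSubdomain M) ∧
                (∀ t : ℝ, dist (M.boundary t + τ) (D.boundary t) ≤ η) ∧
                (dist (M.pt 0 + τ) (D.pt 0) ≤ η) ∧
                (dist (M.pt 1 + τ) (D.pt 1) ≤ η) ∧
                (∀ i, E.carrier ∩ ball (E.pt i) ρw = {z : ℂ | (E.pt i).im < z.im} ∩ ball (E.pt i) ρw) ∧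
                (∀ i (z : ℂ), |z.re - (E.pt i).re| ≤ ρc → (E.pt i).im - ρc' ≤ z.im → z.im ≤ (E.pt i).im → z ∉ E.carrier) ∧
                (0 < ρc) ∧
                (0 < ρc') ∧
                (0 < ρF) ∧
                (ρF ≤ ρc) ∧
                (ρF ≤ ρc') ∧
                (ρF ≤ ρw) ∧
                (2 * (ρc + ρc') + ρF ≤ dist (E.pt 0) (E.pt 1)) ∧
                (E.IsChordalUniformizing φE) ∧
                (IsRestrictionMap (φE.pullbackHull M) Φ) ∧
                (HasRestrictionDeriv (φE.pullbackHull M) Φ d) ∧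
                (1 - ε' < d ^ ((5 : ℝ) / 8)) ∧
                (∀ j, (q (φ (ψ₀ j))).2 = 0) ∧
                (∀ j, (q' (φ (ψ₀ j))).2 = 0) ∧
                (Tendsto (fun j => ((δ (φ (ψ₀ j)) : ℝ) : ℂ) * hexCenter (((q (φ (ψ₀ j))).1 - x j, 0) : HexVertex)) atTop (𝓝 (E.pt 0))) ∧
                (Tendsto (fun j => ((δ (φ (ψ₀ j)) : ℝ) : ℂ) * hexCenter (((q' (φ (ψ₀ j))).1 - x j, 0) : HexVertex)) atTop (𝓝 (E.pt 1))) ∧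
                (∀ j, (E.pt 0).im < (((δ (φ (ψ₀ j)) : ℝ) : ℂ) * hexCenter (((q (φ (ψ₀ j))).1 - x j, 0) : HexVertex)).im) ∧
                (∀ j, (E.pt 1).im < (((δ (φ (ψ₀ j)) : ℝ) : ℂ) * hexCenter (((q' (φ (ψ₀ j))).1 - x j, 0) : HexVertex)).im) ∧
                (∀ᶠ j in atTop, ∀ v : HexVertex, ((δ (φ (ψ₀ j)) : ℝ) : ℂ) * hexCenter v - ((δ (φ (ψ₀ j)) : ℝ) : ℂ) * triEmbed (x j) ∈ ball (E.pt 0) ρF → (v ∈ S (φ (ψ₀ j)) (n (φ (ψ₀ j))) ∪ T (φ (ψ₀ j)) (n' (φ (ψ₀ j))) ↔ v.1 1 < (q (φ (ψ₀ j))).1 1)) ∧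
                (∀ᶠ j in atTop, ∀ v : HexVertex, ((δ (φ (ψ₀ j)) : ℝ) : ℂ) * hexCenter v - ((δ (φ (ψ₀ j)) : ℝ) : ℂ) * triEmbed (x j) ∈ ball (E.pt 1) ρF → (v ∈ S (φ (ψ₀ j)) (n (φ (ψ₀ j))) ∪ T (φ (ψ₀ j)) (n' (φ (ψ₀ j))) ↔ v.1 1 < (q' (φ (ψ₀ j))).1 1)) ∧
                (∀ᶠ j in atTop, ∀ z : ℂ, (z ∈ M.carrier ∨ ∃ i, dist z (E.pt i) ≤ 2 * ρc) → z + ((δ (φ (ψ₀ j)) : ℝ) : ℂ) * triEmbed (x j) ∈ D.carrier) ∧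
                (∀ᶠ j in atTop, ∀ v : HexVertex, ((δ (φ (ψ₀ j)) : ℝ) : ℂ) * hexCenter v - ((δ (φ (ψ₀ j)) : ℝ) : ℂ) * triEmbed (x j) ∈ M.carrier → (∀ i, ρF ≤ dist (((δ (φ (ψ₀ j)) : ℝ) : ℂ) * hexCenter v - ((δ (φ (ψ₀ j)) : ℝ) : ℂ) * triEmbed (x j)) (E.pt i)) → v ∉ S (φ (ψ₀ j)) (n (φ (ψ₀ j))) ∪ T (φ (ψ₀ j)) (n' (φ (ψ₀ j)))) ∧
                (∀ᶠ j in atTop, ∀ (w : HexVertex) (π : (hexDomainGraph D.carrier (δ (φ (ψ₀ j)))).Walk (q (φ (ψ₀ j))) w), (∀ y ∈ π.support, y ∉ S (φ (ψ₀ j)) (n (φ (ψ₀ j))) ∪ T (φ (ψ₀ j)) (n' (φ (ψ₀ j)))) → ∀ y ∈ π.support, ((δ (φ (ψ₀ j)) : ℝ) : ℂ) * hexCenter y - ((δ (φ (ψ₀ j)) : ℝ) : ℂ) * triEmbed (x j) ∈ E.carrier ∧ closedBall (((δ (φ (ψ₀ j)) : ℝ) : ℂ) * hexCenter y - ((δ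 (φ (ψ₀ j)) : ℝ) : ℂ) * triEmbed (x j)) (25 * δ (φ (ψ₀ j))) ⊆ E.carrier ∪ ⋃ i, {z : ℂ | |z.re - (E.pt i).re| ≤ ρc ∧ (E.pt i).im - 30 * δ (φ (ψ₀ j)) ≤ z.im ∧ z.im ≤ (E.pt i).im} ∧ (|(((δ (φ (ψ₀ j)) : ℝ) : ℂ) * hexCenter y - ((δ (φ (ψ₀ j)) : ℝ) : ℂ) * triEmbed (x j)).re - (E.pt 0).re| < ρc + 10 * δ (φ (ψ₀ j)) → |(((δ (φ (ψ₀ j)) : ℝ) : ℂ) * hexCenter y - ((δ (φ (ψ₀ j)) : ℝ) : ℂ) * triEmbed (x j)).im - (E.pt 0).im| < ρc' → (q (φ (ψ₀ j))).1 1 ≤ y.1 1) ∧ (|(((δ (φ (ψ₀ j)) : ℝ) : ℂ) * hexCenter y - ((δ (φ (ψ₀ j)) : ℝ) : ℂ) * triEmbed (x j)).re - (E.pt 1).re| < ρc + 10 * δ (φ (ψ₀ j)) → |(((δ (φ (ψ₀ j)) : ℝ) : ℂ) * hexCenter y - ((δ (φ (ψ₀ j)) : ℝ) : ℂ) * triEmbed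 (x j)).im - (E.pt 1).im| < ρc' → (q' (φ (ψ₀ j))).1 1 ≤ y.1 1)) ∧
                (∀ j, q (φ (ψ₀ j)) ∈ embMeshDomain hexGraph hexCenter D.carrier (δ (φ (ψ₀ j)))) ∧
                (∀ᶠ j in atTop, IsProbabilityMeasure (carvedLaw D.carrier (δ (φ (ψ₀ j))) (S (φ (ψ₀ j)) (n (φ (ψ₀ j))) ∪ T (φ (ψ₀ j)) (n' (φ (ψ₀ j)))) (q (φ (ψ₀ j))) (q' (φ (ψ₀ j)))))) :=
  -- LANDED (twin wave 6, p162460: Theorems/SAWDevelopingMapObservableToSLETypeLadderCarvedReductionSqueezeDomainsCoreF.lean)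
  Summit.CriticalPhenomena.SAWScalingLimit.Theorems.ObservableToSLE.TypeLadder.carvedReduction_squeezeGeometry_domainsCoreF

/-- STUB T-A′ `stub_carvedReduction_squeezeGeometry_domains` (r10 leaf = STAGE 1b of T-A; from r11 GLUE = T-A′₂ applied to T-A′₁) —
**the continuum geometry of the pinned frame**: from the hypotheses of T-A and the output of the LANDED STAGE 1a
(`TypeLadder.carvedReduction_squeezeGeometry_selection`, p137830: a subsequence `ψ₀`, lattice translations `x`, drift `τ`,
pinned limit gates `P₀`, `P₁` strictly below the pinned gate rows, window exactness at radius `ρ/2`, window balls inside `D`),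
a further subsequence carrying the OUTER two-piece flat Jordan approximant `E` (exact upper half-discs of radius `ρw` at
`E.pt i = Pᵢ`, closed gate boxes `[Re Pᵢ ± ρc] × [Im Pᵢ - ρc', Im Pᵢ] ⊆ Eᶜ`), the INNER hull subdomain `M` of `E`, a chordal
uniformizer `φE` of `E`, a restriction map `Φ` of the pulled-back hull with derivative `d`, `1 - ε' < d^{5/8}`, the boundary
closeness (C2) of `M + τ` to `D`, and the three lattice-facing facts (MD) `M + τⱼ ⊆ D` and the `2ρc`-balls about the gates
translate into `D`, (MU) `M`-points `r`-off the gates carry no removed vertex, (R) every vertex of a removed-set-avoiding walk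
from the gate is, pinned, CLEARLY DEEP in `E` — verbatim the 35 hypotheses of the LANDED STAGE 2
(`TypeLadder.carvedReduction_squeezeGeometry_lattice`, p137080).  Outer side (E by the twin's `superDomainOfCrosscuts` p133663 /
`legsToCrosscut` p135598 / `jordanApprox` p130751 from the limit package; reach) is this line's; the inner approximant and (C2) are
the twin's contract `Squeeze.InnerApproximant`; the frame is `Squeeze.stub_carvedReduction_derivFrame` p129409. -/
theorem stub_carvedReduction_squeezeGeometry_domains :
    (∀ (D : DobrushinDomain) (a b : ℝ → HexVertex), IsEmbEndpointApprox hexGraph hexCenter D a b →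
      ∀ η > (0 : ℝ), ∃ R₀ > (0 : ℝ), ∀ R ∈ Set.Ioc (0 : ℝ) R₀, ∀ ρ > (0 : ℝ), ∀ N : ℕ,
          ∀ (δ : ℕ → ℝ) (S T : ℕ → ℕ → Set HexVertex) (n n' : ℕ → ℕ) (q q' : ℕ → HexVertex),
            Tendsto δ atTop (𝓝[>] 0) →
            (∀ k, TameNestedFamily (δ k) R N (a (δ k)) (S k) ∧
              TameNestedFamily (δ k) R N (b (δ k)) (T k) ∧
              (((∀ i, ExteriorAnchored D.carrier (δ k) (S k i) (a (δ k))) ∧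
          (∀ i, ExteriorAnchored D.carrier (δ k) (T k i) (b (δ k))) ∧
          (∀ (i : ℕ) (p q : HexVertex), HasCleanWindow D.carrier (δ k) ρ (S k i) p q →
            rowOf 0 q = rowOf 0 p + 1 ∧
              ∀ x : HexVertex, ((δ k : ℝ) : ℂ) * hexCenter x ∈ ball (((δ k : ℝ) : ℂ) * hexCenter q) ρ →
                (x ∈ S k i ↔ rowOf 0 x ≤ rowOf 0 p)) ∧
          (∀ (i : ℕ) (p q : HexVertex), HasCleanWindow D.carrier (δ k) ρ (T k i) p q →
            rowOf 0 q = rowOf 0 p + 1 ∧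
              ∀ x : HexVertex, ((δ k : ℝ) : ℂ) * hexCenter x ∈ ball (((δ k : ℝ) : ℂ) * hexCenter q) ρ →
                (x ∈ T k i ↔ rowOf 0 x ≤ rowOf 0 p))) ∧
          (∀ (i : ℕ) (p q : HexVertex), HasCleanWindow D.carrier (δ k) ρ (S k i) p q →
            ∃ K : Set ℂ, IsCompact K ∧ IsConnected K ∧
              ((δ k : ℝ) : ℂ) * hexCenter q - ((ρ / 2 : ℝ) : ℂ) * Complex.I ∈ K ∧ ((δ k : ℝ) : ℂ) * hexCenter (a (δ k)) ∈ K ∧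
              ∀ v : HexVertex, Metric.infDist (((δ k : ℝ) : ℂ) * hexCenter v) K ≤ ρ / 4 → v ∈ S k i) ∧
          (∀ (i : ℕ) (p q : HexVertex), HasCleanWindow D.carrier (δ k) ρ (T k i) p q →
            ∃ K : Set ℂ, IsCompact K ∧ IsConnected K ∧
              ((δ k : ℝ) : ℂ) * hexCenter q - ((ρ / 2 : ℝ) : ℂ) * Complex.I ∈ K ∧ ((δ k : ℝ) : ℂ) * hexCenter (b (δ k)) ∈ K ∧
              ∀ v : HexVertex, Metric.infDist (((δ k : ℝ) : ℂ) * hexCenter v) K ≤ ρ / 4 → v ∈ T k i) ∧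
          (∀ i : ℕ, ∃ K : Set ℂ, IsCompact K ∧ IsConnected K ∧ ((δ k : ℝ) : ℂ) * hexCenter (a (δ k)) ∈ K ∧
            (∀ v : HexVertex, Metric.infDist (((δ k : ℝ) : ℂ) * hexCenter v) K ≤ ρ / 8 → v ∈ S k i) ∧
            (∀ v ∈ S k i, ∃ (t w : HexVertex) (r : ℕ), v ∈ hexBall t r ∧ w ∈ hexBall t r ∧
              hexBall t r ⊆ S k i ∧ Metric.infDist (((δ k : ℝ) : ℂ) * hexCenter w) K ≤ ρ / 16)) ∧
          (∀ i : ℕ, ∃ K : Set ℂ, IsCompact K ∧ IsConnected K ∧ ((δ k : ℝ) : ℂ) * hexCenter (b (δ k)) ∈ K ∧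
            (∀ v : HexVertex, Metric.infDist (((δ k : ℝ) : ℂ) * hexCenter v) K ≤ ρ / 8 → v ∈ T k i) ∧
            (∀ v ∈ T k i, ∃ (t w : HexVertex) (r : ℕ), v ∈ hexBall t r ∧ w ∈ hexBall t r ∧
              hexBall t r ⊆ T k i ∧ Metric.infDist (((δ k : ℝ) : ℂ) * hexCenter w) K ≤ ρ / 16)))) →
            (∀ k, ∃ (γ : HexDomainSAW D.carrier (δ k) (a (δ k)) (b (δ k))) (m : ℕ) (p : HexVertex)
                (m' : ℕ) (p' : HexVertex),
              IsFirstGoodGateN D.carrier (δ k) ρ R (S k) (a (δ k)) γ.walk.support (n k) m p (q k) ∧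
              IsFirstGoodGateN D.carrier (δ k) ρ R (T k) (b (δ k)) γ.walk.support.reverse
                (n' k) m' p' (q' k) ∧
              WideLink D.carrier (δ k) ρ (S k (n k) ∪ T k (n' k)) (q k) (q' k)) →
            ∀ ε' > (0 : ℝ), ∀ φ : ℕ → ℕ, StrictMono φ →
              ∀ (ψ₀ : ℕ → ℕ) (x : ℕ → Site 2) (τ P₀ P₁ : ℂ),
                StrictMono ψ₀ ∧ (StrictAnti fun j => δ (φ (ψ₀ j))) ∧ (∀ j, 0 < δ (φ (ψ₀ j))) ∧
                Tendsto (fun j => δ (φ (ψ₀ j))) atTop (𝓝[>] 0) ∧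
                Tendsto (fun j => ((δ (φ (ψ₀ j)) : ℝ) : ℂ) * triEmbed (x j)) atTop (𝓝 τ) ∧
                (∀ k, (q k).2 = 0) ∧ (∀ k, (q' k).2 = 0) ∧
                Tendsto (fun j => ((δ (φ (ψ₀ j)) : ℝ) : ℂ) *
                  hexCenter (((q (φ (ψ₀ j))).1 - x j, 0) : HexVertex)) atTop (𝓝 P₀) ∧
                Tendsto (fun j => ((δ (φ (ψ₀ j)) : ℝ) : ℂ) *
                  hexCenter (((q' (φ (ψ₀ j))).1 - x j, 0) : HexVertex)) atTop (𝓝 P₁) ∧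
                (∀ j, P₀.im < (((δ (φ (ψ₀ j)) : ℝ) : ℂ) * hexCenter (((q (φ (ψ₀ j))).1 - x j, 0) : HexVertex)).im) ∧
                (∀ j, P₁.im < (((δ (φ (ψ₀ j)) : ℝ) : ℂ) * hexCenter (((q' (φ (ψ₀ j))).1 - x j, 0) : HexVertex)).im) ∧
                Tendsto (fun j => ((δ (φ (ψ₀ j)) : ℝ) : ℂ) * hexCenter (q (φ (ψ₀ j)))) atTop (𝓝 (P₀ + τ)) ∧
                Tendsto (fun j => ((δ (φ (ψ₀ j)) : ℝ) : ℂ) * hexCenter (q' (φ (ψ₀ j)))) atTop (𝓝 (P₁ + τ)) ∧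
                (∀ᶠ j in atTop, ∀ v : HexVertex,
                  ((δ (φ (ψ₀ j)) : ℝ) : ℂ) * hexCenter v - ((δ (φ (ψ₀ j)) : ℝ) : ℂ) * triEmbed (x j) ∈ ball P₀ (ρ / 2) →
                    (v ∈ S (φ (ψ₀ j)) (n (φ (ψ₀ j))) ∪ T (φ (ψ₀ j)) (n' (φ (ψ₀ j))) ↔
                      v.1 1 < (q (φ (ψ₀ j))).1 1)) ∧
                (∀ᶠ j in atTop, ∀ v : HexVertex,
                  ((δ (φ (ψ₀ j)) : ℝ) : ℂ) * hexCenter v - ((δ (φ (ψ₀ j)) : ℝ) : ℂ) * triEmbed (x j) ∈ ball P₁ (ρ / 2) →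
                    (v ∈ S (φ (ψ₀ j)) (n (φ (ψ₀ j))) ∪ T (φ (ψ₀ j)) (n' (φ (ψ₀ j))) ↔
                      v.1 1 < (q' (φ (ψ₀ j))).1 1)) ∧
                (∀ᶠ j in atTop,
                  closedBall (P₀ + ((δ (φ (ψ₀ j)) : ℝ) : ℂ) * triEmbed (x j)) (ρ / 2) ⊆ D.carrier ∧
                  closedBall (P₁ + ((δ (φ (ψ₀ j)) : ℝ) : ℂ) * triEmbed (x j)) (ρ / 2) ⊆ D.carrier) ∧
                (∀ k, q k ∈ embMeshDomain hexGraph hexCenter D.carrier (δ k)) ∧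
                (∀ᶠ k in atTop, IsProbabilityMeasure
                  (carvedLaw D.carrier (δ k) (S k (n k) ∪ T k (n' k)) (q k) (q' k))) →
              ∃ (ψ₀ : ℕ → ℕ) (E M : DobrushinDomain) (τ : ℂ) (x : ℕ → Site 2)
                (φE : ConformalEquiv upperHalfPlaneSet E.carrier)
                (Φ : ConformalEquiv (upperHalfPlaneSet \ φE.pullbackHull M) upperHalfPlaneSet) (d : ℝ)
                (ρw ρc ρc' ρF : ℝ),
                (StrictMono ψ₀) ∧
                (StrictAnti fun j => δ (φ (ψ₀ j))) ∧
                (∀ j, 0 < δ (φ (ψ₀ j))) ∧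
                (Tendsto (fun j => δ (φ (ψ₀ j))) atTop (𝓝[>] 0)) ∧
                (Tendsto (fun j => ((δ (φ (ψ₀ j)) : ℝ) : ℂ) * triEmbed (x j)) atTop (𝓝 τ)) ∧
                (E.IsHullSubdomain M) ∧
                (∀ t : ℝ, dist (M.boundary t + τ) (D.boundary t) ≤ η) ∧
                (dist (M.pt 0 + τ) (D.pt 0) ≤ η) ∧
                (dist (M.pt 1 + τ) (D.pt 1) ≤ η) ∧
                (∀ i, E.carrier ∩ ball (E.pt i) ρw = {z : ℂ | (E.pt i).im < z.im} ∩ ball (E.pt i) ρw) ∧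
                (∀ i (z : ℂ), |z.re - (E.pt i).re| ≤ ρc → (E.pt i).im - ρc' ≤ z.im → z.im ≤ (E.pt i).im → z ∉ E.carrier) ∧
                (0 < ρc) ∧
                (0 < ρc') ∧
                (0 < ρF) ∧
                (ρF ≤ ρc) ∧
                (ρF ≤ ρc') ∧
                (ρF ≤ ρw) ∧
                (2 * (ρc + ρc') + ρF ≤ dist (E.pt 0) (E.pt 1)) ∧
                (E.IsChordalUniformizing φE) ∧
                (IsRestrictionMap (φE.pullbackHull M) Φ) ∧
                (HasRestrictionDeriv (φE.pullbackHull M) Φ d) ∧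
                (1 - ε' < d ^ ((5 : ℝ) / 8)) ∧
                (∀ j, (q (φ (ψ₀ j))).2 = 0) ∧
                (∀ j, (q' (φ (ψ₀ j))).2 = 0) ∧
                (Tendsto (fun j => ((δ (φ (ψ₀ j)) : ℝ) : ℂ) * hexCenter (((q (φ (ψ₀ j))).1 - x j, 0) : HexVertex)) atTop (𝓝 (E.pt 0))) ∧
                (Tendsto (fun j => ((δ (φ (ψ₀ j)) : ℝ) : ℂ) * hexCenter (((q' (φ (ψ₀ j))).1 - x j, 0) : HexVertex)) atTop (𝓝 (E.pt 1))) ∧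
                (∀ j, (E.pt 0).im < (((δ (φ (ψ₀ j)) : ℝ) : ℂ) * hexCenter (((q (φ (ψ₀ j))).1 - x j, 0) : HexVertex)).im) ∧
                (∀ j, (E.pt 1).im < (((δ (φ (ψ₀ j)) : ℝ) : ℂ) * hexCenter (((q' (φ (ψ₀ j))).1 - x j, 0) : HexVertex)).im) ∧
                (∀ᶠ j in atTop, ∀ v : HexVertex, ((δ (φ (ψ₀ j)) : ℝ) : ℂ) * hexCenter v - ((δ (φ (ψ₀ j)) : ℝ) : ℂ) * triEmbed (x j) ∈ ball (E.pt 0) ρF → (v ∈ S (φ (ψ₀ j)) (n (φ (ψ₀ j))) ∪ T (φ (ψ₀ j)) (n' (φ (ψ₀ j))) ↔ v.1 1 < (q (φ (ψ₀ j))).1 1)) ∧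
                (∀ᶠ j in atTop, ∀ v : HexVertex, ((δ (φ (ψ₀ j)) : ℝ) : ℂ) * hexCenter v - ((δ (φ (ψ₀ j)) : ℝ) : ℂ) * triEmbed (x j) ∈ ball (E.pt 1) ρF → (v ∈ S (φ (ψ₀ j)) (n (φ (ψ₀ j))) ∪ T (φ (ψ₀ j)) (n' (φ (ψ₀ j))) ↔ v.1 1 < (q' (φ (ψ₀ j))).1 1)) ∧
                (∀ᶠ j in atTop, ∀ z : ℂ, (z ∈ M.carrier ∨ ∃ i, dist z (E.pt i) ≤ 2 * ρc) → z + ((δ (φ (ψ₀ j)) : ℝ) : ℂ) * triEmbed (x j) ∈ D.carrier) ∧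
                (∀ᶠ j in atTop, ∀ v : HexVertex, ((δ (φ (ψ₀ j)) : ℝ) : ℂ) * hexCenter v - ((δ (φ (ψ₀ j)) : ℝ) : ℂ) * triEmbed (x j) ∈ M.carrier → (∀ i, ρF ≤ dist (((δ (φ (ψ₀ j)) : ℝ) : ℂ) * hexCenter v - ((δ (φ (ψ₀ j)) : ℝ) : ℂ) * triEmbed (x j)) (E.pt i)) → v ∉ S (φ (ψ₀ j)) (n (φ (ψ₀ j))) ∪ T (φ (ψ₀ j)) (n' (φ (ψ₀ j)))) ∧
                (∀ᶠ j in atTop, ∀ (w : HexVertex) (π : (hexDomainGraph D.carrier (δ (φ (ψ₀ j)))).Walk (q (φ (ψ₀ j))) w), (∀ y ∈ π.support, y ∉ S (φ (ψ₀ j)) (n (φ (ψ₀ j))) ∪ T (φ (ψ₀ j)) (n' (φ (ψ₀ j)))) → ∀ y ∈ π.support, ((δ (φ (ψ₀ j)) : ℝ) : ℂ) * hexCenter y - ((δ (φ (ψ₀ j)) : ℝ) : ℂ) * triEmbed (x j) ∈ E.carrier ∧ closedBall (((δ (φ (ψ₀ j)) : ℝ) : ℂ) * hexCenter y - ((δ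 (φ (ψ₀ j)) : ℝ) : ℂ) * triEmbed (x j)) (25 * δ (φ (ψ₀ j))) ⊆ E.carrier ∪ ⋃ i, {z : ℂ | |z.re - (E.pt i).re| ≤ ρc ∧ (E.pt i).im - 30 * δ (φ (ψ₀ j)) ≤ z.im ∧ z.im ≤ (E.pt i).im} ∧ (|(((δ (φ (ψ₀ j)) : ℝ) : ℂ) * hexCenter y - ((δ (φ (ψ₀ j)) : ℝ) : ℂ) * triEmbed (x j)).re - (E.pt 0).re| < ρc + 10 * δ (φ (ψ₀ j)) → |(((δ (φ (ψ₀ j)) : ℝ) : ℂ) * hexCenter y - ((δ (φ (ψ₀ j)) : ℝ) : ℂ) * triEmbed (x j)).im - (E.pt 0).im| < ρc' → (q (φ (ψ₀ j))).1 1 ≤ y.1 1) ∧ (|(((δ (φ (ψ₀ j)) : ℝ) : ℂ) * hexCenter y - ((δ (φ (ψ₀ j)) : ℝ) : ℂ) * triEmbed (x j)).re - (E.pt 1).re| < ρc + 10 * δ (φ (ψ₀ j)) → |(((δ (φ (ψ₀ j)) : ℝ) : ℂ) * hexCenter y - ((δ (φ (ψ₀ j)) : ℝ) : ℂ) * triEmbed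 (x j)).im - (E.pt 1).im| < ρc' → (q' (φ (ψ₀ j))).1 1 ≤ y.1 1)) ∧
                (∀ j, q (φ (ψ₀ j)) ∈ embMeshDomain hexGraph hexCenter D.carrier (δ (φ (ψ₀ j)))) ∧
                (∀ᶠ j in atTop, IsProbabilityMeasure (carvedLaw D.carrier (δ (φ (ψ₀ j))) (S (φ (ψ₀ j)) (n (φ (ψ₀ j))) ∪ T (φ (ψ₀ j)) (n' (φ (ψ₀ j)))) (q (φ (ψ₀ j))) (q' (φ (ψ₀ j)))))) := by
  exact stub_carvedReduction_squeezeGeometry_domainsCoreF stub_carvedReduction_confinedOuterHull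

/-- STAGE 1 of T-A = T-A′ ∘ STAGE 1a (glue, sorry-free; the worker's `carvedReduction_squeezeGeometry_continuum`). -/
theorem carvedReduction_squeezeGeometry_continuum :
    (∀ (D : DobrushinDomain) (a b : ℝ → HexVertex), IsEmbEndpointApprox hexGraph hexCenter D a b →
      ∀ η > (0 : ℝ), ∃ R₀ > (0 : ℝ), ∀ R ∈ Set.Ioc (0 : ℝ) R₀, ∀ ρ > (0 : ℝ), ∀ N : ℕ,
          ∀ (δ : ℕ → ℝ) (S T : ℕ → ℕ → Set HexVertex) (n n' : ℕ → ℕ) (q q' : ℕ → HexVertex),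
            Tendsto δ atTop (𝓝[>] 0) →
            (∀ k, TameNestedFamily (δ k) R N (a (δ k)) (S k) ∧
              TameNestedFamily (δ k) R N (b (δ k)) (T k) ∧
              (((∀ i, ExteriorAnchored D.carrier (δ k) (S k i) (a (δ k))) ∧
          (∀ i, ExteriorAnchored D.carrier (δ k) (T k i) (b (δ k))) ∧
          (∀ (i : ℕ) (p q : HexVertex), HasCleanWindow D.carrier (δ k) ρ (S k i) p q →
            rowOf 0 q = rowOf 0 p + 1 ∧
              ∀ x : HexVertex, ((δ k : ℝ) : ℂ) * hexCenter x ∈ ball (((δ k : ℝ) : ℂ) * hexCenter q) ρ →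
                (x ∈ S k i ↔ rowOf 0 x ≤ rowOf 0 p)) ∧
          (∀ (i : ℕ) (p q : HexVertex), HasCleanWindow D.carrier (δ k) ρ (T k i) p q →
            rowOf 0 q = rowOf 0 p + 1 ∧
              ∀ x : HexVertex, ((δ k : ℝ) : ℂ) * hexCenter x ∈ ball (((δ k : ℝ) : ℂ) * hexCenter q) ρ →
                (x ∈ T k i ↔ rowOf 0 x ≤ rowOf 0 p))) ∧
          (∀ (i : ℕ) (p q : HexVertex), HasCleanWindow D.carrier (δ k) ρ (S k i) p q →
            ∃ K : Set ℂ, IsCompact K ∧ IsConnected K ∧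
              ((δ k : ℝ) : ℂ) * hexCenter q - ((ρ / 2 : ℝ) : ℂ) * Complex.I ∈ K ∧ ((δ k : ℝ) : ℂ) * hexCenter (a (δ k)) ∈ K ∧
              ∀ v : HexVertex, Metric.infDist (((δ k : ℝ) : ℂ) * hexCenter v) K ≤ ρ / 4 → v ∈ S k i) ∧
          (∀ (i : ℕ) (p q : HexVertex), HasCleanWindow D.carrier (δ k) ρ (T k i) p q →
            ∃ K : Set ℂ, IsCompact K ∧ IsConnected K ∧
              ((δ k : ℝ) : ℂ) * hexCenter q - ((ρ / 2 : ℝ) : ℂ) * Complex.I ∈ K ∧ ((δ k : ℝ) : ℂ) * hexCenter (b (δ k)) ∈ K ∧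
              ∀ v : HexVertex, Metric.infDist (((δ k : ℝ) : ℂ) * hexCenter v) K ≤ ρ / 4 → v ∈ T k i) ∧
          (∀ i : ℕ, ∃ K : Set ℂ, IsCompact K ∧ IsConnected K ∧ ((δ k : ℝ) : ℂ) * hexCenter (a (δ k)) ∈ K ∧
            (∀ v : HexVertex, Metric.infDist (((δ k : ℝ) : ℂ) * hexCenter v) K ≤ ρ / 8 → v ∈ S k i) ∧
            (∀ v ∈ S k i, ∃ (t w : HexVertex) (r : ℕ), v ∈ hexBall t r ∧ w ∈ hexBall t r ∧
              hexBall t r ⊆ S k i ∧ Metric.infDist (((δ k : ℝ) : ℂ) * hexCenter w) K ≤ ρ / 16)) ∧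
          (∀ i : ℕ, ∃ K : Set ℂ, IsCompact K ∧ IsConnected K ∧ ((δ k : ℝ) : ℂ) * hexCenter (b (δ k)) ∈ K ∧
            (∀ v : HexVertex, Metric.infDist (((δ k : ℝ) : ℂ) * hexCenter v) K ≤ ρ / 8 → v ∈ T k i) ∧
            (∀ v ∈ T k i, ∃ (t w : HexVertex) (r : ℕ), v ∈ hexBall t r ∧ w ∈ hexBall t r ∧
              hexBall t r ⊆ T k i ∧ Metric.infDist (((δ k : ℝ) : ℂ) * hexCenter w) K ≤ ρ / 16)))) →
            (∀ k, ∃ (γ : HexDomainSAW D.carrier (δ k) (a (δ k)) (b (δ k))) (m : ℕ) (p : HexVertex)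
                (m' : ℕ) (p' : HexVertex),
              IsFirstGoodGateN D.carrier (δ k) ρ R (S k) (a (δ k)) γ.walk.support (n k) m p (q k) ∧
              IsFirstGoodGateN D.carrier (δ k) ρ R (T k) (b (δ k)) γ.walk.support.reverse
                (n' k) m' p' (q' k) ∧
              WideLink D.carrier (δ k) ρ (S k (n k) ∪ T k (n' k)) (q k) (q' k)) →
            ∀ ε' > (0 : ℝ), ∀ φ : ℕ → ℕ, StrictMono φ →
              ∃ (ψ₀ : ℕ → ℕ) (E M : DobrushinDomain) (τ : ℂ) (x : ℕ → Site 2)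
                (φE : ConformalEquiv upperHalfPlaneSet E.carrier)
                (Φ : ConformalEquiv (upperHalfPlaneSet \ φE.pullbackHull M) upperHalfPlaneSet) (d : ℝ)
                (ρw ρc ρc' ρF : ℝ),
                (StrictMono ψ₀) ∧
                (StrictAnti fun j => δ (φ (ψ₀ j))) ∧
                (∀ j, 0 < δ (φ (ψ₀ j))) ∧
                (Tendsto (fun j => δ (φ (ψ₀ j))) atTop (𝓝[>] 0)) ∧
                (Tendsto (fun j => ((δ (φ (ψ₀ j)) : ℝ) : ℂ) * triEmbed (x j)) atTop (𝓝 τ)) ∧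
                (E.IsHullSubdomain M) ∧
                (∀ t : ℝ, dist (M.boundary t + τ) (D.boundary t) ≤ η) ∧
                (dist (M.pt 0 + τ) (D.pt 0) ≤ η) ∧
                (dist (M.pt 1 + τ) (D.pt 1) ≤ η) ∧
                (∀ i, E.carrier ∩ ball (E.pt i) ρw = {z : ℂ | (E.pt i).im < z.im} ∩ ball (E.pt i) ρw) ∧
                (∀ i (z : ℂ), |z.re - (E.pt i).re| ≤ ρc → (E.pt i).im - ρc' ≤ z.im → z.im ≤ (E.pt i).im → z ∉ E.carrier) ∧
                (0 < ρc) ∧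
                (0 < ρc') ∧
                (0 < ρF) ∧
                (ρF ≤ ρc) ∧
                (ρF ≤ ρc') ∧
                (ρF ≤ ρw) ∧
                (2 * (ρc + ρc') + ρF ≤ dist (E.pt 0) (E.pt 1)) ∧
                (E.IsChordalUniformizing φE) ∧
                (IsRestrictionMap (φE.pullbackHull M) Φ) ∧
                (HasRestrictionDeriv (φE.pullbackHull M) Φ d) ∧
                (1 - ε' < d ^ ((5 : ℝ) / 8)) ∧
                (∀ j, (q (φ (ψ₀ j))).2 = 0) ∧
                (∀ j, (q' (φ (ψ₀ j))).2 = 0) ∧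
                (Tendsto (fun j => ((δ (φ (ψ₀ j)) : ℝ) : ℂ) * hexCenter (((q (φ (ψ₀ j))).1 - x j, 0) : HexVertex)) atTop (𝓝 (E.pt 0))) ∧
                (Tendsto (fun j => ((δ (φ (ψ₀ j)) : ℝ) : ℂ) * hexCenter (((q' (φ (ψ₀ j))).1 - x j, 0) : HexVertex)) atTop (𝓝 (E.pt 1))) ∧
                (∀ j, (E.pt 0).im < (((δ (φ (ψ₀ j)) : ℝ) : ℂ) * hexCenter (((q (φ (ψ₀ j))).1 - x j, 0) : HexVertex)).im) ∧
                (∀ j, (E.pt 1).im < (((δ (φ (ψ₀ j)) : ℝ) : ℂ) * hexCenter (((q' (φ (ψ₀ j))).1 - x j, 0) : HexVertex)).im) ∧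
                (∀ᶠ j in atTop, ∀ v : HexVertex, ((δ (φ (ψ₀ j)) : ℝ) : ℂ) * hexCenter v - ((δ (φ (ψ₀ j)) : ℝ) : ℂ) * triEmbed (x j) ∈ ball (E.pt 0) ρF → (v ∈ S (φ (ψ₀ j)) (n (φ (ψ₀ j))) ∪ T (φ (ψ₀ j)) (n' (φ (ψ₀ j))) ↔ v.1 1 < (q (φ (ψ₀ j))).1 1)) ∧
                (∀ᶠ j in atTop, ∀ v : HexVertex, ((δ (φ (ψ₀ j)) : ℝ) : ℂ) * hexCenter v - ((δ (φ (ψ₀ j)) : ℝ) : ℂ) * triEmbed (x j) ∈ ball (E.pt 1) ρF → (v ∈ S (φ (ψ₀ j)) (n (φ (ψ₀ j))) ∪ T (φ (ψ₀ j)) (n' (φ (ψ₀ j))) ↔ v.1 1 < (q' (φ (ψ₀ j))).1 1)) ∧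
                (∀ᶠ j in atTop, ∀ z : ℂ, (z ∈ M.carrier ∨ ∃ i, dist z (E.pt i) ≤ 2 * ρc) → z + ((δ (φ (ψ₀ j)) : ℝ) : ℂ) * triEmbed (x j) ∈ D.carrier) ∧
                (∀ᶠ j in atTop, ∀ v : HexVertex, ((δ (φ (ψ₀ j)) : ℝ) : ℂ) * hexCenter v - ((δ (φ (ψ₀ j)) : ℝ) : ℂ) * triEmbed (x j) ∈ M.carrier → (∀ i, ρF ≤ dist (((δ (φ (ψ₀ j)) : ℝ) : ℂ) * hexCenter v - ((δ (φ (ψ₀ j)) : ℝ) : ℂ) * triEmbed (x j)) (E.pt i)) → v ∉ S (φ (ψ₀ j)) (n (φ (ψ₀ j))) ∪ T (φ (ψ₀ j)) (n' (φ (ψ₀ j)))) ∧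
                (∀ᶠ j in atTop, ∀ (w : HexVertex) (π : (hexDomainGraph D.carrier (δ (φ (ψ₀ j)))).Walk (q (φ (ψ₀ j))) w), (∀ y ∈ π.support, y ∉ S (φ (ψ₀ j)) (n (φ (ψ₀ j))) ∪ T (φ (ψ₀ j)) (n' (φ (ψ₀ j)))) → ∀ y ∈ π.support, ((δ (φ (ψ₀ j)) : ℝ) : ℂ) * hexCenter y - ((δ (φ (ψ₀ j)) : ℝ) : ℂ) * triEmbed (x j) ∈ E.carrier ∧ closedBall (((δ (φ (ψ₀ j)) : ℝ) : ℂ) * hexCenter y - ((δ (φ (ψ₀ j)) : ℝ) : ℂ) * triEmbed (x j)) (25 * δ (φ (ψ₀ j))) ⊆ E.carrier ∪ ⋃ i, {z : ℂ | |z.re - (E.pt i).re| ≤ ρc ∧ (E.pt i).im - 30 * δ (φ (ψ₀ j)) ≤ z.im ∧ z.im ≤ (E.pt i).im} ∧ (|(((δ (φ (ψ₀ j)) : ℝ) : ℂ) * hexCenter y - ((δ (φ (ψ₀ j)) : ℝ) : ℂ) * triEmbed (x j)).re - (E.pt 0).re| < ρc + 10 * δ (φ (ψ₀ j)) → |(((δ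 (φ (ψ₀ j)) : ℝ) : ℂ) * hexCenter y - ((δ (φ (ψ₀ j)) : ℝ) : ℂ) * triEmbed (x j)).im - (E.pt 0).im| < ρc' → (q (φ (ψ₀ j))).1 1 ≤ y.1 1) ∧ (|(((δ (φ (ψ₀ j)) : ℝ) : ℂ) * hexCenter y - ((δ (φ (ψ₀ j)) : ℝ) : ℂ) * triEmbed (x j)).re - (E.pt 1).re| < ρc + 10 * δ (φ (ψ₀ j)) → |(((δ (φ (ψ₀ j)) : ℝ) : ℂ) * hexCenter y - ((δ (φ (ψ₀ j)) : ℝ) : ℂ) * triEmbed (x j)).im - (E.pt 1).im| < ρc' → (q' (φ (ψ₀ j))).1 1 ≤ y.1 1)) ∧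
                (∀ j, q (φ (ψ₀ j)) ∈ embMeshDomain hexGraph hexCenter D.carrier (δ (φ (ψ₀ j)))) ∧
                (∀ᶠ j in atTop, IsProbabilityMeasure (carvedLaw D.carrier (δ (φ (ψ₀ j))) (S (φ (ψ₀ j)) (n (φ (ψ₀ j))) ∪ T (φ (ψ₀ j)) (n' (φ (ψ₀ j)))) (q (φ (ψ₀ j))) (q' (φ (ψ₀ j)))))) := by
  intro D a b hab η hη
  obtain ⟨Ra, hRa, hsel⟩ := Summit.CriticalPhenomena.SAWScalingLimit.Theorems.ObservableToSLE.TypeLadder.carvedReduction_squeezeGeometry_selection D a b hab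
  obtain ⟨Rb, hRb, hdom⟩ := stub_carvedReduction_squeezeGeometry_domains D a b hab η hη
  refine ⟨min Ra Rb, lt_min hRa hRb, fun R hR ρ hρ N δ S T n n' q q' hδ hfam hgates ε' hε' φ hφ => ?_⟩
  obtain ⟨ψ₀, x, τ, P₀, P₁, hfacts⟩ :=
    hsel R ⟨hR.1, hR.2.trans (min_le_left _ _)⟩ ρ hρ N δ S T n n' q q' hδ hfam hgates φ hφ
  exact hdom R ⟨hR.1, hR.2.trans (min_le_right _ _)⟩ ρ hρ N δ S T n n' q q' hδ hfam hgates ε' hε' φ hφ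
    ψ₀ x τ P₀ P₁ hfacts

/-- STUB STAGE 2′ `stub_carvedReduction_squeezeGeometry_lattice2` (twin r12 registered leaf; **LANDED p154374**, wired r15) — **the lattice
half of T-A with the corrected (MU)**: verbatim the LANDED STAGE 2 `TypeLadder.carvedReduction_squeezeGeometry_lattice` (p137080)
except that hypothesis (MU) is the FIXED-RADIUS form (MU_F) "pinned removed vertices `ρF`-off both gates are not in `M`" instead
of "`∀ r > 0`, … `r`-off …" (unsatisfiable: wave-5 finding, a band of removed rows may sit above the limit line at one gate,
inside `M`'s flat half-disc).  Proof = p137080's with `squeeze_cells` (p136631) re-run at exemption radius `ρF` (≤ ρc, ρc'):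
inside `ball (E.pt i) ρF` a family member lies in the `(ρc + 10 s) × ρc'` box, so the ROW CLAUSE of the family depth
(`twoPiece_nested_families`, output `hdepth`, second conjunct) gives `gate row ≤ row`, while (U) at radius `ρF` says removed
vertices there have `row < gate row`. -/
theorem stub_carvedReduction_squeezeGeometry_lattice2 (D : DobrushinDomain) (δ : ℕ → ℝ)
    (S T : ℕ → ℕ → Set HexVertex) (n n' : ℕ → ℕ) (q q' : ℕ → HexVertex) (η ε' : ℝ) (φ ψ₀ : ℕ → ℕ)
    (E M : DobrushinDomain) (τ : ℂ) (x : ℕ → Site 2) (φE : ConformalEquiv upperHalfPlaneSet E.carrier)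
    (Φ : ConformalEquiv (upperHalfPlaneSet \ φE.pullbackHull M) upperHalfPlaneSet) (d : ℝ)
    (ρw ρc ρc' ρF : ℝ)
    (hψ₀ : StrictMono ψ₀) (hsanti : StrictAnti fun j => δ (φ (ψ₀ j))) (hspos : ∀ j, 0 < δ (φ (ψ₀ j)))
    (hs0 : Tendsto (fun j => δ (φ (ψ₀ j))) atTop (𝓝[>] 0))
    (hτ : Tendsto (fun j => ((δ (φ (ψ₀ j)) : ℝ) : ℂ) * triEmbed (x j)) atTop (𝓝 τ))
    (hM : E.IsHullSubdomain M)
    (hbd : ∀ t : ℝ, dist (M.boundary t + τ) (D.boundary t) ≤ η)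
    (hbd0 : dist (M.pt 0 + τ) (D.pt 0) ≤ η) (hbd1 : dist (M.pt 1 + τ) (D.pt 1) ≤ η)
    (hflat : ∀ i, E.carrier ∩ ball (E.pt i) ρw = {z : ℂ | (E.pt i).im < z.im} ∩ ball (E.pt i) ρw)
    (hB : ∀ i (z : ℂ), |z.re - (E.pt i).re| ≤ ρc → (E.pt i).im - ρc' ≤ z.im → z.im ≤ (E.pt i).im →
      z ∉ E.carrier)
    (hρc : 0 < ρc) (hρc' : 0 < ρc') (hρF : 0 < ρF) (hFc : ρF ≤ ρc) (hFc' : ρF ≤ ρc') (hFw : ρF ≤ ρw)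
    (hsep : 2 * (ρc + ρc') + ρF ≤ dist (E.pt 0) (E.pt 1))
    (hφE : E.IsChordalUniformizing φE) (hΦ : IsRestrictionMap (φE.pullbackHull M) Φ)
    (hd : HasRestrictionDeriv (φE.pullbackHull M) Φ d) (hlev : 1 - ε' < d ^ ((5 : ℝ) / 8))
    -- (g) the pinned gates
    (hq0 : ∀ j, (q (φ (ψ₀ j))).2 = 0) (hq1 : ∀ j, (q' (φ (ψ₀ j))).2 = 0)
    (hconv0 : Tendsto (fun j => ((δ (φ (ψ₀ j)) : ℝ) : ℂ) *
      hexCenter (((q (φ (ψ₀ j))).1 - x j, 0) : HexVertex)) atTop (𝓝 (E.pt 0)))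
    (hconv1 : Tendsto (fun j => ((δ (φ (ψ₀ j)) : ℝ) : ℂ) *
      hexCenter (((q' (φ (ψ₀ j))).1 - x j, 0) : HexVertex)) atTop (𝓝 (E.pt 1)))
    (habove0 : ∀ j, (E.pt 0).im <
      (((δ (φ (ψ₀ j)) : ℝ) : ℂ) * hexCenter (((q (φ (ψ₀ j))).1 - x j, 0) : HexVertex)).im)
    (habove1 : ∀ j, (E.pt 1).im <
      (((δ (φ (ψ₀ j)) : ℝ) : ℂ) * hexCenter (((q' (φ (ψ₀ j))).1 - x j, 0) : HexVertex)).im)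
    -- (U) exactness of the removed set near the pinned gates
    (hU0 : ∀ᶠ j in atTop, ∀ v : HexVertex,
      ((δ (φ (ψ₀ j)) : ℝ) : ℂ) * hexCenter v - ((δ (φ (ψ₀ j)) : ℝ) : ℂ) * triEmbed (x j) ∈ ball (E.pt 0) ρF →
        (v ∈ S (φ (ψ₀ j)) (n (φ (ψ₀ j))) ∪ T (φ (ψ₀ j)) (n' (φ (ψ₀ j))) ↔ v.1 1 < (q (φ (ψ₀ j))).1 1))
    (hU1 : ∀ᶠ j in atTop, ∀ v : HexVertex,
      ((δ (φ (ψ₀ j)) : ℝ) : ℂ) * hexCenter v - ((δ (φ (ψ₀ j)) : ℝ) : ℂ) * triEmbed (x j) ∈ ball (E.pt 1) ρF →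
        (v ∈ S (φ (ψ₀ j)) (n (φ (ψ₀ j))) ∪ T (φ (ψ₀ j)) (n' (φ (ψ₀ j))) ↔ v.1 1 < (q' (φ (ψ₀ j))).1 1))
    -- (MD), (MU)
    (hMD : ∀ᶠ j in atTop, ∀ z : ℂ, (z ∈ M.carrier ∨ ∃ i, dist z (E.pt i) ≤ 2 * ρc) →
      z + ((δ (φ (ψ₀ j)) : ℝ) : ℂ) * triEmbed (x j) ∈ D.carrier)
    (hMU : ∀ᶠ j in atTop, ∀ v : HexVertex,
      ((δ (φ (ψ₀ j)) : ℝ) : ℂ) * hexCenter v - ((δ (φ (ψ₀ j)) : ℝ) : ℂ) * triEmbed (x j) ∈ M.carrier →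
        (∀ i, ρF ≤ dist (((δ (φ (ψ₀ j)) : ℝ) : ℂ) * hexCenter v - ((δ (φ (ψ₀ j)) : ℝ) : ℂ) * triEmbed (x j))
          (E.pt i)) →
        v ∉ S (φ (ψ₀ j)) (n (φ (ψ₀ j))) ∪ T (φ (ψ₀ j)) (n' (φ (ψ₀ j))))
    -- (R) the reach of the gate is clearly deep in `E`
    (hreach : ∀ᶠ j in atTop, ∀ (w : HexVertex)
      (π : (hexDomainGraph D.carrier (δ (φ (ψ₀ j)))).Walk (q (φ (ψ₀ j))) w),
      (∀ y ∈ π.support, y ∉ S (φ (ψ₀ j)) (n (φ (ψ₀ j))) ∪ T (φ (ψ₀ j)) (n' (φ (ψ₀ j)))) →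
        ∀ y ∈ π.support,
          ((δ (φ (ψ₀ j)) : ℝ) : ℂ) * hexCenter y - ((δ (φ (ψ₀ j)) : ℝ) : ℂ) * triEmbed (x j) ∈ E.carrier ∧
          closedBall (((δ (φ (ψ₀ j)) : ℝ) : ℂ) * hexCenter y - ((δ (φ (ψ₀ j)) : ℝ) : ℂ) * triEmbed (x j))
              (25 * δ (φ (ψ₀ j))) ⊆ E.carrier ∪
            ⋃ i, {z : ℂ | |z.re - (E.pt i).re| ≤ ρc ∧ (E.pt i).im - 30 * δ (φ (ψ₀ j)) ≤ z.im ∧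
              z.im ≤ (E.pt i).im} ∧
          (|(((δ (φ (ψ₀ j)) : ℝ) : ℂ) * hexCenter y - ((δ (φ (ψ₀ j)) : ℝ) : ℂ) * triEmbed (x j)).re -
                (E.pt 0).re| < ρc + 10 * δ (φ (ψ₀ j)) →
            |(((δ (φ (ψ₀ j)) : ℝ) : ℂ) * hexCenter y - ((δ (φ (ψ₀ j)) : ℝ) : ℂ) * triEmbed (x j)).im -
                (E.pt 0).im| < ρc' → (q (φ (ψ₀ j))).1 1 ≤ y.1 1) ∧
          (|(((δ (φ (ψ₀ j)) : ℝ) : ℂ) * hexCenter y - ((δ (φ (ψ₀ j)) : ℝ) : ℂ) * triEmbed (x j)).re -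
                (E.pt 1).re| < ρc + 10 * δ (φ (ψ₀ j)) →
            |(((δ (φ (ψ₀ j)) : ℝ) : ℂ) * hexCenter y - ((δ (φ (ψ₀ j)) : ℝ) : ℂ) * triEmbed (x j)).im -
                (E.pt 1).im| < ρc' → (q' (φ (ψ₀ j))).1 1 ≤ y.1 1))
    (hqdom : ∀ j, q (φ (ψ₀ j)) ∈ embMeshDomain hexGraph hexCenter D.carrier (δ (φ (ψ₀ j))))
    (hprob : ∀ᶠ j in atTop, IsProbabilityMeasure (carvedLaw D.carrier (δ (φ (ψ₀ j)))
      (S (φ (ψ₀ j)) (n (φ (ψ₀ j))) ∪ T (φ (ψ₀ j)) (n' (φ (ψ₀ j)))) (q (φ (ψ₀ j))) (q' (φ (ψ₀ j))))) :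
    ∃ (ψ : ℕ → ℕ) (M : DobrushinDomain) (τ : ℂ) (ρ' : ℝ) (Λ' : ℝ → Finset HexVertex)
      (m : Fin 2 → ℝ → ℤ) (a' b' : ℝ → Sym2 HexVertex) (x : ℕ → Site 2)
      (Λ'' : ℕ → Finset HexVertex) (pu pv : ℕ → HexVertex),
      StrictMono ψ ∧
      (∀ t : ℝ, dist (M.boundary t + τ) (D.boundary t) ≤ η) ∧
      dist (M.pt 0 + τ) (D.pt 0) ≤ η ∧ dist (M.pt 1 + τ) (D.pt 1) ≤ η ∧
      (0 < ρ' ∧ ∀ i : Fin 2,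
        M.carrier ∩ ball (M.pt i) ρ' = {z : ℂ | (M.pt i).im < z.im} ∩ ball (M.pt i) ρ') ∧
      (∀ᶠ δ' : ℝ in 𝓝[>] 0, hexDomainSimplyConnected (Λ' δ') ∧
        a' δ' ∈ hexDomainBoundary (Λ' δ') ∧ b' δ' ∈ hexDomainBoundary (Λ' δ') ∧
        Nonempty (HexMidEdgeSAW (Λ' δ') (a' δ') (b' δ')) ∧
        (hexGraph.induce (↑(Λ' δ') : Set HexVertex)).Preconnected ∧
        (∀ v ∈ Λ' δ', (δ' : ℂ) * hexCenter v ∈ M.carrier) ∧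
        (∀ i : Fin 2, ∀ v : HexVertex, (δ' : ℂ) * hexCenter v ∈ ball (M.pt i) ρ' →
          (v ∈ Λ' δ' ↔ m i δ' ≤ v.1 1))) ∧
      (∀ K : Set ℂ, IsCompact K → K ⊆ M.carrier →
        ∀ᶠ δ' : ℝ in 𝓝[>] 0, ∀ v : HexVertex, (δ' : ℂ) * hexCenter v ∈ K → v ∈ Λ' δ') ∧
      Tendsto (fun δ' : ℝ => (δ' : ℂ) * hexMidpoint (a' δ')) (𝓝[>] 0) (𝓝 (M.pt 0)) ∧
      Tendsto (fun δ' : ℝ => (δ' : ℂ) * hexMidpoint (b' δ')) (𝓝[>] 0) (𝓝 (M.pt 1)) ∧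
      Tendsto (fun j : ℕ => ((δ (φ (ψ j)) : ℝ) : ℂ) *
        Literature.Probability.LatticeModels.triEmbed (x j)) atTop (𝓝 τ) ∧
      (∀ j : ℕ,
        (∀ w : HexVertex, w ∈ Λ'' j ↔ ((-(x j) + w.1, w.2) : HexVertex) ∈ Λ' (δ (φ (ψ j)))) ∧
        (∀ w ∈ Λ'' j, w ∉ S (φ (ψ j)) (n (φ (ψ j))) ∪ T (φ (ψ j)) (n' (φ (ψ j)))) ∧
        (∀ w ∈ Λ'' j, ∀ y ∈ Λ'' j, hexGraph.Adj w y →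
          (hexDomainGraph D.carrier (δ (φ (ψ j)))).Adj w y) ∧
        q (φ (ψ j)) ∈ Λ'' j ∧
        pu j ∈ S (φ (ψ j)) (n (φ (ψ j))) ∪ T (φ (ψ j)) (n' (φ (ψ j))) ∧
        pv j ∈ S (φ (ψ j)) (n (φ (ψ j))) ∪ T (φ (ψ j)) (n' (φ (ψ j))) ∧
        hexGraph.Adj (q (φ (ψ j))) (pu j) ∧
        s(q (φ (ψ j)), pu j) ≠ s(q' (φ (ψ j)), pv j) ∧
        (a' (δ (φ (ψ j)))).map (fun w : HexVertex => ((x j + w.1, w.2) : HexVertex)) =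
          s(q (φ (ψ j)), pu j) ∧
        (b' (δ (φ (ψ j)))).map (fun w : HexVertex => ((x j + w.1, w.2) : HexVertex)) =
          s(q' (φ (ψ j)), pv j)) ∧
      ∃ (E : DobrushinDomain) (ρE : ℝ) (φE : ConformalEquiv upperHalfPlaneSet E.carrier)
        (Φ : ConformalEquiv (upperHalfPlaneSet \ φE.pullbackHull M) upperHalfPlaneSet) (d : ℝ)
        (Nf : ℝ → Finset HexVertex) (m₀ m₁ m₁' : ℝ → ℤ),
        (0 < ρE ∧ ∀ i : Fin 2,
          E.carrier ∩ ball (E.pt i) ρE = {z : ℂ | (E.pt i).im < z.im} ∩ ball (E.pt i) ρE) ∧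
        E.IsHullSubdomain M ∧ E.IsChordalUniformizing φE ∧
        IsRestrictionMap (φE.pullbackHull M) Φ ∧ HasRestrictionDeriv (φE.pullbackHull M) Φ d ∧
        1 - ε' < d ^ ((5 : ℝ) / 8) ∧
        (∀ᶠ δ' : ℝ in 𝓝[>] 0,
          Λ' δ' ⊆ Nf δ' ∧ hexDomainSimplyConnected (Nf δ') ∧ hexDomainSimplyConnected (Λ' δ') ∧
          (hexGraph.induce (↑(Nf δ') : Set HexVertex)).Preconnected ∧
          (hexGraph.induce (↑(Λ' δ') : Set HexVertex)).Preconnected ∧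
          a' δ' ∈ hexDomainBoundary (Nf δ') ∧ b' δ' ∈ hexDomainBoundary (Nf δ') ∧
          a' δ' ∈ hexDomainBoundary (Λ' δ') ∧ b' δ' ∈ hexDomainBoundary (Λ' δ') ∧
          Nonempty (HexMidEdgeSAW (Λ' δ') (a' δ') (b' δ')) ∧
          (∀ w ∈ Nf δ', (δ' : ℂ) * hexCenter w ∈ E.carrier) ∧
          (∀ w ∈ Λ' δ', (δ' : ℂ) * hexCenter w ∈ M.carrier) ∧
          (∀ w : HexVertex, (δ' : ℂ) * hexCenter w ∈ ball (E.pt 0) ρE →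
            ((w ∈ Nf δ' ↔ m₀ δ' ≤ w.1 1) ∧ (w ∈ Λ' δ' ↔ m₀ δ' ≤ w.1 1))) ∧
          (∀ w : HexVertex, (δ' : ℂ) * hexCenter w ∈ ball (E.pt 1) ρE →
            ((w ∈ Nf δ' ↔ m₁ δ' ≤ w.1 1) ∧ (w ∈ Λ' δ' ↔ m₁' δ' ≤ w.1 1)))) ∧
        (∀ K : Set ℂ, IsCompact K → K ⊆ E.carrier →
          ∀ᶠ δ' : ℝ in 𝓝[>] 0, ∀ w : HexVertex, (δ' : ℂ) * hexCenter w ∈ K → w ∈ Nf δ') ∧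
        (∀ K : Set ℂ, IsCompact K → K ⊆ M.carrier →
          ∀ᶠ δ' : ℝ in 𝓝[>] 0, ∀ w : HexVertex, (δ' : ℂ) * hexCenter w ∈ K → w ∈ Λ' δ') ∧
        Tendsto (fun δ' : ℝ => (δ' : ℂ) * hexMidpoint (a' δ')) (𝓝[>] 0) (𝓝 (E.pt 0)) ∧
        Tendsto (fun δ' : ℝ => (δ' : ℂ) * hexMidpoint (b' δ')) (𝓝[>] 0) (𝓝 (E.pt 1)) ∧
        (∀ᶠ j : ℕ in atTop,
          IsProbabilityMeasure (carvedLaw D.carrier (δ (φ (ψ j)))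
            (S (φ (ψ j)) (n (φ (ψ j))) ∪ T (φ (ψ j)) (n' (φ (ψ j)))) (q (φ (ψ j))) (q' (φ (ψ j)))) ∧
          (∀ w : HexVertex, w ∈ Λ'' j ↔ ((-(x j) + w.1, w.2) : HexVertex) ∈ Λ' (δ (φ (ψ j)))) ∧
          (∀ w ∈ Λ'' j, w ∉ S (φ (ψ j)) (n (φ (ψ j))) ∪ T (φ (ψ j)) (n' (φ (ψ j)))) ∧
          (∀ w ∈ Λ'' j, ∀ y ∈ Λ'' j, hexGraph.Adj w y →
            (hexDomainGraph D.carrier (δ (φ (ψ j)))).Adj w y) ∧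
          q (φ (ψ j)) ∈ Λ'' j ∧
          pu j ∈ S (φ (ψ j)) (n (φ (ψ j))) ∪ T (φ (ψ j)) (n' (φ (ψ j))) ∧
          pv j ∈ S (φ (ψ j)) (n (φ (ψ j))) ∪ T (φ (ψ j)) (n' (φ (ψ j))) ∧
          hexGraph.Adj (q (φ (ψ j))) (pu j) ∧
          s(q (φ (ψ j)), pu j) ≠ s(q' (φ (ψ j)), pv j) ∧
          (a' (δ (φ (ψ j)))).map (fun w : HexVertex => ((x j + w.1, w.2) : HexVertex)) =
            s(q (φ (ψ j)), pu j) ∧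
          (b' (δ (φ (ψ j)))).map (fun w : HexVertex => ((x j + w.1, w.2) : HexVertex)) =
            s(q' (φ (ψ j)), pv j) ∧
          (∀ (w : HexVertex) (π : (hexDomainGraph D.carrier (δ (φ (ψ j)))).Walk (q (φ (ψ j))) w),
            (∀ y ∈ π.support, y ∉ S (φ (ψ j)) (n (φ (ψ j))) ∪ T (φ (ψ j)) (n' (φ (ψ j)))) →
              ∀ y ∈ π.support, ((-(x j) + y.1, y.2) : HexVertex) ∈ Nf (δ (φ (ψ j)))) ∧
          ((-(x j) + (pu j).1, (pu j).2) : HexVertex) ∉ Nf (δ (φ (ψ j))) ∧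
          ((-(x j) + (pv j).1, (pv j).2) : HexVertex) ∉ Nf (δ (φ (ψ j)))) :=
  -- LANDED (twin wave 6, p154374: Theorems/SAWDevelopingMapObservableToSLETypeLadderCarvedReductionSqueezeLattice2.lean)
  Summit.CriticalPhenomena.SAWScalingLimit.Theorems.ObservableToSLE.TypeLadder.carvedReduction_squeezeGeometry_lattice2
    D δ S T n n' q q' η ε' φ ψ₀ E M τ x φE Φ d ρw ρc ρc' ρF hψ₀ hsanti hspos hs0 hτ hM hbd hbd0 hbd1 hflat hB hρc hρc'
    hρF hFc hFc' hFw hsep hφE hΦ hd hlev hq0 hq1 hconv0 hconv1 habove0 habove1 hU0 hU1 hMD hMU hreach hqdom hprob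

/-- STUB T-A `stub_carvedReduction_squeezeGeometry` (r8 leaf; from r10 GLUE = STAGE 2 (p137080) ∘ T-A′ ∘ STAGE 1a (p137830); size XL — THE GEOMETRY of the moving-carving
squeeze for solid families; what remains of T2b″ after wave 2's 14 landed pieces Ratio p131716, Shadow p132188, Reverse p132576,
Escape p132758, Inner p133010, Select p133194, FamilyCore p133276, Hexagons p133791, FamilyAscent p133885, FamilyGates p134188,
Family p134423 (`twoPiece_exists_innerFamily`, the two-piece M1 port), Prob p134516, Faces p134609, Contain p134719; memo
`work/stubs/T2bsolid-PLAN.md` §T-A): all hypotheses of T2b″ except ARL″ give the conclusion data (C1)–(C8) of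
`MovingCarvingSqueezeP FatAnchoredClassZeroSolid` AND the squeeze package consumed by the landed T-B
`TypeLadder.stub_carvedReduction_ratioSqueeze` (outer two-piece flat Jordan approximant `E` with gate boxes removed, inner hull
subdomain `M`, restriction datum with `1 - ε' < d^{5/8}`, nested admissible families `Nf ⊇ Λ'`, outer containment of the
carved walks, probability of the carved laws). -/
theorem stub_carvedReduction_squeezeGeometry :
    (∀ (D : DobrushinDomain) (a b : ℝ → HexVertex), IsEmbEndpointApprox hexGraph hexCenter D a b →
      ∀ η > (0 : ℝ), ∃ R₀ > (0 : ℝ), ∀ R ∈ Set.Ioc (0 : ℝ) R₀, ∀ ρ > (0 : ℝ), ∀ N : ℕ,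
          ∀ (δ : ℕ → ℝ) (S T : ℕ → ℕ → Set HexVertex) (n n' : ℕ → ℕ) (q q' : ℕ → HexVertex),
            Tendsto δ atTop (𝓝[>] 0) →
            (∀ k, TameNestedFamily (δ k) R N (a (δ k)) (S k) ∧
              TameNestedFamily (δ k) R N (b (δ k)) (T k) ∧
              (((∀ i, ExteriorAnchored D.carrier (δ k) (S k i) (a (δ k))) ∧
          (∀ i, ExteriorAnchored D.carrier (δ k) (T k i) (b (δ k))) ∧
          (∀ (i : ℕ) (p q : HexVertex), HasCleanWindow D.carrier (δ k) ρ (S k i) p q →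
            rowOf 0 q = rowOf 0 p + 1 ∧
              ∀ x : HexVertex, ((δ k : ℝ) : ℂ) * hexCenter x ∈ ball (((δ k : ℝ) : ℂ) * hexCenter q) ρ →
                (x ∈ S k i ↔ rowOf 0 x ≤ rowOf 0 p)) ∧
          (∀ (i : ℕ) (p q : HexVertex), HasCleanWindow D.carrier (δ k) ρ (T k i) p q →
            rowOf 0 q = rowOf 0 p + 1 ∧
              ∀ x : HexVertex, ((δ k : ℝ) : ℂ) * hexCenter x ∈ ball (((δ k : ℝ) : ℂ) * hexCenter q) ρ →
                (x ∈ T k i ↔ rowOf 0 x ≤ rowOf 0 p))) ∧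
          (∀ (i : ℕ) (p q : HexVertex), HasCleanWindow D.carrier (δ k) ρ (S k i) p q →
            ∃ K : Set ℂ, IsCompact K ∧ IsConnected K ∧
              ((δ k : ℝ) : ℂ) * hexCenter q - ((ρ / 2 : ℝ) : ℂ) * Complex.I ∈ K ∧ ((δ k : ℝ) : ℂ) * hexCenter (a (δ k)) ∈ K ∧
              ∀ v : HexVertex, Metric.infDist (((δ k : ℝ) : ℂ) * hexCenter v) K ≤ ρ / 4 → v ∈ S k i) ∧
          (∀ (i : ℕ) (p q : HexVertex), HasCleanWindow D.carrier (δ k) ρ (T k i) p q →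
            ∃ K : Set ℂ, IsCompact K ∧ IsConnected K ∧
              ((δ k : ℝ) : ℂ) * hexCenter q - ((ρ / 2 : ℝ) : ℂ) * Complex.I ∈ K ∧ ((δ k : ℝ) : ℂ) * hexCenter (b (δ k)) ∈ K ∧
              ∀ v : HexVertex, Metric.infDist (((δ k : ℝ) : ℂ) * hexCenter v) K ≤ ρ / 4 → v ∈ T k i) ∧
          (∀ i : ℕ, ∃ K : Set ℂ, IsCompact K ∧ IsConnected K ∧ ((δ k : ℝ) : ℂ) * hexCenter (a (δ k)) ∈ K ∧
            (∀ v : HexVertex, Metric.infDist (((δ k : ℝ) : ℂ) * hexCenter v) K ≤ ρ / 8 → v ∈ S k i) ∧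
            (∀ v ∈ S k i, ∃ (t w : HexVertex) (r : ℕ), v ∈ hexBall t r ∧ w ∈ hexBall t r ∧
              hexBall t r ⊆ S k i ∧ Metric.infDist (((δ k : ℝ) : ℂ) * hexCenter w) K ≤ ρ / 16)) ∧
          (∀ i : ℕ, ∃ K : Set ℂ, IsCompact K ∧ IsConnected K ∧ ((δ k : ℝ) : ℂ) * hexCenter (b (δ k)) ∈ K ∧
            (∀ v : HexVertex, Metric.infDist (((δ k : ℝ) : ℂ) * hexCenter v) K ≤ ρ / 8 → v ∈ T k i) ∧
            (∀ v ∈ T k i, ∃ (t w : HexVertex) (r : ℕ), v ∈ hexBall t r ∧ w ∈ hexBall t r ∧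
              hexBall t r ⊆ T k i ∧ Metric.infDist (((δ k : ℝ) : ℂ) * hexCenter w) K ≤ ρ / 16)))) →
            (∀ k, ∃ (γ : HexDomainSAW D.carrier (δ k) (a (δ k)) (b (δ k))) (m : ℕ) (p : HexVertex)
                (m' : ℕ) (p' : HexVertex),
              IsFirstGoodGateN D.carrier (δ k) ρ R (S k) (a (δ k)) γ.walk.support (n k) m p (q k) ∧
              IsFirstGoodGateN D.carrier (δ k) ρ R (T k) (b (δ k)) γ.walk.support.reverse
                (n' k) m' p' (q' k) ∧
              WideLink D.carrier (δ k) ρ (S k (n k) ∪ T k (n' k)) (q k) (q' k)) →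
            ∀ ε' > (0 : ℝ), ∀ φ : ℕ → ℕ, StrictMono φ →
              ∃ (ψ : ℕ → ℕ) (M : DobrushinDomain) (τ : ℂ) (ρ' : ℝ) (Λ' : ℝ → Finset HexVertex)
                (m : Fin 2 → ℝ → ℤ) (a' b' : ℝ → Sym2 HexVertex) (x : ℕ → Site 2)
                (Λ'' : ℕ → Finset HexVertex) (pu pv : ℕ → HexVertex),
                StrictMono ψ ∧
                (∀ t : ℝ, dist (M.boundary t + τ) (D.boundary t) ≤ η) ∧
                dist (M.pt 0 + τ) (D.pt 0) ≤ η ∧ dist (M.pt 1 + τ) (D.pt 1) ≤ η ∧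
                (0 < ρ' ∧ ∀ i : Fin 2,
                  M.carrier ∩ ball (M.pt i) ρ' = {z : ℂ | (M.pt i).im < z.im} ∩ ball (M.pt i) ρ') ∧
                (∀ᶠ δ' : ℝ in 𝓝[>] 0, hexDomainSimplyConnected (Λ' δ') ∧
                  a' δ' ∈ hexDomainBoundary (Λ' δ') ∧ b' δ' ∈ hexDomainBoundary (Λ' δ') ∧
                  Nonempty (HexMidEdgeSAW (Λ' δ') (a' δ') (b' δ')) ∧
                  (hexGraph.induce (↑(Λ' δ') : Set HexVertex)).Preconnected ∧
                  (∀ v ∈ Λ' δ', (δ' : ℂ) * hexCenter v ∈ M.carrier) ∧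
                  (∀ i : Fin 2, ∀ v : HexVertex, (δ' : ℂ) * hexCenter v ∈ ball (M.pt i) ρ' →
                    (v ∈ Λ' δ' ↔ m i δ' ≤ v.1 1))) ∧
                (∀ K : Set ℂ, IsCompact K → K ⊆ M.carrier →
                  ∀ᶠ δ' : ℝ in 𝓝[>] 0, ∀ v : HexVertex, (δ' : ℂ) * hexCenter v ∈ K → v ∈ Λ' δ') ∧
                Tendsto (fun δ' : ℝ => (δ' : ℂ) * hexMidpoint (a' δ')) (𝓝[>] 0) (𝓝 (M.pt 0)) ∧
                Tendsto (fun δ' : ℝ => (δ' : ℂ) * hexMidpoint (b' δ')) (𝓝[>] 0) (𝓝 (M.pt 1)) ∧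
                Tendsto (fun j : ℕ => ((δ (φ (ψ j)) : ℝ) : ℂ) *
                  Literature.Probability.LatticeModels.triEmbed (x j)) atTop (𝓝 τ) ∧
                (∀ j : ℕ,
                  (∀ w : HexVertex, w ∈ Λ'' j ↔ ((-(x j) + w.1, w.2) : HexVertex) ∈ Λ' (δ (φ (ψ j)))) ∧
                  (∀ w ∈ Λ'' j, w ∉ S (φ (ψ j)) (n (φ (ψ j))) ∪ T (φ (ψ j)) (n' (φ (ψ j)))) ∧
                  (∀ w ∈ Λ'' j, ∀ y ∈ Λ'' j, hexGraph.Adj w y →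
                    (hexDomainGraph D.carrier (δ (φ (ψ j)))).Adj w y) ∧
                  q (φ (ψ j)) ∈ Λ'' j ∧
                  pu j ∈ S (φ (ψ j)) (n (φ (ψ j))) ∪ T (φ (ψ j)) (n' (φ (ψ j))) ∧
                  pv j ∈ S (φ (ψ j)) (n (φ (ψ j))) ∪ T (φ (ψ j)) (n' (φ (ψ j))) ∧
                  hexGraph.Adj (q (φ (ψ j))) (pu j) ∧
                  s(q (φ (ψ j)), pu j) ≠ s(q' (φ (ψ j)), pv j) ∧
                  (a' (δ (φ (ψ j)))).map (fun w : HexVertex => ((x j + w.1, w.2) : HexVertex)) =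
                    s(q (φ (ψ j)), pu j) ∧
                  (b' (δ (φ (ψ j)))).map (fun w : HexVertex => ((x j + w.1, w.2) : HexVertex)) =
                    s(q' (φ (ψ j)), pv j)) ∧
                ∃ (E : DobrushinDomain) (ρE : ℝ) (φE : ConformalEquiv upperHalfPlaneSet E.carrier)
                  (Φ : ConformalEquiv (upperHalfPlaneSet \ φE.pullbackHull M) upperHalfPlaneSet) (d : ℝ)
                  (Nf : ℝ → Finset HexVertex) (m₀ m₁ m₁' : ℝ → ℤ),
                  (0 < ρE ∧ ∀ i : Fin 2,
                    E.carrier ∩ ball (E.pt i) ρE = {z : ℂ | (E.pt i).im < z.im} ∩ ball (E.pt i) ρE) ∧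
                  E.IsHullSubdomain M ∧ E.IsChordalUniformizing φE ∧
                  IsRestrictionMap (φE.pullbackHull M) Φ ∧ HasRestrictionDeriv (φE.pullbackHull M) Φ d ∧
                  1 - ε' < d ^ ((5 : ℝ) / 8) ∧
                  (∀ᶠ δ' : ℝ in 𝓝[>] 0,
                    Λ' δ' ⊆ Nf δ' ∧ hexDomainSimplyConnected (Nf δ') ∧ hexDomainSimplyConnected (Λ' δ') ∧
                    (hexGraph.induce (↑(Nf δ') : Set HexVertex)).Preconnected ∧
                    (hexGraph.induce (↑(Λ' δ') : Set HexVertex)).Preconnected ∧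
                    a' δ' ∈ hexDomainBoundary (Nf δ') ∧ b' δ' ∈ hexDomainBoundary (Nf δ') ∧
                    a' δ' ∈ hexDomainBoundary (Λ' δ') ∧ b' δ' ∈ hexDomainBoundary (Λ' δ') ∧
                    Nonempty (HexMidEdgeSAW (Λ' δ') (a' δ') (b' δ')) ∧
                    (∀ w ∈ Nf δ', (δ' : ℂ) * hexCenter w ∈ E.carrier) ∧
                    (∀ w ∈ Λ' δ', (δ' : ℂ) * hexCenter w ∈ M.carrier) ∧
                    (∀ w : HexVertex, (δ' : ℂ) * hexCenter w ∈ ball (E.pt 0) ρE →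
                      ((w ∈ Nf δ' ↔ m₀ δ' ≤ w.1 1) ∧ (w ∈ Λ' δ' ↔ m₀ δ' ≤ w.1 1))) ∧
                    (∀ w : HexVertex, (δ' : ℂ) * hexCenter w ∈ ball (E.pt 1) ρE →
                      ((w ∈ Nf δ' ↔ m₁ δ' ≤ w.1 1) ∧ (w ∈ Λ' δ' ↔ m₁' δ' ≤ w.1 1)))) ∧
                  (∀ K : Set ℂ, IsCompact K → K ⊆ E.carrier →
                    ∀ᶠ δ' : ℝ in 𝓝[>] 0, ∀ w : HexVertex, (δ' : ℂ) * hexCenter w ∈ K → w ∈ Nf δ') ∧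
                  (∀ K : Set ℂ, IsCompact K → K ⊆ M.carrier →
                    ∀ᶠ δ' : ℝ in 𝓝[>] 0, ∀ w : HexVertex, (δ' : ℂ) * hexCenter w ∈ K → w ∈ Λ' δ') ∧
                  Tendsto (fun δ' : ℝ => (δ' : ℂ) * hexMidpoint (a' δ')) (𝓝[>] 0) (𝓝 (E.pt 0)) ∧
                  Tendsto (fun δ' : ℝ => (δ' : ℂ) * hexMidpoint (b' δ')) (𝓝[>] 0) (𝓝 (E.pt 1)) ∧
                  (∀ᶠ j : ℕ in atTop,
                    IsProbabilityMeasure (carvedLaw D.carrier (δ (φ (ψ j)))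
                      (S (φ (ψ j)) (n (φ (ψ j))) ∪ T (φ (ψ j)) (n' (φ (ψ j)))) (q (φ (ψ j))) (q' (φ (ψ j)))) ∧
                    (∀ w : HexVertex, w ∈ Λ'' j ↔ ((-(x j) + w.1, w.2) : HexVertex) ∈ Λ' (δ (φ (ψ j)))) ∧
                    (∀ w ∈ Λ'' j, w ∉ S (φ (ψ j)) (n (φ (ψ j))) ∪ T (φ (ψ j)) (n' (φ (ψ j)))) ∧
                    (∀ w ∈ Λ'' j, ∀ y ∈ Λ'' j, hexGraph.Adj w y →
                      (hexDomainGraph D.carrier (δ (φ (ψ j)))).Adj w y) ∧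
                    q (φ (ψ j)) ∈ Λ'' j ∧
                    pu j ∈ S (φ (ψ j)) (n (φ (ψ j))) ∪ T (φ (ψ j)) (n' (φ (ψ j))) ∧
                    pv j ∈ S (φ (ψ j)) (n (φ (ψ j))) ∪ T (φ (ψ j)) (n' (φ (ψ j))) ∧
                    hexGraph.Adj (q (φ (ψ j))) (pu j) ∧
                    s(q (φ (ψ j)), pu j) ≠ s(q' (φ (ψ j)), pv j) ∧
                    (a' (δ (φ (ψ j)))).map (fun w : HexVertex => ((x j + w.1, w.2) : HexVertex)) =
                      s(q (φ (ψ j)), pu j) ∧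
                    (b' (δ (φ (ψ j)))).map (fun w : HexVertex => ((x j + w.1, w.2) : HexVertex)) =
                      s(q' (φ (ψ j)), pv j) ∧
                    (∀ (w : HexVertex) (π : (hexDomainGraph D.carrier (δ (φ (ψ j)))).Walk (q (φ (ψ j))) w),
                      (∀ y ∈ π.support, y ∉ S (φ (ψ j)) (n (φ (ψ j))) ∪ T (φ (ψ j)) (n' (φ (ψ j)))) →
                        ∀ y ∈ π.support, ((-(x j) + y.1, y.2) : HexVertex) ∈ Nf (δ (φ (ψ j)))) ∧
                    ((-(x j) + (pu j).1, (pu j).2) : HexVertex) ∉ Nf (δ (φ (ψ j))) ∧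
                    ((-(x j) + (pv j).1, (pv j).2) : HexVertex) ∉ Nf (δ (φ (ψ j))))) := by
  intro D a b hab η hη
  obtain ⟨R₀, hR₀, hgeo⟩ := carvedReduction_squeezeGeometry_continuum D a b hab η hη
  refine ⟨R₀, hR₀, fun R hR ρ hρ N δ S T n n' q q' hδ hfam hgates ε' hε' φ hφ => ?_⟩
  obtain ⟨ψ₀, E, M, τ, x, φE, Φ, d, ρw, ρc, ρc', ρF, hψ₀, hsanti, hspos, hs0, hτ, hM, hbd, hbd0, hbd1,
    hflat, hB, hρc, hρc', hρF, hFc, hFc', hFw, hsep, hφE, hΦ, hd, hlev, hq0, hq1, hconv0, hconv1,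
    habove0, habove1, hU0, hU1, hMD, hMU, hreach, hqdom, hprob⟩ :=
    hgeo R hR ρ hρ N δ S T n n' q q' hδ hfam hgates ε' hε' φ hφ
  exact stub_carvedReduction_squeezeGeometry_lattice2 D δ S T n n' q q' η ε' φ ψ₀ E M τ x φE Φ d ρw ρc ρc' ρF
    hψ₀ hsanti hspos hs0 hτ hM hbd hbd0 hbd1 hflat hB hρc hρc' hρF hFc hFc' hFw hsep hφE hΦ hd hlev hq0 hq1
    hconv0 hconv1 habove0 habove1 hU0 hU1 hMD hMU hreach hqdom hprob

/-- T2b″ `stub_carvedReduction_squeezeSolid` (r8: GLUE, sorry-free, checked by the wave-2 worker in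
`work/stubs/SqueezeSolid_SPLIT.lean`) — `TwoPieceAdmRestrictionLimit → MovingCarvingSqueezeP FatAnchoredClassZeroSolid` from T-A
(`stub_carvedReduction_squeezeGeometry`) and the LANDED T-B `TypeLadder.stub_carvedReduction_ratioSqueeze` (p131716: ARL″ once in the
outer approximant + the exact sandwich ⇒ (C9)).  (r6/r7 had T2b″ itself as the registered leaf.) -/
theorem stub_carvedReduction_squeezeSolid :
    (∀ (D D' : DobrushinDomain) (ρ : ℝ) (φ : ConformalEquiv upperHalfPlaneSet D.carrier)
      (Φ : ConformalEquiv (upperHalfPlaneSet \ φ.pullbackHull D') upperHalfPlaneSet) (d : ℝ)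
      (Λ Λ' : ℝ → Finset HexVertex) (m₀ m₁ m₁' : ℝ → ℤ) (a b : ℝ → Sym2 HexVertex),
      (0 < ρ ∧ ∀ i : Fin 2, D.carrier ∩ ball (D.pt i) ρ = {z : ℂ | (D.pt i).im < z.im} ∩ ball (D.pt i) ρ) →
      D.IsHullSubdomain D' → D.IsChordalUniformizing φ →
      IsRestrictionMap (φ.pullbackHull D') Φ → HasRestrictionDeriv (φ.pullbackHull D') Φ d →
      (∀ᶠ δ : ℝ in 𝓝[>] 0,
        Λ' δ ⊆ Λ δ ∧ hexDomainSimplyConnected (Λ δ) ∧ hexDomainSimplyConnected (Λ' δ) ∧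
        (hexGraph.induce (↑(Λ δ) : Set HexVertex)).Preconnected ∧
        (hexGraph.induce (↑(Λ' δ) : Set HexVertex)).Preconnected ∧
        a δ ∈ hexDomainBoundary (Λ δ) ∧ b δ ∈ hexDomainBoundary (Λ δ) ∧
        a δ ∈ hexDomainBoundary (Λ' δ) ∧ b δ ∈ hexDomainBoundary (Λ' δ) ∧
        Nonempty (HexMidEdgeSAW (Λ' δ) (a δ) (b δ)) ∧
        (∀ v ∈ Λ δ, (δ : ℂ) * hexCenter v ∈ D.carrier) ∧
        (∀ v ∈ Λ' δ, (δ : ℂ) * hexCenter v ∈ D'.carrier) ∧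
        (∀ v : HexVertex, (δ : ℂ) * hexCenter v ∈ ball (D.pt 0) ρ →
          ((v ∈ Λ δ ↔ m₀ δ ≤ v.1 1) ∧ (v ∈ Λ' δ ↔ m₀ δ ≤ v.1 1))) ∧
        (∀ v : HexVertex, (δ : ℂ) * hexCenter v ∈ ball (D.pt 1) ρ →
          ((v ∈ Λ δ ↔ m₁ δ ≤ v.1 1) ∧ (v ∈ Λ' δ ↔ m₁' δ ≤ v.1 1)))) →
      (∀ K : Set ℂ, IsCompact K → K ⊆ D.carrier →
        ∀ᶠ δ : ℝ in 𝓝[>] 0, ∀ v : HexVertex, (δ : ℂ) * hexCenter v ∈ K → v ∈ Λ δ) →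
      (∀ K : Set ℂ, IsCompact K → K ⊆ D'.carrier →
        ∀ᶠ δ : ℝ in 𝓝[>] 0, ∀ v : HexVertex, (δ : ℂ) * hexCenter v ∈ K → v ∈ Λ' δ) →
      Tendsto (fun δ : ℝ => (δ : ℂ) * hexMidpoint (a δ)) (𝓝[>] 0) (𝓝 (D.pt 0)) →
      Tendsto (fun δ : ℝ => (δ : ℂ) * hexMidpoint (b δ)) (𝓝[>] 0) (𝓝 (D.pt 1)) →
      Tendsto (fun δ : ℝ =>
          (∑ γ : HexMidEdgeSAW (Λ' δ) (a δ) (b δ), hexCriticalFugacity ^ γ.length) /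
            (∑ γ : HexMidEdgeSAW (Λ δ) (a δ) (b δ), hexCriticalFugacity ^ γ.length)) (𝓝[>] 0)
        (𝓝 (d ^ ((5 : ℝ) / 8)))) →
    (∀ (D : DobrushinDomain) (a b : ℝ → HexVertex), IsEmbEndpointApprox hexGraph hexCenter D a b →
      ∀ η > (0 : ℝ), ∃ R₀ > (0 : ℝ), ∀ R ∈ Set.Ioc (0 : ℝ) R₀, ∀ ρ > (0 : ℝ), ∀ N : ℕ,
          ∀ (δ : ℕ → ℝ) (S T : ℕ → ℕ → Set HexVertex) (n n' : ℕ → ℕ) (q q' : ℕ → HexVertex),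
            Tendsto δ atTop (𝓝[>] 0) →
            (∀ k, TameNestedFamily (δ k) R N (a (δ k)) (S k) ∧
              TameNestedFamily (δ k) R N (b (δ k)) (T k) ∧
              (((∀ i, ExteriorAnchored D.carrier (δ k) (S k i) (a (δ k))) ∧
          (∀ i, ExteriorAnchored D.carrier (δ k) (T k i) (b (δ k))) ∧
          (∀ (i : ℕ) (p q : HexVertex), HasCleanWindow D.carrier (δ k) ρ (S k i) p q →
            rowOf 0 q = rowOf 0 p + 1 ∧
              ∀ x : HexVertex, ((δ k : ℝ) : ℂ) * hexCenter x ∈ ball (((δ k : ℝ) : ℂ) * hexCenter q) ρ →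
                (x ∈ S k i ↔ rowOf 0 x ≤ rowOf 0 p)) ∧
          (∀ (i : ℕ) (p q : HexVertex), HasCleanWindow D.carrier (δ k) ρ (T k i) p q →
            rowOf 0 q = rowOf 0 p + 1 ∧
              ∀ x : HexVertex, ((δ k : ℝ) : ℂ) * hexCenter x ∈ ball (((δ k : ℝ) : ℂ) * hexCenter q) ρ →
                (x ∈ T k i ↔ rowOf 0 x ≤ rowOf 0 p))) ∧
          (∀ (i : ℕ) (p q : HexVertex), HasCleanWindow D.carrier (δ k) ρ (S k i) p q →
            ∃ K : Set ℂ, IsCompact K ∧ IsConnected K ∧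
              ((δ k : ℝ) : ℂ) * hexCenter q - ((ρ / 2 : ℝ) : ℂ) * Complex.I ∈ K ∧ ((δ k : ℝ) : ℂ) * hexCenter (a (δ k)) ∈ K ∧
              ∀ v : HexVertex, Metric.infDist (((δ k : ℝ) : ℂ) * hexCenter v) K ≤ ρ / 4 → v ∈ S k i) ∧
          (∀ (i : ℕ) (p q : HexVertex), HasCleanWindow D.carrier (δ k) ρ (T k i) p q →
            ∃ K : Set ℂ, IsCompact K ∧ IsConnected K ∧
              ((δ k : ℝ) : ℂ) * hexCenter q - ((ρ / 2 : ℝ) : ℂ) * Complex.I ∈ K ∧ ((δ k : ℝ) : ℂ) * hexCenter (b (δ k)) ∈ K ∧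
              ∀ v : HexVertex, Metric.infDist (((δ k : ℝ) : ℂ) * hexCenter v) K ≤ ρ / 4 → v ∈ T k i) ∧
          (∀ i : ℕ, ∃ K : Set ℂ, IsCompact K ∧ IsConnected K ∧ ((δ k : ℝ) : ℂ) * hexCenter (a (δ k)) ∈ K ∧
            (∀ v : HexVertex, Metric.infDist (((δ k : ℝ) : ℂ) * hexCenter v) K ≤ ρ / 8 → v ∈ S k i) ∧
            (∀ v ∈ S k i, ∃ (t w : HexVertex) (r : ℕ), v ∈ hexBall t r ∧ w ∈ hexBall t r ∧
              hexBall t r ⊆ S k i ∧ Metric.infDist (((δ k : ℝ) : ℂ) * hexCenter w) K ≤ ρ / 16)) ∧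
          (∀ i : ℕ, ∃ K : Set ℂ, IsCompact K ∧ IsConnected K ∧ ((δ k : ℝ) : ℂ) * hexCenter (b (δ k)) ∈ K ∧
            (∀ v : HexVertex, Metric.infDist (((δ k : ℝ) : ℂ) * hexCenter v) K ≤ ρ / 8 → v ∈ T k i) ∧
            (∀ v ∈ T k i, ∃ (t w : HexVertex) (r : ℕ), v ∈ hexBall t r ∧ w ∈ hexBall t r ∧
              hexBall t r ⊆ T k i ∧ Metric.infDist (((δ k : ℝ) : ℂ) * hexCenter w) K ≤ ρ / 16)))) →
            (∀ k, ∃ (γ : HexDomainSAW D.carrier (δ k) (a (δ k)) (b (δ k))) (m : ℕ) (p : HexVertex)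
                (m' : ℕ) (p' : HexVertex),
              IsFirstGoodGateN D.carrier (δ k) ρ R (S k) (a (δ k)) γ.walk.support (n k) m p (q k) ∧
              IsFirstGoodGateN D.carrier (δ k) ρ R (T k) (b (δ k)) γ.walk.support.reverse
                (n' k) m' p' (q' k) ∧
              WideLink D.carrier (δ k) ρ (S k (n k) ∪ T k (n' k)) (q k) (q' k)) →
            ∀ ε' > (0 : ℝ), ∀ φ : ℕ → ℕ, StrictMono φ →
              ∃ (ψ : ℕ → ℕ) (M : DobrushinDomain) (τ : ℂ) (ρ' : ℝ) (Λ' : ℝ → Finset HexVertex)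
                (m : Fin 2 → ℝ → ℤ) (a' b' : ℝ → Sym2 HexVertex) (x : ℕ → Site 2)
                (Λ'' : ℕ → Finset HexVertex) (pu pv : ℕ → HexVertex),
                StrictMono ψ ∧
                (∀ t : ℝ, dist (M.boundary t + τ) (D.boundary t) ≤ η) ∧
                dist (M.pt 0 + τ) (D.pt 0) ≤ η ∧ dist (M.pt 1 + τ) (D.pt 1) ≤ η ∧
                (0 < ρ' ∧ ∀ i : Fin 2,
                  M.carrier ∩ ball (M.pt i) ρ' = {z : ℂ | (M.pt i).im < z.im} ∩ ball (M.pt i) ρ') ∧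
                (∀ᶠ δ' : ℝ in 𝓝[>] 0, hexDomainSimplyConnected (Λ' δ') ∧
                  a' δ' ∈ hexDomainBoundary (Λ' δ') ∧ b' δ' ∈ hexDomainBoundary (Λ' δ') ∧
                  Nonempty (HexMidEdgeSAW (Λ' δ') (a' δ') (b' δ')) ∧
                  (hexGraph.induce (↑(Λ' δ') : Set HexVertex)).Preconnected ∧
                  (∀ v ∈ Λ' δ', (δ' : ℂ) * hexCenter v ∈ M.carrier) ∧
                  (∀ i : Fin 2, ∀ v : HexVertex, (δ' : ℂ) * hexCenter v ∈ ball (M.pt i) ρ' →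
                    (v ∈ Λ' δ' ↔ m i δ' ≤ v.1 1))) ∧
                (∀ K : Set ℂ, IsCompact K → K ⊆ M.carrier →
                  ∀ᶠ δ' : ℝ in 𝓝[>] 0, ∀ v : HexVertex, (δ' : ℂ) * hexCenter v ∈ K → v ∈ Λ' δ') ∧
                Tendsto (fun δ' : ℝ => (δ' : ℂ) * hexMidpoint (a' δ')) (𝓝[>] 0) (𝓝 (M.pt 0)) ∧
                Tendsto (fun δ' : ℝ => (δ' : ℂ) * hexMidpoint (b' δ')) (𝓝[>] 0) (𝓝 (M.pt 1)) ∧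
                Tendsto (fun j : ℕ => ((δ (φ (ψ j)) : ℝ) : ℂ) *
                  Literature.Probability.LatticeModels.triEmbed (x j)) atTop (𝓝 τ) ∧
                (∀ j : ℕ,
                  (∀ w : HexVertex, w ∈ Λ'' j ↔ ((-(x j) + w.1, w.2) : HexVertex) ∈ Λ' (δ (φ (ψ j)))) ∧
                  (∀ w ∈ Λ'' j, w ∉ S (φ (ψ j)) (n (φ (ψ j))) ∪ T (φ (ψ j)) (n' (φ (ψ j)))) ∧
                  (∀ w ∈ Λ'' j, ∀ y ∈ Λ'' j, hexGraph.Adj w y →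
                    (hexDomainGraph D.carrier (δ (φ (ψ j)))).Adj w y) ∧
                  q (φ (ψ j)) ∈ Λ'' j ∧
                  pu j ∈ S (φ (ψ j)) (n (φ (ψ j))) ∪ T (φ (ψ j)) (n' (φ (ψ j))) ∧
                  pv j ∈ S (φ (ψ j)) (n (φ (ψ j))) ∪ T (φ (ψ j)) (n' (φ (ψ j))) ∧
                  hexGraph.Adj (q (φ (ψ j))) (pu j) ∧
                  s(q (φ (ψ j)), pu j) ≠ s(q' (φ (ψ j)), pv j) ∧
                  (a' (δ (φ (ψ j)))).map (fun w : HexVertex => ((x j + w.1, w.2) : HexVertex)) =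
                    s(q (φ (ψ j)), pu j) ∧
                  (b' (δ (φ (ψ j)))).map (fun w : HexVertex => ((x j + w.1, w.2) : HexVertex)) =
                    s(q' (φ (ψ j)), pv j)) ∧
                (∀ᶠ j : ℕ in atTop, 1 - ε' ≤
                  (carvedLaw D.carrier (δ (φ (ψ j))) (S (φ (ψ j)) (n (φ (ψ j))) ∪ T (φ (ψ j)) (n' (φ (ψ j))))
                    (q (φ (ψ j))) (q' (φ (ψ j))) {ξ | ∀ w ∈ ξ.walk.support, w ∈ Λ'' j}).toReal)) := by
  intro hARL D a b hab η hη
  obtain ⟨R₀, hR₀, hmain⟩ := stub_carvedReduction_squeezeGeometry D a b hab η hη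
  refine ⟨R₀, hR₀, fun R hR ρ hρ N δ S T n n' q q' hδ hfam hgates ε' hε' φ hφ => ?_⟩
  obtain ⟨ψ, M, τ, ρ', Λ', m, a', b', x, Λ'', pu, pv, h1, h2, h3, h4, h5, h6, h7, h8, h9, h10, h11,
    E, ρE, φE, Φ, d, Nf, m₀, m₁, m₁', hflat, hHull, hφE, hΦ, hd, hlev, hadm, hexhE, hexhM, haE, hbE, hcell⟩ :=
    hmain R hR ρ hρ N δ S T n n' q q' hδ hfam hgates ε' hε' φ hφ
  refine ⟨ψ, M, τ, ρ', Λ', m, a', b', x, Λ'', pu, pv, h1, h2, h3, h4, h5, h6, h7, h8, h9, h10, h11, ?_⟩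
  exact Summit.CriticalPhenomena.SAWScalingLimit.Theorems.ObservableToSLE.TypeLadder.stub_carvedReduction_ratioSqueeze hARL D.carrier (fun j => δ (φ (ψ j)))
    (fun j => S (φ (ψ j)) (n (φ (ψ j))) ∪ T (φ (ψ j)) (n' (φ (ψ j)))) (fun j => q (φ (ψ j)))
    (fun j => q' (φ (ψ j))) pu pv x Λ'' E M ρE φE Φ d Nf Λ' m₀ m₁ m₁' a' b' ε' D.isBounded
    (hδ.comp (hφ.comp h1).tendsto_atTop) hflat hHull hφE hΦ hd hlev hadm hexhE hexhM haE hbE hcell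

/-- STUB T2c `stub_carvedReduction_assemblyP` (r6; LANDED p130700 in wave 2, `TypeLadder.stub_carvedReduction_assemblyP`; MECHANICAL: the landed assembly
`TypeLadder.stub_carvedReduction_assembly` p125956 only hands the family block to the squeeze, so its proof is verbatim
generic in the block) — `∀ P, MovingCarvingSqueezeP P → TwoPieceAdmIdentification → SLELawContinuity →
CarvedSeqIdentificationPM P` (all inlined). -/
theorem stub_carvedReduction_assemblyP :
    ∀ (P : DobrushinDomain → (ℝ → HexVertex) → (ℝ → HexVertex) → ℝ → ℝ → ℝ → ℕ →
      (ℕ → Set HexVertex) → (ℕ → Set HexVertex) → Prop),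
    (∀ (D : DobrushinDomain) (a b : ℝ → HexVertex), IsEmbEndpointApprox hexGraph hexCenter D a b →
      ∀ η > (0 : ℝ), ∃ R₀ > (0 : ℝ), ∀ R ∈ Set.Ioc (0 : ℝ) R₀, ∀ ρ > (0 : ℝ), ∀ N : ℕ,
          ∀ (δ : ℕ → ℝ) (S T : ℕ → ℕ → Set HexVertex) (n n' : ℕ → ℕ) (q q' : ℕ → HexVertex),
            Tendsto δ atTop (𝓝[>] 0) →
            (∀ k, TameNestedFamily (δ k) R N (a (δ k)) (S k) ∧
              TameNestedFamily (δ k) R N (b (δ k)) (T k) ∧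
              P D a b (δ k) ρ R N (S k) (T k)) →
            (∀ k, ∃ (γ : HexDomainSAW D.carrier (δ k) (a (δ k)) (b (δ k))) (m : ℕ) (p : HexVertex)
                (m' : ℕ) (p' : HexVertex),
              IsFirstGoodGateN D.carrier (δ k) ρ R (S k) (a (δ k)) γ.walk.support (n k) m p (q k) ∧
              IsFirstGoodGateN D.carrier (δ k) ρ R (T k) (b (δ k)) γ.walk.support.reverse
                (n' k) m' p' (q' k) ∧
              WideLink D.carrier (δ k) ρ (S k (n k) ∪ T k (n' k)) (q k) (q' k)) →
            ∀ ε' > (0 : ℝ), ∀ φ : ℕ → ℕ, StrictMono φ →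
              ∃ (ψ : ℕ → ℕ) (M : DobrushinDomain) (τ : ℂ) (ρ' : ℝ) (Λ' : ℝ → Finset HexVertex)
                (m : Fin 2 → ℝ → ℤ) (a' b' : ℝ → Sym2 HexVertex) (x : ℕ → Site 2)
                (Λ'' : ℕ → Finset HexVertex) (pu pv : ℕ → HexVertex),
                StrictMono ψ ∧
                (∀ t : ℝ, dist (M.boundary t + τ) (D.boundary t) ≤ η) ∧
                dist (M.pt 0 + τ) (D.pt 0) ≤ η ∧ dist (M.pt 1 + τ) (D.pt 1) ≤ η ∧
                (0 < ρ' ∧ ∀ i : Fin 2,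
                  M.carrier ∩ ball (M.pt i) ρ' = {z : ℂ | (M.pt i).im < z.im} ∩ ball (M.pt i) ρ') ∧
                (∀ᶠ δ' : ℝ in 𝓝[>] 0, hexDomainSimplyConnected (Λ' δ') ∧
                  a' δ' ∈ hexDomainBoundary (Λ' δ') ∧ b' δ' ∈ hexDomainBoundary (Λ' δ') ∧
                  Nonempty (HexMidEdgeSAW (Λ' δ') (a' δ') (b' δ')) ∧
                  (hexGraph.induce (↑(Λ' δ') : Set HexVertex)).Preconnected ∧
                  (∀ v ∈ Λ' δ', (δ' : ℂ) * hexCenter v ∈ M.carrier) ∧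
                  (∀ i : Fin 2, ∀ v : HexVertex, (δ' : ℂ) * hexCenter v ∈ ball (M.pt i) ρ' →
                    (v ∈ Λ' δ' ↔ m i δ' ≤ v.1 1))) ∧
                (∀ K : Set ℂ, IsCompact K → K ⊆ M.carrier →
                  ∀ᶠ δ' : ℝ in 𝓝[>] 0, ∀ v : HexVertex, (δ' : ℂ) * hexCenter v ∈ K → v ∈ Λ' δ') ∧
                Tendsto (fun δ' : ℝ => (δ' : ℂ) * hexMidpoint (a' δ')) (𝓝[>] 0) (𝓝 (M.pt 0)) ∧
                Tendsto (fun δ' : ℝ => (δ' : ℂ) * hexMidpoint (b' δ')) (𝓝[>] 0) (𝓝 (M.pt 1)) ∧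
                Tendsto (fun j : ℕ => ((δ (φ (ψ j)) : ℝ) : ℂ) *
                  Literature.Probability.LatticeModels.triEmbed (x j)) atTop (𝓝 τ) ∧
                (∀ j : ℕ,
                  (∀ w : HexVertex, w ∈ Λ'' j ↔ ((-(x j) + w.1, w.2) : HexVertex) ∈ Λ' (δ (φ (ψ j)))) ∧
                  (∀ w ∈ Λ'' j, w ∉ S (φ (ψ j)) (n (φ (ψ j))) ∪ T (φ (ψ j)) (n' (φ (ψ j)))) ∧
                  (∀ w ∈ Λ'' j, ∀ y ∈ Λ'' j, hexGraph.Adj w y →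
                    (hexDomainGraph D.carrier (δ (φ (ψ j)))).Adj w y) ∧
                  q (φ (ψ j)) ∈ Λ'' j ∧
                  pu j ∈ S (φ (ψ j)) (n (φ (ψ j))) ∪ T (φ (ψ j)) (n' (φ (ψ j))) ∧
                  pv j ∈ S (φ (ψ j)) (n (φ (ψ j))) ∪ T (φ (ψ j)) (n' (φ (ψ j))) ∧
                  hexGraph.Adj (q (φ (ψ j))) (pu j) ∧
                  s(q (φ (ψ j)), pu j) ≠ s(q' (φ (ψ j)), pv j) ∧
                  (a' (δ (φ (ψ j)))).map (fun w : HexVertex => ((x j + w.1, w.2) : HexVertex)) =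
                    s(q (φ (ψ j)), pu j) ∧
                  (b' (δ (φ (ψ j)))).map (fun w : HexVertex => ((x j + w.1, w.2) : HexVertex)) =
                    s(q' (φ (ψ j)), pv j)) ∧
                (∀ᶠ j : ℕ in atTop, 1 - ε' ≤
                  (carvedLaw D.carrier (δ (φ (ψ j))) (S (φ (ψ j)) (n (φ (ψ j))) ∪ T (φ (ψ j)) (n' (φ (ψ j))))
                    (q (φ (ψ j))) (q' (φ (ψ j))) {ξ | ∀ w ∈ ξ.walk.support, w ∈ Λ'' j}).toReal)) →
    (∀ (M : DobrushinDomain) (ρ : ℝ) (Λ : ℝ → Finset HexVertex) (m : Fin 2 → ℝ → ℤ)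
      (a b : ℝ → Sym2 HexVertex),
      (0 < ρ ∧ ∀ i : Fin 2, M.carrier ∩ ball (M.pt i) ρ = {z : ℂ | (M.pt i).im < z.im} ∩ ball (M.pt i) ρ) →
      (∀ᶠ δ : ℝ in 𝓝[>] 0, hexDomainSimplyConnected (Λ δ) ∧ a δ ∈ hexDomainBoundary (Λ δ) ∧
        b δ ∈ hexDomainBoundary (Λ δ) ∧ Nonempty (HexMidEdgeSAW (Λ δ) (a δ) (b δ)) ∧
        (hexGraph.induce (↑(Λ δ) : Set HexVertex)).Preconnected ∧
        (∀ v ∈ Λ δ, (δ : ℂ) * hexCenter v ∈ M.carrier) ∧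
        (∀ i : Fin 2, ∀ v : HexVertex, (δ : ℂ) * hexCenter v ∈ ball (M.pt i) ρ →
          (v ∈ Λ δ ↔ m i δ ≤ v.1 1))) →
      (∀ K : Set ℂ, IsCompact K → K ⊆ M.carrier →
        ∀ᶠ δ : ℝ in 𝓝[>] 0, ∀ v : HexVertex, (δ : ℂ) * hexCenter v ∈ K → v ∈ Λ δ) →
      Tendsto (fun δ : ℝ => (δ : ℂ) * hexMidpoint (a δ)) (𝓝[>] 0) (𝓝 (M.pt 0)) →
      Tendsto (fun δ : ℝ => (δ : ℂ) * hexMidpoint (b δ)) (𝓝[>] 0) (𝓝 (M.pt 1)) →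
      ∀ (μ : Measure (CurveClass ℂ)) (s : ℕ → ℝ), IsProbabilityMeasure μ →
        Tendsto s atTop (𝓝[>] 0) →
        (∀ f : CurveClass ℂ →ᵇ ℝ,
          Tendsto (fun n =>
            (∑ γ : HexMidEdgeSAW (Λ (s n)) (a (s n)) (b (s n)),
                hexCriticalFugacity ^ γ.length *
                  f (CurveClass.mk ⟨polyline (γ.verts.map fun v => ((s n : ℝ) : ℂ) * hexCenter v)⟩)) /
              (∑ γ : HexMidEdgeSAW (Λ (s n)) (a (s n)) (b (s n)), hexCriticalFugacity ^ γ.length))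
            atTop (𝓝 (∫ x, f x ∂μ))) →
        (∀ ε η : ℝ, 0 < ε → 0 < η → ∃ θ : ℝ, 0 < θ ∧ ∀ᶠ n in atTop,
          (∑ γ : HexMidEdgeSAW (Λ (s n)) (a (s n)) (b (s n)),
              if CurveClass.mk ⟨polyline (γ.verts.map fun v => ((s n : ℝ) : ℂ) * hexCenter v)⟩ ∉
                  CurveClass.modulusClass ε θ
              then hexCriticalFugacity ^ γ.length else 0) ≤
            η * ∑ γ : HexMidEdgeSAW (Λ (s n)) (a (s n)) (b (s n)), hexCriticalFugacity ^ γ.length) →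
        IsSLELaw ((8 : ℝ≥0) / 3) M μ) →
    (∀ (D : DobrushinDomain) (f : CurveClass ℂ →ᵇ ℝ) (ε : ℝ), 0 < ε → ∃ η > (0 : ℝ),
       ∀ (M : DobrushinDomain), (∀ t : ℝ, dist (M.boundary t) (D.boundary t) ≤ η) →
         dist (M.pt 0) (D.pt 0) ≤ η → dist (M.pt 1) (D.pt 1) ≤ η →
         ∀ μ ν : Measure (CurveClass ℂ), IsSLELaw ((8 : ℝ≥0) / 3) M μ → IsSLELaw ((8 : ℝ≥0) / 3) D ν →
           |∫ x, f x ∂μ - ∫ x, f x ∂ν| ≤ ε) →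
    ∀ (D : DobrushinDomain) (a b : ℝ → HexVertex), IsEmbEndpointApprox hexGraph hexCenter D a b →
      ∀ (ν : Measure (CurveClass ℂ)), IsSLELaw ((8 : ℝ≥0) / 3) D ν →
      ∀ (f : CurveClass ℂ →ᵇ ℝ) (ε : ℝ), 0 < ε →
        ∃ R₀ > (0 : ℝ), ∀ R ∈ Set.Ioc (0 : ℝ) R₀, ∀ ρ > (0 : ℝ), ∀ N : ℕ,
          ∀ (δ : ℕ → ℝ) (S T : ℕ → ℕ → Set HexVertex) (n n' : ℕ → ℕ) (q q' : ℕ → HexVertex),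
            Tendsto δ atTop (𝓝[>] 0) →
            (∀ k, TameNestedFamily (δ k) R N (a (δ k)) (S k) ∧
              TameNestedFamily (δ k) R N (b (δ k)) (T k) ∧
              P D a b (δ k) ρ R N (S k) (T k)) →
            (∀ k, ∃ (γ : HexDomainSAW D.carrier (δ k) (a (δ k)) (b (δ k))) (m : ℕ) (p : HexVertex)
                (m' : ℕ) (p' : HexVertex),
              IsFirstGoodGateN D.carrier (δ k) ρ R (S k) (a (δ k)) γ.walk.support (n k) m p (q k) ∧
              IsFirstGoodGateN D.carrier (δ k) ρ R (T k) (b (δ k)) γ.walk.support.reverse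
                (n' k) m' p' (q' k) ∧
              WideLink D.carrier (δ k) ρ (S k (n k) ∪ T k (n' k)) (q k) (q' k)) →
            (∀ k, IsProbabilityMeasure
              (carvedLaw D.carrier (δ k) (S k (n k) ∪ T k (n' k)) (q k) (q' k))) →
            (∀ η > (0 : ℝ), ∃ 𝒦 : Set (CurveClass ℂ), IsCompact 𝒦 ∧ ∀ᶠ k in atTop,
              carvedLaw D.carrier (δ k) (S k (n k) ∪ T k (n' k)) (q k) (q' k)
                {ξ | ξ.curve ∉ 𝒦} ≤ ENNReal.ofReal η) →
            (∀ ε' > (0 : ℝ), ∀ η > (0 : ℝ), ∃ θ > (0 : ℝ), ∀ᶠ k in atTop,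
              carvedLaw D.carrier (δ k) (S k (n k) ∪ T k (n' k)) (q k) (q' k)
                {ξ | ξ.curve ∉ CurveClass.modulusClass ε' θ} ≤ ENNReal.ofReal η) →
            ∀ᶠ k in atTop,
              |(∫ ξ, f ξ.curve ∂(carvedLaw D.carrier (δ k) (S k (n k) ∪ T k (n' k)) (q k) (q' k))) -
                  ∫ x, f x ∂ν| ≤ ε :=
  -- LANDED (wave 2, p130700: Theorems/SAWDevelopingMapObservableToSLETypeLadderCarvedReductionAssemblyP.lean)
  Summit.CriticalPhenomena.SAWScalingLimit.Theorems.ObservableToSLE.TypeLadder.stub_carvedReduction_assemblyP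

/-- T2b (r6: GLUE over T2b″ and T2c) — the moving-carving reduction for SOLID class-zero families:
`TwoPieceAdmRestrictionLimit → TwoPieceAdmIdentification → SLELawContinuity →
CarvedSeqIdentificationPM FatAnchoredClassZeroSolid`. -/
theorem carvedReductionSolid_of (h₁ : TwoPieceAdmRestrictionLimit) (h₂ : TwoPieceAdmIdentification)
    (h₃ : SLELawContinuity) : CarvedSeqIdentificationPM FatAnchoredClassZeroSolid :=
  stub_carvedReduction_assemblyP FatAnchoredClassZeroSolid (stub_carvedReduction_squeezeSolid h₁) h₂ h₃

/-- T2 (r6: GLUE, sorry-free) — `HexObservableLimit → TwoPieceSourceLocality → SLELawContinuity →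
CarvedSeqIdentificationPM FatAnchoredClassZeroSolid`: the twin's LANDED 5a2
(`ObservableToSLER.TwoPiece.stub_twoPieceAdmRestrictionLimit`, p121515; `HexObservableLimit` and
`HexObservableLimitR` are the same term) followed by T2a (landed) and the solid reduction. -/
theorem csiFatClassZeroSolid_of (hO : HexObservableLimitR) (hA : MacroSourceLocality) (hS : SLELawContinuity) :
    CarvedSeqIdentificationPM FatAnchoredClassZeroSolid := by
  have hARL : TwoPieceAdmRestrictionLimit :=
    Summit.CriticalPhenomena.SAWScalingLimit.Theorems.ObservableToSLER.Macro.stub_macroRestrictionLimit (show _ from hO) hA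
  exact carvedReductionSolid_of hARL (stub_twoPieceAdmIdentification hARL) hS

/-- STUB S2′ `stub_coOrientedReductionSolid` (r6; LANDED 2026-08-17 00:46Z by the TWIN lead 14005 c3, `ObservableToSLER.CoOrientedSolid.stub_coOrientedReductionSolid`, identical signature — the two skeletons are one; size M: the landed S2 proof
`TypeLadder.stub_coOrientedReduction` p123341 — helpers RotationSAW p121781, RotationGates p122441, RotationSLE p122648,
CoOrientedTransport p123047 — plus ONE more transport lemma `fatSpine_rot` for the spine clause: `image_hexBall_rot`,
`hexRotIso_mem_hexBall_iff`, isometry invariance of `infDist`, images of compact connected sets) — **the co-oriented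
reduction for solid families**: `CarvedSeqIdentificationPM FatAnchoredClassZeroSolid →
CarvedSeqIdentificationPM FatAnchoredCoOrientedSolid` by the global `60°`-rotation covariance and pigeonhole on `Fin 6`. -/
theorem stub_coOrientedReductionSolid :
    (∀ (D : DobrushinDomain) (a b : ℝ → HexVertex), IsEmbEndpointApprox hexGraph hexCenter D a b →
      ∀ (ν : Measure (CurveClass ℂ)), IsSLELaw ((8 : ℝ≥0) / 3) D ν →
      ∀ (f : CurveClass ℂ →ᵇ ℝ) (ε : ℝ), 0 < ε →
        ∃ R₀ > (0 : ℝ), ∀ R ∈ Set.Ioc (0 : ℝ) R₀, ∀ ρ > (0 : ℝ), ∀ N : ℕ,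
          ∀ (δ : ℕ → ℝ) (S T : ℕ → ℕ → Set HexVertex) (n n' : ℕ → ℕ) (q q' : ℕ → HexVertex),
            Tendsto δ atTop (𝓝[>] 0) →
            (∀ k, TameNestedFamily (δ k) R N (a (δ k)) (S k) ∧
              TameNestedFamily (δ k) R N (b (δ k)) (T k) ∧
              (((∀ i, ExteriorAnchored D.carrier (δ k) (S k i) (a (δ k))) ∧
          (∀ i, ExteriorAnchored D.carrier (δ k) (T k i) (b (δ k))) ∧
          (∀ (i : ℕ) (p q : HexVertex), HasCleanWindow D.carrier (δ k) ρ (S k i) p q →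
            rowOf 0 q = rowOf 0 p + 1 ∧
              ∀ x : HexVertex, ((δ k : ℝ) : ℂ) * hexCenter x ∈ ball (((δ k : ℝ) : ℂ) * hexCenter q) ρ →
                (x ∈ S k i ↔ rowOf 0 x ≤ rowOf 0 p)) ∧
          (∀ (i : ℕ) (p q : HexVertex), HasCleanWindow D.carrier (δ k) ρ (T k i) p q →
            rowOf 0 q = rowOf 0 p + 1 ∧
              ∀ x : HexVertex, ((δ k : ℝ) : ℂ) * hexCenter x ∈ ball (((δ k : ℝ) : ℂ) * hexCenter q) ρ →
                (x ∈ T k i ↔ rowOf 0 x ≤ rowOf 0 p))) ∧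
          (∀ (i : ℕ) (p q : HexVertex), HasCleanWindow D.carrier (δ k) ρ (S k i) p q →
            ∃ K : Set ℂ, IsCompact K ∧ IsConnected K ∧
              ((δ k : ℝ) : ℂ) * hexCenter q - ((ρ / 2 : ℝ) : ℂ) * Complex.I ∈ K ∧ ((δ k : ℝ) : ℂ) * hexCenter (a (δ k)) ∈ K ∧
              ∀ v : HexVertex, Metric.infDist (((δ k : ℝ) : ℂ) * hexCenter v) K ≤ ρ / 4 → v ∈ S k i) ∧
          (∀ (i : ℕ) (p q : HexVertex), HasCleanWindow D.carrier (δ k) ρ (T k i) p q →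
            ∃ K : Set ℂ, IsCompact K ∧ IsConnected K ∧
              ((δ k : ℝ) : ℂ) * hexCenter q - ((ρ / 2 : ℝ) : ℂ) * Complex.I ∈ K ∧ ((δ k : ℝ) : ℂ) * hexCenter (b (δ k)) ∈ K ∧
              ∀ v : HexVertex, Metric.infDist (((δ k : ℝ) : ℂ) * hexCenter v) K ≤ ρ / 4 → v ∈ T k i) ∧
          (∀ i : ℕ, ∃ K : Set ℂ, IsCompact K ∧ IsConnected K ∧ ((δ k : ℝ) : ℂ) * hexCenter (a (δ k)) ∈ K ∧
            (∀ v : HexVertex, Metric.infDist (((δ k : ℝ) : ℂ) * hexCenter v) K ≤ ρ / 8 → v ∈ S k i) ∧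
            (∀ v ∈ S k i, ∃ (t w : HexVertex) (r : ℕ), v ∈ hexBall t r ∧ w ∈ hexBall t r ∧
              hexBall t r ⊆ S k i ∧ Metric.infDist (((δ k : ℝ) : ℂ) * hexCenter w) K ≤ ρ / 16)) ∧
          (∀ i : ℕ, ∃ K : Set ℂ, IsCompact K ∧ IsConnected K ∧ ((δ k : ℝ) : ℂ) * hexCenter (b (δ k)) ∈ K ∧
            (∀ v : HexVertex, Metric.infDist (((δ k : ℝ) : ℂ) * hexCenter v) K ≤ ρ / 8 → v ∈ T k i) ∧
            (∀ v ∈ T k i, ∃ (t w : HexVertex) (r : ℕ), v ∈ hexBall t r ∧ w ∈ hexBall t r ∧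
              hexBall t r ⊆ T k i ∧ Metric.infDist (((δ k : ℝ) : ℂ) * hexCenter w) K ≤ ρ / 16)))) →
            (∀ k, ∃ (γ : HexDomainSAW D.carrier (δ k) (a (δ k)) (b (δ k))) (m : ℕ) (p : HexVertex)
                (m' : ℕ) (p' : HexVertex),
              IsFirstGoodGateN D.carrier (δ k) ρ R (S k) (a (δ k)) γ.walk.support (n k) m p (q k) ∧
              IsFirstGoodGateN D.carrier (δ k) ρ R (T k) (b (δ k)) γ.walk.support.reverse
                (n' k) m' p' (q' k) ∧
              WideLink D.carrier (δ k) ρ (S k (n k) ∪ T k (n' k)) (q k) (q' k)) →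
            (∀ k, IsProbabilityMeasure
              (carvedLaw D.carrier (δ k) (S k (n k) ∪ T k (n' k)) (q k) (q' k))) →
            (∀ η > (0 : ℝ), ∃ 𝒦 : Set (CurveClass ℂ), IsCompact 𝒦 ∧ ∀ᶠ k in atTop,
              carvedLaw D.carrier (δ k) (S k (n k) ∪ T k (n' k)) (q k) (q' k)
                {ξ | ξ.curve ∉ 𝒦} ≤ ENNReal.ofReal η) →
            (∀ ε' > (0 : ℝ), ∀ η > (0 : ℝ), ∃ θ > (0 : ℝ), ∀ᶠ k in atTop,
              carvedLaw D.carrier (δ k) (S k (n k) ∪ T k (n' k)) (q k) (q' k)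
                {ξ | ξ.curve ∉ CurveClass.modulusClass ε' θ} ≤ ENNReal.ofReal η) →
            ∀ᶠ k in atTop,
              |(∫ ξ, f ξ.curve ∂(carvedLaw D.carrier (δ k) (S k (n k) ∪ T k (n' k)) (q k) (q' k))) -
                  ∫ x, f x ∂ν| ≤ ε) →
    ∀ (D : DobrushinDomain) (a b : ℝ → HexVertex), IsEmbEndpointApprox hexGraph hexCenter D a b →
      ∀ (ν : Measure (CurveClass ℂ)), IsSLELaw ((8 : ℝ≥0) / 3) D ν →
      ∀ (f : CurveClass ℂ →ᵇ ℝ) (ε : ℝ), 0 < ε →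
        ∃ R₀ > (0 : ℝ), ∀ R ∈ Set.Ioc (0 : ℝ) R₀, ∀ ρ > (0 : ℝ), ∀ N : ℕ,
          ∀ (δ : ℕ → ℝ) (S T : ℕ → ℕ → Set HexVertex) (n n' : ℕ → ℕ) (q q' : ℕ → HexVertex),
            Tendsto δ atTop (𝓝[>] 0) →
            (∀ k, TameNestedFamily (δ k) R N (a (δ k)) (S k) ∧
              TameNestedFamily (δ k) R N (b (δ k)) (T k) ∧
              ((∀ i, ExteriorAnchored D.carrier (δ k) (S k i) (a (δ k))) ∧
               (∀ i, ExteriorAnchored D.carrier (δ k) (T k i) (b (δ k))) ∧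
               ∃ j : Fin 6,
                ((∀ (i : ℕ) (p q : HexVertex), HasCleanWindow D.carrier (δ k) ρ (S k i) p q →
                    rowOf j q = rowOf j p + 1 ∧
                      ∀ x : HexVertex, ((δ k : ℝ) : ℂ) * hexCenter x ∈ ball (((δ k : ℝ) : ℂ) * hexCenter q) ρ →
                        (x ∈ S k i ↔ rowOf j x ≤ rowOf j p)) ∧
                  (∀ (i : ℕ) (p q : HexVertex), HasCleanWindow D.carrier (δ k) ρ (T k i) p q →
                    rowOf j q = rowOf j p + 1 ∧
                      ∀ x : HexVertex, ((δ k : ℝ) : ℂ) * hexCenter x ∈ ball (((δ k : ℝ) : ℂ) * hexCenter q) ρ →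
                        (x ∈ T k i ↔ rowOf j x ≤ rowOf j p))) ∧
                (∀ (i : ℕ) (p q : HexVertex), HasCleanWindow D.carrier (δ k) ρ (S k i) p q →
                  ∃ K : Set ℂ, IsCompact K ∧ IsConnected K ∧
                    ((δ k : ℝ) : ℂ) * hexCenter q - ((ρ / 2 : ℝ) : ℂ) * Complex.I * triZeta ^ (j : ℕ) ∈ K ∧
                    ((δ k : ℝ) : ℂ) * hexCenter (a (δ k)) ∈ K ∧
                    ∀ v : HexVertex, Metric.infDist (((δ k : ℝ) : ℂ) * hexCenter v) K ≤ ρ / 4 → v ∈ S k i) ∧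
                (∀ (i : ℕ) (p q : HexVertex), HasCleanWindow D.carrier (δ k) ρ (T k i) p q →
                  ∃ K : Set ℂ, IsCompact K ∧ IsConnected K ∧
                    ((δ k : ℝ) : ℂ) * hexCenter q - ((ρ / 2 : ℝ) : ℂ) * Complex.I * triZeta ^ (j : ℕ) ∈ K ∧
                    ((δ k : ℝ) : ℂ) * hexCenter (b (δ k)) ∈ K ∧
                    ∀ v : HexVertex, Metric.infDist (((δ k : ℝ) : ℂ) * hexCenter v) K ≤ ρ / 4 → v ∈ T k i) ∧
                (∀ i : ℕ, ∃ K : Set ℂ, IsCompact K ∧ IsConnected K ∧ ((δ k : ℝ) : ℂ) * hexCenter (a (δ k)) ∈ K ∧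
                  (∀ v : HexVertex, Metric.infDist (((δ k : ℝ) : ℂ) * hexCenter v) K ≤ ρ / 8 → v ∈ S k i) ∧
                  (∀ v ∈ S k i, ∃ (t w : HexVertex) (r : ℕ), v ∈ hexBall t r ∧ w ∈ hexBall t r ∧
                    hexBall t r ⊆ S k i ∧ Metric.infDist (((δ k : ℝ) : ℂ) * hexCenter w) K ≤ ρ / 16)) ∧
                (∀ i : ℕ, ∃ K : Set ℂ, IsCompact K ∧ IsConnected K ∧ ((δ k : ℝ) : ℂ) * hexCenter (b (δ k)) ∈ K ∧
                  (∀ v : HexVertex, Metric.infDist (((δ k : ℝ) : ℂ) * hexCenter v) K ≤ ρ / 8 → v ∈ T k i) ∧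
                  (∀ v ∈ T k i, ∃ (t w : HexVertex) (r : ℕ), v ∈ hexBall t r ∧ w ∈ hexBall t r ∧
                    hexBall t r ⊆ T k i ∧ Metric.infDist (((δ k : ℝ) : ℂ) * hexCenter w) K ≤ ρ / 16)))) →
            (∀ k, ∃ (γ : HexDomainSAW D.carrier (δ k) (a (δ k)) (b (δ k))) (m : ℕ) (p : HexVertex)
                (m' : ℕ) (p' : HexVertex),
              IsFirstGoodGateN D.carrier (δ k) ρ R (S k) (a (δ k)) γ.walk.support (n k) m p (q k) ∧
              IsFirstGoodGateN D.carrier (δ k) ρ R (T k) (b (δ k)) γ.walk.support.reverse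
                (n' k) m' p' (q' k) ∧
              WideLink D.carrier (δ k) ρ (S k (n k) ∪ T k (n' k)) (q k) (q' k)) →
            (∀ k, IsProbabilityMeasure
              (carvedLaw D.carrier (δ k) (S k (n k) ∪ T k (n' k)) (q k) (q' k))) →
            (∀ η > (0 : ℝ), ∃ 𝒦 : Set (CurveClass ℂ), IsCompact 𝒦 ∧ ∀ᶠ k in atTop,
              carvedLaw D.carrier (δ k) (S k (n k) ∪ T k (n' k)) (q k) (q' k)
                {ξ | ξ.curve ∉ 𝒦} ≤ ENNReal.ofReal η) →
            (∀ ε' > (0 : ℝ), ∀ η > (0 : ℝ), ∃ θ > (0 : ℝ), ∀ᶠ k in atTop,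
              carvedLaw D.carrier (δ k) (S k (n k) ∪ T k (n' k)) (q k) (q' k)
                {ξ | ξ.curve ∉ CurveClass.modulusClass ε' θ} ≤ ENNReal.ofReal η) →
            ∀ᶠ k in atTop,
              |(∫ ξ, f ξ.curve ∂(carvedLaw D.carrier (δ k) (S k (n k) ∪ T k (n' k)) (q k) (q' k))) -
                  ∫ x, f x ∂ν| ≤ ε :=
  -- LANDED by the twin lead (14005 c3, skeleton r10): Theorems/SAWDefectDecoherenceObservableToSLERCoOrientedReductionSolid.lean
  Summit.CriticalPhenomena.SAWScalingLimit.Theorems.ObservableToSLER.CoOrientedSolid.stub_coOrientedReductionSolid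

/-- STUB (landed) — `HexTight → MidTightN` (p116996). -/
theorem stub_midTightN :
    HexTight →
    ∀ (D : DobrushinDomain) (a b : ℝ → HexVertex), IsEmbEndpointApprox hexGraph hexCenter D a b →
      ∃ R₂ > (0 : ℝ), ∀ R ∈ Set.Ioc (0 : ℝ) R₂, ∀ ρ > (0 : ℝ), ∀ N : ℕ, ∀ η > (0 : ℝ),
        ∃ 𝒦 : Set (CurveClass ℂ), IsCompact 𝒦 ∧
          ∀ᶠ δ : ℝ in 𝓝[>] 0, ∀ S T : ℕ → Set HexVertex,
            TameNestedFamily δ R N (a δ) S → TameNestedFamily δ R N (b δ) T →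
            hexSAWLaw D.carrier δ (a δ) (b δ)
              {γ | ∃ (n m : ℕ) (p q : HexVertex) (n' m' : ℕ) (p' q' : HexVertex),
                  IsFirstGoodGateN D.carrier δ ρ R S (a δ) γ.walk.support n m p q ∧
                  IsFirstGoodGateN D.carrier δ ρ R T (b δ) γ.walk.support.reverse n' m' p' q' ∧
                  ENNReal.ofReal η <
                    carvedLaw D.carrier δ (S n ∪ T n') q q' {ξ | ξ.curve ∉ 𝒦}} ≤
              ENNReal.ofReal η :=
  -- LANDED (wave 3: Theorems/SAWDefectDecoherenceObservableToSLERMidTightN.lean p116996, helper MidTightSubarc p116810)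
  Summit.CriticalPhenomena.SAWScalingLimit.Theorems.ObservableToSLER.NestedGate.stub_midTightN

/-- STUB T3 (LANDED by the twin line, p120791) — `HexUniformModulus → MidModulusN`. -/
theorem stub_midModulusN :
    (∀ (D : DobrushinDomain) (a b : ℝ → HexVertex), IsEmbEndpointApprox hexGraph hexCenter D a b →
      ∀ ε > (0 : ℝ), ∀ η > (0 : ℝ), ∃ θ > (0 : ℝ), ∀ᶠ δ : ℝ in 𝓝[>] 0,
        hexSAWLaw D.carrier δ (a δ) (b δ) {γ | γ.curve ∉ CurveClass.modulusClass ε θ} ≤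
          ENNReal.ofReal η) →
    ∀ (D : DobrushinDomain) (a b : ℝ → HexVertex), IsEmbEndpointApprox hexGraph hexCenter D a b →
      ∃ R₃ > (0 : ℝ), ∀ R ∈ Set.Ioc (0 : ℝ) R₃, ∀ ρ > (0 : ℝ), ∀ N : ℕ, ∀ ε > (0 : ℝ), ∀ η > (0 : ℝ),
        ∃ θ > (0 : ℝ),
          ∀ᶠ δ : ℝ in 𝓝[>] 0, ∀ S T : ℕ → Set HexVertex,
            TameNestedFamily δ R N (a δ) S → TameNestedFamily δ R N (b δ) T →
            hexSAWLaw D.carrier δ (a δ) (b δ)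
              {γ | ∃ (n m : ℕ) (p q : HexVertex) (n' m' : ℕ) (p' q' : HexVertex),
                  IsFirstGoodGateN D.carrier δ ρ R S (a δ) γ.walk.support n m p q ∧
                  IsFirstGoodGateN D.carrier δ ρ R T (b δ) γ.walk.support.reverse n' m' p' q' ∧
                  ENNReal.ofReal η <
                    carvedLaw D.carrier δ (S n ∪ T n') q q'
                      {ξ | ξ.curve ∉ CurveClass.modulusClass ε θ}} ≤
              ENNReal.ofReal η :=
  Summit.CriticalPhenomena.SAWScalingLimit.Theorems.ObservableToSLER.NestedGate.stub_midModulusN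

/-- STUB T4 (LANDED by the twin line, p120538) — the sequential reduction with tightness and modulus,
generic in the family constraint `P`. -/
theorem stub_seqReductionPM :
    ∀ (P : DobrushinDomain → (ℝ → HexVertex) → (ℝ → HexVertex) → ℝ → ℝ → ℝ → ℕ →
      (ℕ → Set HexVertex) → (ℕ → Set HexVertex) → Prop),
    (∀ (D : DobrushinDomain) (a b : ℝ → HexVertex), IsEmbEndpointApprox hexGraph hexCenter D a b →
        ∀ (ν : Measure (CurveClass ℂ)), IsSLELaw ((8 : ℝ≥0) / 3) D ν →
        ∀ (f : CurveClass ℂ →ᵇ ℝ) (ε : ℝ), 0 < ε →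
          ∃ R₀ > (0 : ℝ), ∀ R ∈ Set.Ioc (0 : ℝ) R₀, ∀ ρ > (0 : ℝ), ∀ N : ℕ,
            ∀ (δ : ℕ → ℝ) (S T : ℕ → ℕ → Set HexVertex) (n n' : ℕ → ℕ) (q q' : ℕ → HexVertex),
              Tendsto δ atTop (𝓝[>] 0) →
              (∀ k, TameNestedFamily (δ k) R N (a (δ k)) (S k) ∧
                TameNestedFamily (δ k) R N (b (δ k)) (T k) ∧
                P D a b (δ k) ρ R N (S k) (T k)) →
              (∀ k, ∃ (γ : HexDomainSAW D.carrier (δ k) (a (δ k)) (b (δ k))) (m : ℕ) (p : HexVertex)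
                  (m' : ℕ) (p' : HexVertex),
                IsFirstGoodGateN D.carrier (δ k) ρ R (S k) (a (δ k)) γ.walk.support (n k) m p (q k) ∧
                IsFirstGoodGateN D.carrier (δ k) ρ R (T k) (b (δ k)) γ.walk.support.reverse
                  (n' k) m' p' (q' k) ∧
                WideLink D.carrier (δ k) ρ (S k (n k) ∪ T k (n' k)) (q k) (q' k)) →
              (∀ k, IsProbabilityMeasure
                (carvedLaw D.carrier (δ k) (S k (n k) ∪ T k (n' k)) (q k) (q' k))) →
              (∀ η > (0 : ℝ), ∃ 𝒦 : Set (CurveClass ℂ), IsCompact 𝒦 ∧ ∀ᶠ k in atTop,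
                carvedLaw D.carrier (δ k) (S k (n k) ∪ T k (n' k)) (q k) (q' k)
                  {ξ | ξ.curve ∉ 𝒦} ≤ ENNReal.ofReal η) →
              (∀ ε' > (0 : ℝ), ∀ η > (0 : ℝ), ∃ θ > (0 : ℝ), ∀ᶠ k in atTop,
                carvedLaw D.carrier (δ k) (S k (n k) ∪ T k (n' k)) (q k) (q' k)
                  {ξ | ξ.curve ∉ CurveClass.modulusClass ε' θ} ≤ ENNReal.ofReal η) →
              ∀ᶠ k in atTop,
                |(∫ ξ, f ξ.curve ∂(carvedLaw D.carrier (δ k) (S k (n k) ∪ T k (n' k)) (q k) (q' k))) -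
                    ∫ x, f x ∂ν| ≤ ε) →
    (∀ (D : DobrushinDomain) (a b : ℝ → HexVertex), IsEmbEndpointApprox hexGraph hexCenter D a b →
        ∃ R₂ > (0 : ℝ), ∀ R ∈ Set.Ioc (0 : ℝ) R₂, ∀ ρ > (0 : ℝ), ∀ N : ℕ, ∀ η > (0 : ℝ),
          ∃ 𝒦 : Set (CurveClass ℂ), IsCompact 𝒦 ∧
            ∀ᶠ δ : ℝ in 𝓝[>] 0, ∀ S T : ℕ → Set HexVertex,
              TameNestedFamily δ R N (a δ) S → TameNestedFamily δ R N (b δ) T →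
              hexSAWLaw D.carrier δ (a δ) (b δ)
                {γ | ∃ (n m : ℕ) (p q : HexVertex) (n' m' : ℕ) (p' q' : HexVertex),
                    IsFirstGoodGateN D.carrier δ ρ R S (a δ) γ.walk.support n m p q ∧
                    IsFirstGoodGateN D.carrier δ ρ R T (b δ) γ.walk.support.reverse n' m' p' q' ∧
                    ENNReal.ofReal η <
                      carvedLaw D.carrier δ (S n ∪ T n') q q' {ξ | ξ.curve ∉ 𝒦}} ≤
                ENNReal.ofReal η) →
    (∀ (D : DobrushinDomain) (a b : ℝ → HexVertex), IsEmbEndpointApprox hexGraph hexCenter D a b →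
        ∃ R₃ > (0 : ℝ), ∀ R ∈ Set.Ioc (0 : ℝ) R₃, ∀ ρ > (0 : ℝ), ∀ N : ℕ, ∀ ε > (0 : ℝ), ∀ η > (0 : ℝ),
          ∃ θ > (0 : ℝ),
            ∀ᶠ δ : ℝ in 𝓝[>] 0, ∀ S T : ℕ → Set HexVertex,
              TameNestedFamily δ R N (a δ) S → TameNestedFamily δ R N (b δ) T →
              hexSAWLaw D.carrier δ (a δ) (b δ)
                {γ | ∃ (n m : ℕ) (p q : HexVertex) (n' m' : ℕ) (p' q' : HexVertex),
                    IsFirstGoodGateN D.carrier δ ρ R S (a δ) γ.walk.support n m p q ∧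
                    IsFirstGoodGateN D.carrier δ ρ R T (b δ) γ.walk.support.reverse n' m' p' q' ∧
                    ENNReal.ofReal η <
                      carvedLaw D.carrier δ (S n ∪ T n') q q'
                        {ξ | ξ.curve ∉ CurveClass.modulusClass ε θ}} ≤
                ENNReal.ofReal η) →
    ∀ (D : DobrushinDomain) (a b : ℝ → HexVertex), IsEmbEndpointApprox hexGraph hexCenter D a b →
      ∀ (ν : Measure (CurveClass ℂ)), IsSLELaw ((8 : ℝ≥0) / 3) D ν →
      ∀ (f : CurveClass ℂ →ᵇ ℝ) (ε : ℝ), 0 < ε →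
        ∃ R₀ > (0 : ℝ), ∀ R ∈ Set.Ioc (0 : ℝ) R₀, ∀ ρ > (0 : ℝ), ∀ N : ℕ,
          ∀ᶠ δ : ℝ in 𝓝[>] 0, ∀ S T : ℕ → Set HexVertex,
            TameNestedFamily δ R N (a δ) S → TameNestedFamily δ R N (b δ) T →
            P D a b δ ρ R N S T →
            hexSAWLaw D.carrier δ (a δ) (b δ)
              {γ | ∃ (n m : ℕ) (p q : HexVertex) (n' m' : ℕ) (p' q' : HexVertex),
                  IsFirstGoodGateN D.carrier δ ρ R S (a δ) γ.walk.support n m p q ∧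
                  IsFirstGoodGateN D.carrier δ ρ R T (b δ) γ.walk.support.reverse n' m' p' q' ∧
                  WideLink D.carrier δ ρ (S n ∪ T n') q q' ∧
                  ε < |(∫ ξ, f ξ.curve ∂(carvedLaw D.carrier δ (S n ∪ T n') q q')) - ∫ x, f x ∂ν|} ≤
              ENNReal.ofReal ε :=
  Summit.CriticalPhenomena.SAWScalingLimit.Theorems.ObservableToSLER.NestedGate.stub_seqReductionPM

/-- STUB (landed) — `∀ P, GateDecomposition → NestedRenewalP P → CarvedToSLENP P → FullIdentification`
(p117872). -/
theorem stub_nestedTransferP :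
    ∀ (P : DobrushinDomain → (ℝ → HexVertex) → (ℝ → HexVertex) → ℝ → ℝ → ℝ → ℕ →
      (ℕ → Set HexVertex) → (ℕ → Set HexVertex) → Prop),
    (∀ (Ω : Set ℂ) (δ : ℝ) (a b p q p' q' : HexVertex) (S T : Set HexVertex) (l₁ l₂ : List HexVertex)
       (B : Set (List HexVertex)),
       Disjoint S T →
       (∃ w₁ : (hexDomainGraph Ω δ).Walk a p, w₁.IsPath ∧ w₁.support = l₁ ∧ ∀ v ∈ l₁, v ∈ S) →
       (∃ w₂ : (hexDomainGraph Ω δ).Walk p' b, w₂.IsPath ∧ w₂.support = l₂ ∧ ∀ v ∈ l₂, v ∈ T) →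
       (hexDomainGraph Ω δ).Adj p q → (hexDomainGraph Ω δ).Adj q' p' →
       hexSAWWeight Ω δ a b
           {γ | ∃ mid ∈ B, mid.head? = some q ∧ mid.getLast? = some q' ∧
             (∀ v ∈ mid, v ∉ S ∧ v ∉ T) ∧ γ.walk.support = l₁ ++ mid ++ l₂} =
         ENNReal.ofReal (hexCriticalFugacity ^ (l₁.length + l₂.length)) *
           hexSAWWeight Ω δ q q'
             {γ | γ.walk.support ∈ B ∧ ∀ v ∈ γ.walk.support, v ∉ S ∧ v ∉ T}) →
    (∀ (D : DobrushinDomain) (a b : ℝ → HexVertex), IsEmbEndpointApprox hexGraph hexCenter D a b →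
       ∀ ε > (0 : ℝ), ∀ R > (0 : ℝ), ∃ ρ > (0 : ℝ), ∃ N : ℕ, ∀ᶠ δ : ℝ in 𝓝[>] 0,
         ∃ S T : ℕ → Set HexVertex,
           TameNestedFamily δ R N (a δ) S ∧ TameNestedFamily δ R N (b δ) T ∧
           P D a b δ ρ R N S T ∧
           hexSAWLaw D.carrier δ (a δ) (b δ)
               {γ | ¬ ∃ (n m : ℕ) (p q : HexVertex) (n' m' : ℕ) (p' q' : HexVertex),
                   IsFirstGoodGateN D.carrier δ ρ R S (a δ) γ.walk.support n m p q ∧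
                   IsFirstGoodGateN D.carrier δ ρ R T (b δ) γ.walk.support.reverse n' m' p' q' ∧
                   WideLink D.carrier δ ρ (S n ∪ T n') q q'} ≤
             ENNReal.ofReal ε) →
    (∀ (D : DobrushinDomain) (a b : ℝ → HexVertex), IsEmbEndpointApprox hexGraph hexCenter D a b →
       ∀ (ν : Measure (CurveClass ℂ)), IsSLELaw ((8 : ℝ≥0) / 3) D ν →
       ∀ (f : CurveClass ℂ →ᵇ ℝ) (ε : ℝ), 0 < ε →
         ∃ R₀ > (0 : ℝ), ∀ R ∈ Set.Ioc (0 : ℝ) R₀, ∀ ρ > (0 : ℝ), ∀ N : ℕ,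
           ∀ᶠ δ : ℝ in 𝓝[>] 0, ∀ S T : ℕ → Set HexVertex,
             TameNestedFamily δ R N (a δ) S → TameNestedFamily δ R N (b δ) T →
             P D a b δ ρ R N S T →
             hexSAWLaw D.carrier δ (a δ) (b δ)
               {γ | ∃ (n m : ℕ) (p q : HexVertex) (n' m' : ℕ) (p' q' : HexVertex),
                   IsFirstGoodGateN D.carrier δ ρ R S (a δ) γ.walk.support n m p q ∧
                   IsFirstGoodGateN D.carrier δ ρ R T (b δ) γ.walk.support.reverse n' m' p' q' ∧
                   WideLink D.carrier δ ρ (S n ∪ T n') q q' ∧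
                   ε < |(∫ ξ, f ξ.curve ∂(carvedLaw D.carrier δ (S n ∪ T n') q q')) - ∫ x, f x ∂ν|} ≤
               ENNReal.ofReal ε) →
    ∀ (D : DobrushinDomain) (a b : ℝ → HexVertex),
      IsEmbEndpointApprox hexGraph hexCenter D a b →
      ∀ μ : Measure (CurveClass ℂ), IsProbabilityMeasure μ →
        IsSubseqLimitLaw (fun δ (γ : HexDomainSAW D.carrier δ (a δ) (b δ)) => γ.curve)
          (fun δ => hexSAWLaw D.carrier δ (a δ) (b δ)) μ →
        IsSLELaw ((8 : ℝ≥0) / 3) D μ :=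
  Summit.CriticalPhenomena.SAWScalingLimit.Theorems.ObservableToSLER.NestedGate.stub_nestedTransferP

/-- STUB T6 (r3; LANDED p124665, lead c3, `TypeLadder.stub_nestedTransferPR`) — **the nested transfer with
the locality scale bounded**:
`∀ P, GateDecomposition → NestedRenewalPR P → CarvedToSLENP P → FullIdentification`.  Port of the landed
`stub_nestedTransferP` (p117872): its proof applies abundance only at `R := min (min R₀ R₁) (η/(2(3K+1)))`,
so one more `min` with `R₂(ε)` suffices. -/
theorem stub_nestedTransferPR :
    ∀ (P : DobrushinDomain → (ℝ → HexVertex) → (ℝ → HexVertex) → ℝ → ℝ → ℝ → ℕ →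
      (ℕ → Set HexVertex) → (ℕ → Set HexVertex) → Prop),
    (∀ (Ω : Set ℂ) (δ : ℝ) (a b p q p' q' : HexVertex) (S T : Set HexVertex) (l₁ l₂ : List HexVertex)
       (B : Set (List HexVertex)),
       Disjoint S T →
       (∃ w₁ : (hexDomainGraph Ω δ).Walk a p, w₁.IsPath ∧ w₁.support = l₁ ∧ ∀ v ∈ l₁, v ∈ S) →
       (∃ w₂ : (hexDomainGraph Ω δ).Walk p' b, w₂.IsPath ∧ w₂.support = l₂ ∧ ∀ v ∈ l₂, v ∈ T) →
       (hexDomainGraph Ω δ).Adj p q → (hexDomainGraph Ω δ).Adj q' p' →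
       hexSAWWeight Ω δ a b
           {γ | ∃ mid ∈ B, mid.head? = some q ∧ mid.getLast? = some q' ∧
             (∀ v ∈ mid, v ∉ S ∧ v ∉ T) ∧ γ.walk.support = l₁ ++ mid ++ l₂} =
         ENNReal.ofReal (hexCriticalFugacity ^ (l₁.length + l₂.length)) *
           hexSAWWeight Ω δ q q'
             {γ | γ.walk.support ∈ B ∧ ∀ v ∈ γ.walk.support, v ∉ S ∧ v ∉ T}) →
    (∀ (D : DobrushinDomain) (a b : ℝ → HexVertex), IsEmbEndpointApprox hexGraph hexCenter D a b →
       ∀ ε > (0 : ℝ), ∃ R₂ > (0 : ℝ), ∀ R ∈ Set.Ioc (0 : ℝ) R₂, ∃ ρ > (0 : ℝ), ∃ N : ℕ, ∀ᶠ δ : ℝ in 𝓝[>] 0,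
         ∃ S T : ℕ → Set HexVertex,
           TameNestedFamily δ R N (a δ) S ∧ TameNestedFamily δ R N (b δ) T ∧
           P D a b δ ρ R N S T ∧
           hexSAWLaw D.carrier δ (a δ) (b δ)
               {γ | ¬ ∃ (n m : ℕ) (p q : HexVertex) (n' m' : ℕ) (p' q' : HexVertex),
                   IsFirstGoodGateN D.carrier δ ρ R S (a δ) γ.walk.support n m p q ∧
                   IsFirstGoodGateN D.carrier δ ρ R T (b δ) γ.walk.support.reverse n' m' p' q' ∧
                   WideLink D.carrier δ ρ (S n ∪ T n') q q'} ≤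
             ENNReal.ofReal ε) →
    (∀ (D : DobrushinDomain) (a b : ℝ → HexVertex), IsEmbEndpointApprox hexGraph hexCenter D a b →
       ∀ (ν : Measure (CurveClass ℂ)), IsSLELaw ((8 : ℝ≥0) / 3) D ν →
       ∀ (f : CurveClass ℂ →ᵇ ℝ) (ε : ℝ), 0 < ε →
         ∃ R₀ > (0 : ℝ), ∀ R ∈ Set.Ioc (0 : ℝ) R₀, ∀ ρ > (0 : ℝ), ∀ N : ℕ,
           ∀ᶠ δ : ℝ in 𝓝[>] 0, ∀ S T : ℕ → Set HexVertex,
             TameNestedFamily δ R N (a δ) S → TameNestedFamily δ R N (b δ) T →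
             P D a b δ ρ R N S T →
             hexSAWLaw D.carrier δ (a δ) (b δ)
               {γ | ∃ (n m : ℕ) (p q : HexVertex) (n' m' : ℕ) (p' q' : HexVertex),
                   IsFirstGoodGateN D.carrier δ ρ R S (a δ) γ.walk.support n m p q ∧
                   IsFirstGoodGateN D.carrier δ ρ R T (b δ) γ.walk.support.reverse n' m' p' q' ∧
                   WideLink D.carrier δ ρ (S n ∪ T n') q q' ∧
                   ε < |(∫ ξ, f ξ.curve ∂(carvedLaw D.carrier δ (S n ∪ T n') q q')) - ∫ x, f x ∂ν|} ≤
               ENNReal.ofReal ε) →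
    ∀ (D : DobrushinDomain) (a b : ℝ → HexVertex),
      IsEmbEndpointApprox hexGraph hexCenter D a b →
      ∀ μ : Measure (CurveClass ℂ), IsProbabilityMeasure μ →
        IsSubseqLimitLaw (fun δ (γ : HexDomainSAW D.carrier δ (a δ) (b δ)) => γ.curve)
          (fun δ => hexSAWLaw D.carrier δ (a δ) (b δ)) μ →
        IsSLELaw ((8 : ℝ≥0) / 3) D μ :=
  Summit.CriticalPhenomena.SAWScalingLimit.Theorems.ObservableToSLE.TypeLadder.stub_nestedTransferPR

/-- STUB T5ₐ `stub_hexSimpleSubseqLimits` (r7, NEW leaf replacing T5 as a leaf; = twin r8/r9 stub 5mₐ, SAME signature) —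
**`HexSimpleSubseqLimits`, VERBATIM the EXISTING shared item stmt-CriticalPhenomena-7148**
(`SAWLatticeVirasoro.HexSimpleSubseqLimits`, support, open-problem): every probability weak limit of the pushed-forward
critical hexagonal SAW laws along a mesh sequence is carried by SIMPLE curve classes from `pt 0` to `pt 1` inside
`closure D` meeting `∂D` only at the marked points.  Research-grade, but an ITEM of the ledger: the modulus input of the
line is from r7 on a dependency on an existing item, not a private stub. -/
theorem stub_hexSimpleSubseqLimits :
    ∀ (D : DobrushinDomain) (a b : ℝ → HexVertex), IsEmbEndpointApprox hexGraph hexCenter D a b →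
      ∀ (s : ℕ → ℝ) (ν : Measure (CurveClass ℂ)), Tendsto s atTop (𝓝[>] 0) → IsProbabilityMeasure ν →
        (∀ f : CurveClass ℂ →ᵇ ℝ,
          Tendsto (fun n => ∫ γ, f γ.curve ∂(hexSAWLaw D.carrier (s n) (a (s n)) (b (s n)))) atTop
            (𝓝 (∫ x, f x ∂ν))) →
        ∀ᵐ γ ∂ν, γ ∈ CurveClass.simple ∧ γ.source = D.pt 0 ∧ γ.target = D.pt 1 ∧
          γ.range ⊆ closure D.carrier ∧ γ.range ∩ frontier D.carrier ⊆ {D.pt 0, D.pt 1} := by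
  sorry

/-- T5ₐ / 5mₐ is VERBATIM the shared item stmt-CriticalPhenomena-7148 `SAWLatticeVirasoro.HexSimpleSubseqLimits`. -/
theorem hexSimpleSubseqLimits_iff :
    (∀ (D : DobrushinDomain) (a b : ℝ → HexVertex), IsEmbEndpointApprox hexGraph hexCenter D a b →
      ∀ (s : ℕ → ℝ) (ν : Measure (CurveClass ℂ)), Tendsto s atTop (𝓝[>] 0) → IsProbabilityMeasure ν →
        (∀ f : CurveClass ℂ →ᵇ ℝ,
          Tendsto (fun n => ∫ γ, f γ.curve ∂(hexSAWLaw D.carrier (s n) (a (s n)) (b (s n)))) atTop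
            (𝓝 (∫ x, f x ∂ν))) →
        ∀ᵐ γ ∂ν, γ ∈ CurveClass.simple ∧ γ.source = D.pt 0 ∧ γ.target = D.pt 1 ∧
          γ.range ⊆ closure D.carrier ∧ γ.range ∩ frontier D.carrier ⊆ {D.pt 0, D.pt 1}) ↔
    Summit.CriticalPhenomena.SAWScalingLimit.Theses.SAWLatticeVirasoro.HexSimpleSubseqLimits :=
  Iff.rfl

/-- STUB T5_b (r7; LANDED p127640 by the twin lead c3, `ObservableToSLER.Modulus.stub_hexUniformModulus_of_simpleLimits`) —
**the uniform injectivity modulus from tightness and simplicity of all subsequential limits**: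
`HexTight → HexSimpleSubseqLimits → HexUniformModulus` (all three inlined; Prokhorov + the thickened-modulus lemma +
portmanteau). -/
theorem stub_hexUniformModulus_of_simpleLimits :
    (∀ (D : DobrushinDomain) (a b : ℝ → HexVertex), IsEmbEndpointApprox hexGraph hexCenter D a b →
      IsTightAlongMesh (fun δ (γ : HexDomainSAW D.carrier δ (a δ) (b δ)) => γ.curve)
        (fun δ => hexSAWLaw D.carrier δ (a δ) (b δ))) →
    (∀ (D : DobrushinDomain) (a b : ℝ → HexVertex), IsEmbEndpointApprox hexGraph hexCenter D a b →
      ∀ (s : ℕ → ℝ) (ν : Measure (CurveClass ℂ)), Tendsto s atTop (𝓝[>] 0) → IsProbabilityMeasure ν →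
        (∀ f : CurveClass ℂ →ᵇ ℝ,
          Tendsto (fun n => ∫ γ, f γ.curve ∂(hexSAWLaw D.carrier (s n) (a (s n)) (b (s n)))) atTop
            (𝓝 (∫ x, f x ∂ν))) →
        ∀ᵐ γ ∂ν, γ ∈ CurveClass.simple ∧ γ.source = D.pt 0 ∧ γ.target = D.pt 1 ∧
          γ.range ⊆ closure D.carrier ∧ γ.range ∩ frontier D.carrier ⊆ {D.pt 0, D.pt 1}) →
    ∀ (D : DobrushinDomain) (a b : ℝ → HexVertex), IsEmbEndpointApprox hexGraph hexCenter D a b →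
      ∀ ε > (0 : ℝ), ∀ η > (0 : ℝ), ∃ θ > (0 : ℝ), ∀ᶠ δ : ℝ in 𝓝[>] 0,
        hexSAWLaw D.carrier δ (a δ) (b δ) {γ | γ.curve ∉ CurveClass.modulusClass ε θ} ≤
          ENNReal.ofReal η :=
  Summit.CriticalPhenomena.SAWScalingLimit.Theorems.ObservableToSLER.Modulus.stub_hexUniformModulus_of_simpleLimits

/-- T5 (r7: GLUE over T5ₐ, T5_b and the crux's own hypothesis `HexTight`) — `HexTight → HexUniformModulus`. -/
theorem hexUniformModulus_of_tight (hT : HexTight) : HexUniformModulus :=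
  stub_hexUniformModulus_of_simpleLimits hT stub_hexSimpleSubseqLimits

/-! ## Consistency (r6): every registered stub is definitionally the typed statement it names -/

/-- landed stub is `GateDecomposition`. -/
theorem gateDecomposition_of_stub : GateDecomposition := stub_gateDecomposition

/-- S1 (r6) is `NestedRenewalFatCoSolidR = NestedRenewalPR FatAnchoredCoOrientedSolid`. -/
theorem nestedRenewalFatCoSolidR_of_stub : NestedRenewalFatCoSolidR := stub_nestedRenewalFatCoSolidR

-- The r1/r2 abundance input `NestedRenewalFatCo` — indeed every `NestedRenewalP P` — is FALSE: landed certificate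
-- `Summit.CriticalPhenomena.SAWScalingLimit.Theorems.ObservableToSLE.TypeLadder.stub_not_nestedRenewalP` (p124536).

/-- T6 is `∀ P, GateDecomposition → NestedRenewalPR P → CarvedToSLENP P → FullIdentification`. -/
theorem fullIdentification_of_stubR (P : DobrushinDomain → (ℝ → HexVertex) → (ℝ → HexVertex) → ℝ → ℝ → ℝ → ℕ →
      (ℕ → Set HexVertex) → (ℕ → Set HexVertex) → Prop)
    (h1 : GateDecomposition) (h2 : NestedRenewalPR P) (h5 : CarvedToSLENP P) : FullIdentification :=
  stub_nestedTransferPR P h1 h2 h5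

/-- landed stub is `SLELawContinuity`. -/
theorem sleLawContinuity_of_stub : SLELawContinuity := stub_sleLawContinuity

/-- T1⁻ is `MacroSourceLocality`. -/
theorem macroSourceLocality_of_stub : MacroSourceLocality := stub_macroSourceLocality

/-- The r1–r10 anchor T1 `TwoPieceSourceLocality` still implies the weakened one (LANDED, p145850). -/
theorem macroSourceLocality_of_twoPiece (h : TwoPieceSourceLocality) : MacroSourceLocality :=
  Summit.CriticalPhenomena.SAWScalingLimit.Theorems.ObservableToSLER.Macro.macroSourceLocality_of_twoPieceSourceLocality h

/-- T2a is `TwoPieceAdmRestrictionLimit → TwoPieceAdmIdentification`. -/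
theorem admIdentification_of_stub (h : TwoPieceAdmRestrictionLimit) : TwoPieceAdmIdentification :=
  stub_twoPieceAdmIdentification h

/-- T2b″ is `TwoPieceAdmRestrictionLimit → MovingCarvingSqueezeP FatAnchoredClassZeroSolid`. -/
theorem movingCarvingSqueezeSolid_of_stub (h : TwoPieceAdmRestrictionLimit) :
    MovingCarvingSqueezeP FatAnchoredClassZeroSolid :=
  stub_carvedReduction_squeezeSolid h

/-- T2c is `∀ P, MovingCarvingSqueezeP P → TwoPieceAdmIdentification → SLELawContinuity → CarvedSeqIdentificationPM P`. -/
theorem assemblyP_of_stub (P : DobrushinDomain → (ℝ → HexVertex) → (ℝ → HexVertex) → ℝ → ℝ → ℝ → ℕ →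
      (ℕ → Set HexVertex) → (ℕ → Set HexVertex) → Prop)
    (h1 : MovingCarvingSqueezeP P) (h2 : TwoPieceAdmIdentification) (h3 : SLELawContinuity) :
    CarvedSeqIdentificationPM P :=
  stub_carvedReduction_assemblyP P h1 h2 h3

/-- r4's `MovingCarvingSqueeze` is the instance `P := FatAnchoredClassZero` of `MovingCarvingSqueezeP`. -/
theorem movingCarvingSqueezeP_classZero_iff :
    MovingCarvingSqueezeP FatAnchoredClassZero ↔ MovingCarvingSqueeze := Iff.rfl

/-- S2′ is `CarvedSeqIdentificationPM FatAnchoredClassZeroSolid → CarvedSeqIdentificationPM FatAnchoredCoOrientedSolid`. -/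
theorem csiFatCoOrientedSolid_of_stub (h : CarvedSeqIdentificationPM FatAnchoredClassZeroSolid) :
    CarvedSeqIdentificationPM FatAnchoredCoOrientedSolid :=
  stub_coOrientedReductionSolid h

/-- S2 (LANDED p123341) remains available for the r1–r5 classes:
`CarvedSeqIdentificationPM FatAnchoredClassZero → CarvedSeqIdentificationPM FatAnchoredCoOriented`. -/
theorem csiFatCoOriented_of_landed (h : CarvedSeqIdentificationPM FatAnchoredClassZero) :
    CarvedSeqIdentificationPM FatAnchoredCoOriented :=
  Summit.CriticalPhenomena.SAWScalingLimit.Theorems.ObservableToSLE.TypeLadder.stub_coOrientedReduction h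

/-- landed stub is `HexTight → MidTightN`. -/
theorem midTightN_of_stub (hT : HexTight) : MidTightN := stub_midTightN hT

/-- T3 is `HexUniformModulus → MidModulusN`. -/
theorem midModulusN_of_stub (hU : HexUniformModulus) : MidModulusN := stub_midModulusN hU

/-- T4 is `∀ P, CarvedSeqIdentificationPM P → MidTightN → MidModulusN → CarvedToSLENP P`. -/
theorem carvedToSLENP_of_stub (P : DobrushinDomain → (ℝ → HexVertex) → (ℝ → HexVertex) → ℝ → ℝ → ℝ → ℕ →
      (ℕ → Set HexVertex) → (ℕ → Set HexVertex) → Prop)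
    (hC : CarvedSeqIdentificationPM P) (hM : MidTightN) (hU : MidModulusN) : CarvedToSLENP P :=
  stub_seqReductionPM P hC hM hU

/-- T5ₐ is item stmt-CriticalPhenomena-7148 (`SAWLatticeVirasoro.HexSimpleSubseqLimits`), and with `HexTight` gives
`HexUniformModulus`. -/
theorem hexUniformModulus_of_stub (hT : HexTight) : HexUniformModulus := hexUniformModulus_of_tight hT

/-- `FatAnchoredClassZeroSolid` is the instance `j = 0` of `FatAnchoredCoOrientedSolid` (sanity of the NEW
constraint: the solid class-zero families are admissible here). -/
theorem fatAnchoredCoOrientedSolid_of_classZero (D : DobrushinDomain) (a b : ℝ → HexVertex) (δ ρ R : ℝ)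
    (N : ℕ) (S T : ℕ → Set HexVertex) (h : FatAnchoredClassZeroSolid D a b δ ρ R N S T) :
    FatAnchoredCoOrientedSolid D a b δ ρ R N S T := by
  obtain ⟨⟨hS, hT, hWS, hWT⟩, hFS, hFT, hPS, hPT⟩ := h
  refine ⟨hS, hT, 0, ⟨hWS, hWT⟩, ?_, ?_, hPS, hPT⟩
  · intro n p q hw
    obtain ⟨K, hK, hKc, hq, hc, hv⟩ := hFS n p q hw
    exact ⟨K, hK, hKc, by simpa using hq, hc, hv⟩
  · intro n p q hw
    obtain ⟨K, hK, hKc, hq, hc, hv⟩ := hFT n p q hw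
    exact ⟨K, hK, hKc, by simpa using hq, hc, hv⟩

/-- Hence the twin's abundance, re-typed with bounded locality scale and solid families, implies this line's:
`NestedRenewalPR FatAnchoredClassZeroSolid → NestedRenewalFatCoSolidR`. -/
theorem nestedRenewalFatCoSolidR_of_fatR (h : NestedRenewalPR FatAnchoredClassZeroSolid) :
    NestedRenewalFatCoSolidR := by
  intro D a b hab ε hε
  obtain ⟨R₂, hR₂, h⟩ := h D a b hab ε hε
  refine ⟨R₂, hR₂, fun R hR => ?_⟩
  obtain ⟨ρ, hρ, N, hN⟩ := h R hR
  refine ⟨ρ, hρ, N, hN.mono fun δ hδ => ?_⟩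
  obtain ⟨S, T, hS, hT, hP, hbad⟩ := hδ
  exact ⟨S, T, hS, hT, fatAnchoredCoOrientedSolid_of_classZero D a b δ ρ R N S T hP, hbad⟩

/-- Solid families are fat anchored families (forgetting the spines). -/
theorem fatAnchoredCoOriented_of_solid (D : DobrushinDomain) (a b : ℝ → HexVertex) (δ ρ R : ℝ)
    (N : ℕ) (S T : ℕ → Set HexVertex) (h : FatAnchoredCoOrientedSolid D a b δ ρ R N S T) :
    FatAnchoredCoOriented D a b δ ρ R N S T := by
  obtain ⟨hS, hT, j, hW, hFS, hFT, -, -⟩ := h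
  exact ⟨hS, hT, j, hW, hFS, hFT⟩

/-- The identification input of r6 from the stubs:
`R → HexTight → SLELawContinuity → CarvedToSLENP FatAnchoredCoOrientedSolid`. -/
theorem carvedToSLENFatCoSolid_of_stubs (hO : HexObservableLimitR) (hT : HexTight) (hS : SLELawContinuity) :
    CarvedToSLENP FatAnchoredCoOrientedSolid :=
  stub_seqReductionPM FatAnchoredCoOrientedSolid
    (stub_coOrientedReductionSolid (csiFatClassZeroSolid_of hO stub_macroSourceLocality hS))
    (stub_midTightN hT) (stub_midModulusN (hexUniformModulus_of_tight hT))

/-! ## Composition (sorry-free): the skeleton concludes the crux BY NAME -/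

/-- **`ObservableToSLE` from the registered stubs (r6)**, through the landed soft half
`convergesInLawToSLE_of_identification`: `R` enters only through T2 (class `(0,0)` data),
`HexTight` through `MidTightN` and Prokhorov; the OPEN inputs are S1 (abundance, co-oriented solid), T1
(anchor), T5 (modulus); the provable glue still open is T2b″, T2c, S2′. -/
theorem ObservableToSLER_of : ObservableToSLER := by
  intro hO hT D a b hab
  have hfull : FullIdentification :=
    stub_nestedTransferPR FatAnchoredCoOrientedSolid stub_gateDecomposition stub_nestedRenewalFatCoSolidR
      (carvedToSLENFatCoSolid_of_stubs hO hT stub_sleLawContinuity)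
  exact Summit.CriticalPhenomena.SAWScalingLimit.Theorems.ObservableToSLE.Negative.convergesInLawToSLE_of_identification
    hab (hT D a b hab) (hfull D a b hab)

end Summit.CriticalPhenomena.SAWScalingLimit.Cruxes.ObservableToSLER.BridgeGateRenewal

end
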